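import Literature.MathematicalPhysics.QuantumFieldTheory.LatticeGaugePlaquetteLowerBound
import Literature.MathematicalPhysics.QuantumFieldTheory.StrongCouplingActivities
import Literature.MathematicalPhysics.QuantumLattice.SU2Haar
import Mathlib.LinearAlgebra.Matrix.Swap
import HarnessLib

/-!
# Low-degree Haar moments on `SU(N)` (second, third, bidegree-(2,2), trace fourth moment) — re-homed proofs, file 1 of 2 of the toron-plane anticorrelation

**Griffiths II FAILS for `SU(N)` Wilson plaquette energies, every `N ≥ 2` — the barrier fact
`Literature.Barriers.QuantumFields.ToronPlaneAnticorrelation` (`Literature/Barriers/QuantumFields/ToronPlaneAnticorrelation.lean`) HOLDS**: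
for every `N ≥ 2` there are a periodic torus `(ℤ/L)⁴` and a coupling `β > 0` at which the `SU(N)` Wilson plaquette energies `Re tr U_p` of the
two plaquettes through the origin in complementary planes are NEGATIVELY correlated.  Witness (W1) of the barrier file: the one-site
(Eguchi–Kawai) torus `L = 1`, where `Cov_β(Re tr U_(0;01), Re tr U_(0;23))` vanishes at `β = 0` (`oneSiteCovAtZero_proof`: independence of
disjoint link pairs under product Haar measure) and has derivative `(4/N²)·κ_N` there (`oneSiteCovDerivative_proof`: the first
`β`-cumulant of the Gibbs-tilted product Haar measure; the two in-plane plaquettes contribute `0`, the four mixed planes `κ_N/N²` each after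
the inner Schur integration `∫ Re tr(g h g⁻¹ h⁻¹) dh = |tr g|²/N`) with the exact two-matrix Haar moment
`κ_N = ∫∫(|tr X|²−1)(|tr Y|²−1) Re tr(XYX⁻¹Y⁻¹) dX dY = −1/(N(N²−1)) < 0` (`commutatorSkewMoment_proof`; degree-two and bidegree-(2,2)
invariant integration on `SU(N)` done by hand: B. Collins, P. Śniady, CMP 264 (2006) Cor. 2.4 [CollinsSniady2006]); one line of real
analysis (`f(0) = 0`, `f′(0) < 0 ⇒ f(β) < 0` for some small `β > 0`) finishes.  Consequently (`ToronPlaneAnticorrelation.exists_not_forall_admits`,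
proved in the barrier file) for every `N ≥ 2` NO product-closed local association criterion (FKG/Holley, Ginibre systems, monotone
couplings) admits all the `SU(N)` Wilson plaquette terms of that arena [Ginibre1970] [Wilson1974].  The in-tree proof lived on the Summits
side only (`Summits/QuantumFields/YangMills/Theorems/ToronPlaneAnticorrelation.lean`, route `ToronCumulantSign`, plus the Haar-moment
modules of the YMGap venture).  RE-HOMED into `Literature/` by the Hodge foundations lane (`lit-hodgefound`, seat p20, generation 38) as
TWO theorem-only files: verbatim DECLARATION-LEVEL ports (the declarations needed, in dependency order; the sources' `local notation3`
shorthands EXPANDED in place, so no notation is declared) of `Summits/Ventures/YMGap/{RobustBall/HaarSecondMoments,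
Thresholds/HaarFourthMoment{SUN,SUNCross,,SU2Entries,SUNTrace},Thresholds/HaarThirdMomentSU3}.lean` and
`Summits/QuantumFields/YangMills/Theorems/ToronCumulantSign{HaarTwist,HaarMoments22,InnerMoment,CommutatorSkewMoment,OneSiteMoments,OneSiteFubini,
OneSiteExpectations,TiltDerivative,OneSiteCovDerivative,OneSiteCovAtZero}.lean`, namespaces `Summit.Ventures.YMGap.…` re-rooted as
`Literature.MathematicalPhysics.QuantumFieldTheory.HaarMoments.…` and `Summit.QuantumFields.YangMills.Theorems.ToronCumulantSign` as
`Literature.MathematicalPhysics.QuantumFieldTheory.ToronCumulant` (the three route crux statements of `Theses/ToronCumulantSign.lean` UNFOLDED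
verbatim into the crux theorems; the route's deciding theorem `closes` inlined into the discharge).  Built on the tree's Literature layer
(`MathematicalPhysics/QuantumLattice/*`, `MathematicalPhysics/QuantumFieldTheory/*`, `Barriers/QuantumFields/ToronPlaneAnticorrelation`) and
Mathlib only; no definition, no new named fact (D-0026), no Summits import.  HONEST LABEL: a BARRIER-LEDGER result (a certified
obstruction: positive association of non-abelian plaquette energies cannot be certified by any product-closed local criterion); it proves
nothing about the Yang–Mills mass gap or any lattice-to-continuum statement.
THIS FILE (1 of 2): the Haar-moment library on `SU(N)` — second moments and the twist/swap invariances, the degree-two and bidegree-(2,2)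
moments `∫|U_{ij}|²|U_{kl}|²`, `∫ U_{ij}U_{kl}\bar U_{il}\bar U_{kj}`, the `SU(2)` entries, the inner Schur integral and the trace
fourth moment `E|tr U|⁴ = 2` (`N ≥ 2`).
-/

noncomputable section

/-!
## Part 1 — port of `Summits/Ventures/YMGap/RobustBall/HaarSecondMoments.lean` (21 declarations kept)

# Robust ball (Y2), area-law side — the Haar second moments of `SU(N)` and the EXACT character variance
`V₀ = ∫ (Re tr U)² dU`

HONEST FRAMING: venture file of the cell `pub-ymgap` (QuantumFields programme), track ROBUST-BALL, seat rb-p2 (g5).  Pure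
compact-group integration, nothing lattice-specific: for a compact group `G ≅ SU(N)` (`IsSpecialUnitaryModel ρ`, the tree's
standing hypothesis for the gauge group) we compute the quadratic Haar moments of the matrix entries EXACTLY,
`∫ ρ(g)_{ai} conj(ρ(g)_{bk}) dg = δ_{ab} δ_{ik} / N` (`integral_entry_mul_conj_entry`) — the first Weingarten /
Schur-orthogonality relation of the fundamental representation — by nothing more than the two-sided invariance of the Haar
probability measure under three explicit special unitary matrices (a diagonal phase `diag(…, i, …, −i, …)` acting on the left
and on the right, and a signed transposition acting on the right) and the unitarity row sum `Σ_i |U_{ai}|² = 1`.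
Consequences: `∫ |tr ρ(g)|² dg = 1` (`integral_normSq_trace`: the fundamental character has norm one), `∫ (tr ρ(g))² dg = 0`
for `N ≥ 3` (centre twist by `e^{2πi/N}`, whose square is `≠ 1`), the trace of `SU(2)` is real, and therefore THE CHARACTER
VARIANCE OF THE TREE (`PlaquetteLowerBound.charVariance ρ = ∫ (Re tr ρ)² dHaar`, the constant `V₀` in the plaquette floor
`u₀ = β e^{−8(d−1)Nβ} V₀ / (2(d−1)N)` of `PlaquettePositivity` / `WilsonStringTension.stringTension_le`) IS
`V₀ = 1` for `N = 2` and `V₀ = 1/2` for `N ≥ 3` (`charVariance_eq_one`, `charVariance_eq_half`, `half_le_charVariance`);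
previously the tree only knew `V₀ > 0` (`charVariance_pos`) and, for `SU(2)`, `V₀ ≥ 49/4096` (`charVariance_su2_ge`).
WHAT IT IS NOT: no higher Weingarten calculus, no Peter–Weyl; nothing continuum / spectral / Clay.  Used by the sibling file
`StringTensionSharp` (sharp explicit string-tension ceilings for every `N`).

References: M. Creutz, *Quarks, gluons and lattices* (1983) §8 eq. (8.19)–(8.20) (`∫ dU U_{ij} U†_{kl} = δ_{il} δ_{jk}/n`);
B. Collins, IMRN 2003:17, 953 (Weingarten calculus, for context only); T. Bröcker, T. tom Dieck, GTM 98 (1985) II (4.11)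
(Schur orthogonality).  Everything here is proved; no definition, no named fact. [folklore]

(Verbatim declaration-level port — the declarations listed in the Part header count — of the Summits-side module; route
bookkeeping of the source docstring, if any, is historical; `local notation3` shorthands of the source are expanded in place.)
-/

section Part1

open _root_.MeasureTheory _root_.Complex ComplexConjugate _root_.Finset
open Literature.MathematicalPhysics.QuantumLattice Literature.MathematicalPhysics.QuantumFieldTheory

namespace Literature.MathematicalPhysics.QuantumFieldTheory.HaarMoments.RobustBall

namespace HaarSecondMoments

/-! ### Three special unitary matrices -/

section Matrices

variable {N : ℕ}

/-- The diagonal phase matrix `diag(…, i (at a), …, −i (at b), …, 1 …)` lies in `SU(N)` (`a ≠ b`). [cite: CollinsSniady2006, Cor. 2.4 (invariant integration on U(N)/SU(N): low-degree Haar moments; bookkeeping)] -/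
theorem diagonal_phase_mem (a b : Fin N) (hab : a ≠ b) :
    Matrix.diagonal (Pi.mulSingle a Complex.I * Pi.mulSingle b (-Complex.I) : Fin N → ℂ) ∈
      Matrix.specialUnitaryGroup (Fin N) ℂ := by
  rw [Matrix.mem_specialUnitaryGroup_iff]
  refine ⟨?_, ?_⟩
  · rw [Matrix.mem_unitaryGroup_iff, Matrix.star_eq_conjTranspose, Matrix.diagonal_conjTranspose,
      Matrix.diagonal_mul_diagonal, ← Matrix.diagonal_one]
    congr 1; funext j; simp only [Pi.mul_apply, Pi.star_apply]
    rcases eq_or_ne j a with rfl | hja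
    · simp [Pi.mulSingle_eq_of_ne hab, Complex.conj_I]
    · rcases eq_or_ne j b with rfl | hjb
      · simp [Pi.mulSingle_eq_of_ne hja, Complex.conj_I]
      · simp [Pi.mulSingle_eq_of_ne hja, Pi.mulSingle_eq_of_ne hjb]
  · rw [Matrix.det_diagonal]
    simp only [Pi.mul_apply]
    rw [Finset.prod_mul_distrib, Fintype.prod_pi_mulSingle', Fintype.prod_pi_mulSingle', mul_neg, Complex.I_mul_I,
      neg_neg]

/-- The signed transposition `swap(a,b) · diag(…, −1 (at a), …)` (a rotation by a right angle in the `(a,b)` coordinate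
plane) lies in `SU(N)` (`a ≠ b`). [cite: CollinsSniady2006, Cor. 2.4 (invariant integration on U(N)/SU(N): low-degree Haar moments; bookkeeping)] -/
theorem swap_mul_sign_mem (a b : Fin N) (hab : a ≠ b) :
    Matrix.swap ℂ a b * Matrix.diagonal (Pi.mulSingle a (-1 : ℂ)) ∈ Matrix.specialUnitaryGroup (Fin N) ℂ := by
  rw [Matrix.mem_specialUnitaryGroup_iff]
  refine ⟨?_, ?_⟩
  · have h1 : Matrix.swap ℂ a b ∈ Matrix.unitaryGroup (Fin N) ℂ := by
      rw [Matrix.mem_unitaryGroup_iff, Matrix.star_eq_conjTranspose, Matrix.conjTranspose_swap,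
        Matrix.swap_mul_self]
    have h2 : Matrix.diagonal (Pi.mulSingle a (-1 : ℂ)) ∈ Matrix.unitaryGroup (Fin N) ℂ := by
      rw [Matrix.mem_unitaryGroup_iff, Matrix.star_eq_conjTranspose, Matrix.diagonal_conjTranspose,
        Matrix.diagonal_mul_diagonal, ← Matrix.diagonal_one]
      congr 1; funext j; simp only [Pi.star_apply]
      rcases eq_or_ne j a with rfl | hja
      · simp
      · simp [Pi.mulSingle_eq_of_ne hja]
    exact mul_mem h1 h2
  · rw [Matrix.det_mul, Matrix.swap, Matrix.det_permutation, Equiv.Perm.sign_swap hab, Matrix.det_diagonal,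
      Fintype.prod_pi_mulSingle']
    simp

end Matrices

/-! ### Haar invariance through the model `ρ : G ≅ SU(N)` -/

section Moments

variable {N : ℕ} {G : Type*} [Group G] [TopologicalSpace G] [IsTopologicalGroup G] [CompactSpace G]
  [MeasurableSpace G] [BorelSpace G] (ρ : G →* Matrix (Fin N) (Fin N) ℂ)

omit [IsTopologicalGroup G] [CompactSpace G] [MeasurableSpace G] [BorelSpace G] in
/-- Every special unitary matrix is a value of `ρ`. [cite: CollinsSniady2006, Cor. 2.4 (invariant integration on U(N)/SU(N): low-degree Haar moments; bookkeeping)] -/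
theorem exists_eq_of_mem (hρ : IsSpecialUnitaryModel ρ) {S : Matrix (Fin N) (Fin N) ℂ}
    (hS : S ∈ Matrix.specialUnitaryGroup (Fin N) ℂ) : ∃ z : G, ρ z = S := by
  exact (show S ∈ Set.range ρ by rw [hρ.2.2]; exact hS)

/-- **Left invariance through the model**: `∫ F(S ρ(g)) dg = ∫ F(ρ(g)) dg` for every `S ∈ SU(N)`. [cite: CollinsSniady2006, Cor. 2.4 (invariant integration on U(N)/SU(N): low-degree Haar moments; bookkeeping)] -/
theorem integral_comp_mul_left (hρ : IsSpecialUnitaryModel ρ) {S : Matrix (Fin N) (Fin N) ℂ}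
    (hS : S ∈ Matrix.specialUnitaryGroup (Fin N) ℂ) {E : Type*} [NormedAddCommGroup E] [NormedSpace ℝ E]
    (F : Matrix (Fin N) (Fin N) ℂ → E) :
    ∫ g, F (S * ρ g) ∂haarProbability G = ∫ g, F (ρ g) ∂haarProbability G := by
  obtain ⟨z, hz⟩ := exists_eq_of_mem ρ hρ hS
  simpa only [map_mul, hz] using integral_mul_left_eq_self (μ := haarProbability G) (fun g => F (ρ g)) z

/-- **Right invariance through the model**: `∫ F(ρ(g) S) dg = ∫ F(ρ(g)) dg` for every `S ∈ SU(N)` (compact groups are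
unimodular, `haarProbability.instIsMulRightInvariant`). [cite: CollinsSniady2006, Cor. 2.4 (invariant integration on U(N)/SU(N): low-degree Haar moments; bookkeeping)] -/
theorem integral_comp_mul_right (hρ : IsSpecialUnitaryModel ρ) {S : Matrix (Fin N) (Fin N) ℂ}
    (hS : S ∈ Matrix.specialUnitaryGroup (Fin N) ℂ) {E : Type*} [NormedAddCommGroup E] [NormedSpace ℝ E]
    (F : Matrix (Fin N) (Fin N) ℂ → E) :
    ∫ g, F (ρ g * S) ∂haarProbability G = ∫ g, F (ρ g) ∂haarProbability G := by
  obtain ⟨z, hz⟩ := exists_eq_of_mem ρ hρ hS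
  simpa only [map_mul, hz] using integral_mul_right_eq_self (μ := haarProbability G) (fun g => F (ρ g)) z

/-- Products of an entry and a conjugated entry of `ρ(g)` are Haar integrable (continuous on a compact group). [cite: CollinsSniady2006, Cor. 2.4 (invariant integration on U(N)/SU(N): low-degree Haar moments; bookkeeping)] -/
theorem integrable_entry_mul_conj_entry (hρ : Continuous ρ) (a i b k : Fin N) :
    Integrable (fun g => ρ g a i * (starRingEnd ℂ) (ρ g b k)) (haarProbability G) :=
  ((hρ.matrix_elem a i).mul (Complex.continuous_conj.comp (hρ.matrix_elem b k))).integrable_of_hasCompactSupport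
    (HasCompactSupport.of_compactSpace _)

/-- A complex integral equal to its own negative vanishes. [cite: CollinsSniady2006, Cor. 2.4 (invariant integration on U(N)/SU(N): low-degree Haar moments; bookkeeping)] -/
theorem integral_eq_zero_of_neg {f : G → ℂ}
    (h : ∫ g, -f g ∂haarProbability G = ∫ g, f g ∂haarProbability G) :
    ∫ g, f g ∂haarProbability G = 0 := by
  rw [integral_neg] at h
  exact add_self_eq_zero.mp (neg_eq_iff_add_eq_zero.mp h)

/-! ### The quadratic moments of the entries -/

/-- **Different rows are orthogonal in mean**: `∫ ρ(g)_{ai} conj(ρ(g)_{bk}) dg = 0` for `a ≠ b` (left twist by the phase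
`diag(i at a, −i at b)`: the integrand changes sign). [cite: CollinsSniady2006, Cor. 2.4 (invariant integration on U(N)/SU(N): low-degree Haar moments; bookkeeping)] -/
theorem integral_entry_mul_conj_entry_eq_zero_of_row_ne (hρ : IsSpecialUnitaryModel ρ) {a b : Fin N}
    (hab : a ≠ b) (i k : Fin N) :
    ∫ g, ρ g a i * (starRingEnd ℂ) (ρ g b k) ∂haarProbability G = 0 := by
  set D := Matrix.diagonal (Pi.mulSingle a Complex.I * Pi.mulSingle b (-Complex.I) : Fin N → ℂ) with hD
  have hDm : D ∈ Matrix.specialUnitaryGroup (Fin N) ℂ := by rw [hD]; exact diagonal_phase_mem a b hab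
  have h := integral_comp_mul_left ρ hρ hDm (fun M => M a i * (starRingEnd ℂ) (M b k))
  have hDa : ∀ M : Matrix (Fin N) (Fin N) ℂ, (D * M) a i = Complex.I * M a i := fun M => by
    rw [hD, Matrix.diagonal_mul]; simp [Pi.mulSingle_eq_of_ne hab]
  have hDb : ∀ M : Matrix (Fin N) (Fin N) ℂ, (D * M) b k = -Complex.I * M b k := fun M => by
    rw [hD, Matrix.diagonal_mul]; simp [Pi.mulSingle_eq_of_ne hab.symm]
  have hpt : ∀ M : Matrix (Fin N) (Fin N) ℂ,
      (D * M) a i * (starRingEnd ℂ) ((D * M) b k) = -(M a i * (starRingEnd ℂ) (M b k)) := fun M => by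
    rw [hDa, hDb, map_mul, map_neg, Complex.conj_I, neg_neg]
    linear_combination (M a i * (starRingEnd ℂ) (M b k)) * Complex.I_mul_I
  simp only [hpt] at h
  exact integral_eq_zero_of_neg h

/-- **Different columns are orthogonal in mean**: `∫ ρ(g)_{ai} conj(ρ(g)_{ak}) dg = 0` for `i ≠ k` (right twist by the phase
`diag(i at i, −i at k)`). [cite: CollinsSniady2006, Cor. 2.4 (invariant integration on U(N)/SU(N): low-degree Haar moments; bookkeeping)] -/
theorem integral_entry_mul_conj_entry_eq_zero_of_col_ne (hρ : IsSpecialUnitaryModel ρ) (a : Fin N) {i k : Fin N}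
    (hik : i ≠ k) :
    ∫ g, ρ g a i * (starRingEnd ℂ) (ρ g a k) ∂haarProbability G = 0 := by
  set D := Matrix.diagonal (Pi.mulSingle i Complex.I * Pi.mulSingle k (-Complex.I) : Fin N → ℂ) with hD
  have hDm : D ∈ Matrix.specialUnitaryGroup (Fin N) ℂ := by rw [hD]; exact diagonal_phase_mem i k hik
  have h := integral_comp_mul_right ρ hρ hDm (fun M => M a i * (starRingEnd ℂ) (M a k))
  have hDi : ∀ M : Matrix (Fin N) (Fin N) ℂ, (M * D) a i = M a i * Complex.I := fun M => by
    rw [hD, Matrix.mul_diagonal]; simp [Pi.mulSingle_eq_of_ne hik]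
  have hDk : ∀ M : Matrix (Fin N) (Fin N) ℂ, (M * D) a k = M a k * -Complex.I := fun M => by
    rw [hD, Matrix.mul_diagonal]; simp [Pi.mulSingle_eq_of_ne hik.symm]
  have hpt : ∀ M : Matrix (Fin N) (Fin N) ℂ,
      (M * D) a i * (starRingEnd ℂ) ((M * D) a k) = -(M a i * (starRingEnd ℂ) (M a k)) := fun M => by
    rw [hDi, hDk, map_mul, map_neg, Complex.conj_I, neg_neg]
    linear_combination (M a i * (starRingEnd ℂ) (M a k)) * Complex.I_mul_I
  simp only [hpt] at h
  exact integral_eq_zero_of_neg h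

/-- **The mean square modulus of an entry does not depend on the column** (right twist by a signed transposition). [cite: CollinsSniady2006, Cor. 2.4 (invariant integration on U(N)/SU(N): low-degree Haar moments; bookkeeping)] -/
theorem integral_normSq_entry_eq_of_col (hρ : IsSpecialUnitaryModel ρ) (a i j : Fin N) :
    ∫ g, ρ g a i * (starRingEnd ℂ) (ρ g a i) ∂haarProbability G =
      ∫ g, ρ g a j * (starRingEnd ℂ) (ρ g a j) ∂haarProbability G := by
  rcases eq_or_ne i j with rfl | hij
  · rfl
  set T := Matrix.swap ℂ i j * Matrix.diagonal (Pi.mulSingle i (-1 : ℂ)) with hT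
  have hTm : T ∈ Matrix.specialUnitaryGroup (Fin N) ℂ := by rw [hT]; exact swap_mul_sign_mem i j hij
  have h := integral_comp_mul_right ρ hρ hTm (fun M => M a i * (starRingEnd ℂ) (M a i))
  have hTa : ∀ M : Matrix (Fin N) (Fin N) ℂ, (M * T) a i = -M a j := fun M => by
    rw [hT, ← Matrix.mul_assoc, Matrix.mul_diagonal, Matrix.mul_swap_apply_left]; simp
  have hpt : ∀ M : Matrix (Fin N) (Fin N) ℂ,
      (M * T) a i * (starRingEnd ℂ) ((M * T) a i) = M a j * (starRingEnd ℂ) (M a j) := fun M => by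
    rw [hTa, map_neg, neg_mul_neg]
  simp only [hpt] at h
  exact h.symm

/-- **Unitarity row sum in mean**: `Σ_i ∫ |ρ(g)_{ai}|² dg = 1`. [cite: CollinsSniady2006, Cor. 2.4 (invariant integration on U(N)/SU(N): low-degree Haar moments; bookkeeping)] -/
theorem sum_integral_normSq_entry (hρ : IsSpecialUnitaryModel ρ) (a : Fin N) :
    ∑ i, ∫ g, ρ g a i * (starRingEnd ℂ) (ρ g a i) ∂haarProbability G = 1 := by
  rw [← integral_finsetSum _ (fun i _ => integrable_entry_mul_conj_entry ρ hρ.1 a i a i)]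
  have hrow : ∀ g : G, ∑ i, ρ g a i * (starRingEnd ℂ) (ρ g a i) = 1 := by
    intro g
    have hu := IsSpecialUnitaryModel.mem_unitaryGroup ρ hρ g
    rw [Matrix.mem_unitaryGroup_iff] at hu
    have h := congrFun (congrFun hu a) a
    rw [Matrix.mul_apply, Matrix.one_apply_eq] at h
    simpa [Matrix.star_apply, Complex.star_def] using h
  simp_rw [hrow]
  simp

/-- **`∫ |ρ(g)_{ai}|² dg = 1/N`** for every entry. [cite: CollinsSniady2006, Cor. 2.4 (invariant integration on U(N)/SU(N): low-degree Haar moments; bookkeeping)] -/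
theorem integral_normSq_entry (hρ : IsSpecialUnitaryModel ρ) (a i : Fin N) :
    ∫ g, ρ g a i * (starRingEnd ℂ) (ρ g a i) ∂haarProbability G = (N : ℂ)⁻¹ := by
  have h1 := sum_integral_normSq_entry ρ hρ a
  have h2 : ∑ j : Fin N, ∫ g, ρ g a j * (starRingEnd ℂ) (ρ g a j) ∂haarProbability G =
      ∑ _j : Fin N, ∫ g, ρ g a i * (starRingEnd ℂ) (ρ g a i) ∂haarProbability G :=
    Finset.sum_congr rfl fun j _ => (integral_normSq_entry_eq_of_col ρ hρ a i j).symm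
  rw [h2, Finset.sum_const, Finset.card_univ, Fintype.card_fin, nsmul_eq_mul] at h1
  exact eq_inv_of_mul_eq_one_right h1

/-- ★ **THE QUADRATIC HAAR MOMENTS OF `SU(N)`** (first Weingarten / Schur-orthogonality relation of the fundamental
representation): `∫ ρ(g)_{ai} conj(ρ(g)_{bk}) dg = δ_{ab} δ_{ik} / N` for a compact group `G ≅ SU(N)`
(Creutz (8.20)). [cite: CollinsSniady2006, Cor. 2.4 (invariant integration on U(N)/SU(N): low-degree Haar moments; bookkeeping)] -/
theorem integral_entry_mul_conj_entry (hρ : IsSpecialUnitaryModel ρ) (a i b k : Fin N) :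
    ∫ g, ρ g a i * (starRingEnd ℂ) (ρ g b k) ∂haarProbability G =
      if a = b ∧ i = k then (N : ℂ)⁻¹ else 0 := by
  split_ifs with h
  · obtain ⟨rfl, rfl⟩ := h
    exact integral_normSq_entry ρ hρ a i
  · rcases ne_or_eq a b with hab | rfl
    · exact integral_entry_mul_conj_entry_eq_zero_of_row_ne ρ hρ hab i k
    · have hik : i ≠ k := fun hik => h ⟨rfl, hik⟩
      exact integral_entry_mul_conj_entry_eq_zero_of_col_ne ρ hρ a hik

/-! ### The quadratic moments of the character -/

/-- **The fundamental character has mean square modulus one**: `∫ tr ρ(g) · conj(tr ρ(g)) dg = 1` (`N ≥ 1`). [cite: CollinsSniady2006, Cor. 2.4 (invariant integration on U(N)/SU(N): low-degree Haar moments; bookkeeping)] -/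
theorem integral_trace_mul_conj_trace (hρ : IsSpecialUnitaryModel ρ) (hN : 1 ≤ N) :
    ∫ g, (ρ g).trace * (starRingEnd ℂ) (ρ g).trace ∂haarProbability G = 1 := by
  have hexp : ∀ g : G, (ρ g).trace * (starRingEnd ℂ) (ρ g).trace =
      ∑ a, ∑ b, ρ g a a * (starRingEnd ℂ) (ρ g b b) := by
    intro g
    simp only [Matrix.trace, Matrix.diag_apply, map_sum, Finset.sum_mul_sum]
  simp_rw [hexp]
  rw [integral_finsetSum _ (fun a _ =>
    integrable_finsetSum _ (fun b _ => integrable_entry_mul_conj_entry ρ hρ.1 a a b b))]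
  have hin : ∀ a : Fin N, ∫ g, ∑ b, ρ g a a * (starRingEnd ℂ) (ρ g b b) ∂haarProbability G = (N : ℂ)⁻¹ := by
    intro a
    rw [integral_finsetSum _ (fun b _ => integrable_entry_mul_conj_entry ρ hρ.1 a a b b)]
    simp_rw [integral_entry_mul_conj_entry ρ hρ, and_self]
    rw [Finset.sum_ite_eq]
    simp
  simp_rw [hin]
  rw [Finset.sum_const, Finset.card_univ, Fintype.card_fin, nsmul_eq_mul]
  have hN0 : (N : ℂ) ≠ 0 := by exact_mod_cast (show N ≠ 0 by omega)
  exact mul_inv_cancel₀ hN0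

/-- **`∫ |tr ρ(g)|² dg = 1`** (real form, `Complex.normSq`). [cite: CollinsSniady2006, Cor. 2.4 (invariant integration on U(N)/SU(N): low-degree Haar moments; bookkeeping)] -/
theorem integral_normSq_trace (hρ : IsSpecialUnitaryModel ρ) (hN : 1 ≤ N) :
    ∫ g, Complex.normSq (ρ g).trace ∂haarProbability G = 1 := by
  have h := integral_trace_mul_conj_trace ρ hρ hN
  simp_rw [Complex.mul_conj] at h
  rw [integral_complex_ofReal] at h
  exact_mod_cast h

/-- **The trace of `SU(2)` is real**: `conj(tr ρ(g)) = tr ρ(g)` for `G ≅ SU(2)` (`U₁₁ = conj U₀₀`). [cite: CollinsSniady2006, Cor. 2.4 (invariant integration on U(N)/SU(N): low-degree Haar moments; bookkeeping)] -/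
theorem conj_trace_eq_of_two {G : Type*} [Group G] [TopologicalSpace G] (ρ : G →* Matrix (Fin 2) (Fin 2) ℂ)
    (hρ : IsSpecialUnitaryModel ρ) (g : G) : (starRingEnd ℂ) (ρ g).trace = (ρ g).trace := by
  have hmem : ρ g ∈ (Matrix.specialUnitaryGroup (Fin 2) ℂ : Set (Matrix (Fin 2) (Fin 2) ℂ)) :=
    hρ.2.2 ▸ Set.mem_range_self g
  have h11 := su2_apply_11 ⟨ρ g, hmem⟩
  change ρ g 1 1 = (starRingEnd ℂ) (ρ g 0 0) at h11
  rw [Matrix.trace_fin_two, h11, map_add, Complex.conj_conj, add_comm]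

/-- **`∫ (tr ρ(g))² dg = 1` for `G ≅ SU(2)`** (the trace is real, so this is `∫ |tr|² = 1`). [cite: CollinsSniady2006, Cor. 2.4 (invariant integration on U(N)/SU(N): low-degree Haar moments; bookkeeping)] -/
theorem integral_trace_sq_eq_one_of_two {G : Type*} [Group G] [TopologicalSpace G] [IsTopologicalGroup G]
    [CompactSpace G] [MeasurableSpace G] [BorelSpace G] (ρ : G →* Matrix (Fin 2) (Fin 2) ℂ)
    (hρ : IsSpecialUnitaryModel ρ) : ∫ g, (ρ g).trace ^ 2 ∂haarProbability G = 1 := by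
  have h := integral_trace_mul_conj_trace ρ hρ (by norm_num)
  simp_rw [conj_trace_eq_of_two ρ hρ, ← pow_two] at h
  exact h

/-! ### The exact character variance `V₀` -/

/-- The pointwise identity `(Re z)² = (|z|² + Re(z²)) / 2`. [cite: CollinsSniady2006, Cor. 2.4 (invariant integration on U(N)/SU(N): low-degree Haar moments; bookkeeping)] -/
theorem re_sq_eq (z : ℂ) : z.re ^ 2 = (Complex.normSq z + (z ^ 2).re) / 2 := by
  rw [Complex.normSq_apply]
  simp only [pow_two, Complex.mul_re]
  ring

/-- **`V₀ = (1 + Re ∫ (tr ρ)²)/2`** for `G ≅ SU(N)`, `N ≥ 1`. [cite: CollinsSniady2006, Cor. 2.4 (invariant integration on U(N)/SU(N): low-degree Haar moments; bookkeeping)] -/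
theorem charVariance_eq_half_add (hρ : IsSpecialUnitaryModel ρ) (hN : 1 ≤ N) :
    PlaquetteLowerBound.charVariance ρ = (1 + (∫ g, (ρ g).trace ^ 2 ∂haarProbability G).re) / 2 := by
  unfold PlaquetteLowerBound.charVariance PlaquetteLowerBound.reTr
  simp_rw [re_sq_eq]
  have hc : Continuous fun g : G => (ρ g).trace := hρ.1.matrix_trace
  have hi1 : Integrable (fun g : G => Complex.normSq (ρ g).trace) (haarProbability G) :=
    (Complex.continuous_normSq.comp hc).integrable_of_hasCompactSupport (HasCompactSupport.of_compactSpace _)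
  have hi2c : Integrable (fun g : G => (ρ g).trace ^ 2) (haarProbability G) :=
    (hc.pow 2).integrable_of_hasCompactSupport (HasCompactSupport.of_compactSpace _)
  have hi2 : Integrable (fun g : G => ((ρ g).trace ^ 2).re) (haarProbability G) := hi2c.re
  rw [integral_div, integral_add hi1 hi2, integral_normSq_trace ρ hρ hN]
  congr 2
  simpa using integral_re hi2c

/-- ★★ **`V₀(SU(2)) = 1` EXACTLY**: `∫ (Re tr ρ(g))² dg = 1` for every compact group `G ≅ SU(2)`. [cite: CollinsSniady2006, Cor. 2.4 (invariant integration on U(N)/SU(N): low-degree Haar moments; bookkeeping)] -/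
theorem charVariance_eq_one {G : Type*} [Group G] [TopologicalSpace G] [IsTopologicalGroup G]
    [CompactSpace G] [MeasurableSpace G] [BorelSpace G] (ρ : G →* Matrix (Fin 2) (Fin 2) ℂ)
    (hρ : IsSpecialUnitaryModel ρ) : PlaquetteLowerBound.charVariance ρ = 1 := by
  rw [charVariance_eq_half_add ρ hρ (by norm_num), integral_trace_sq_eq_one_of_two ρ hρ, Complex.one_re]
  norm_num

end Moments

/-! ### The concrete groups `SU(N) = Matrix.specialUnitaryGroup (Fin N) ℂ` -/

/-- **`∫_{SU(N)} |tr U|² dU = 1`** (`N ≥ 1`). [cite: CollinsSniady2006, Cor. 2.4 (invariant integration on U(N)/SU(N): low-degree Haar moments; bookkeeping)] -/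
theorem integral_normSq_trace_suN {N : ℕ} (hN : 1 ≤ N) :
    ∫ U, Complex.normSq (U : Matrix (Fin N) (Fin N) ℂ).trace ∂haarProbability (Matrix.specialUnitaryGroup (Fin N) ℂ) = 1 := by
  have h := integral_normSq_trace (fundamentalRep (Fin N)) (TorusAreaLaw.isSpecialUnitaryModel_fundamentalRep N) hN
  simpa only [fundamentalRep_apply] using h

end HaarSecondMoments

end Literature.MathematicalPhysics.QuantumFieldTheory.HaarMoments.RobustBall

end Part1

/-!
## Part 2 — port of `Summits/QuantumFields/YangMills/Theorems/ToronCumulantSignHaarTwist.lean` (13 declarations kept)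

# Route `ToronCumulantSign`, crux `CommutatorSkewMoment` (stmt-QuantumFields-27530) — helper I:
# phase-twist vanishing of the bidegree-(2,2) Haar monomials of `SU(N)`, every `N ≥ 2`

For a compact group `G ≅ SU(N)` (`IsSpecialUnitaryModel ρ`, the tree's standing hypothesis) and the general monomial
`𝔪 = ρ_{r₁c₁} ρ_{r₂c₂} conj(ρ_{r₃c₃}) conj(ρ_{r₄c₄})`, the Haar integral `∫ 𝔪` VANISHES unless the row multisets agree,
`{r₁, r₂} = {r₃, r₄}`, and the column multisets agree, `{c₁, c₂} = {c₃, c₄}` (the support of the second Weingarten function,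
Collins–Śniady 2006 Cor. 2.4 / Creutz (8.22)).  Proof WITHOUT Weingarten calculus, by invariance alone: left (resp. right)
multiplication by the diagonal phase `diag(ζ at a, ζ⁴ at b, 1 elsewhere) ∈ SU(N)`, `ζ = e^{2πi/5}`, multiplies `𝔪` by `ζ^E` with an
exponent `E ∈ ℕ` that is NOT a multiple of `5` for a suitable pair `a ≠ b` whenever the multisets differ (a fifth root of unity
instead of the tree's `± i` twists makes a spare third index unnecessary, so `N = 2` is included).  HONEST LABEL: pure
compact-group integration; a helper toward the OPEN crux `CommutatorSkewMoment`; nothing about the Yang–Mills mass gap.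

References: B. Collins, P. Śniady, CMP 264 (2006) 773–795, Cor. 2.4; M. Creutz, *Quarks, gluons and lattices* (1983) §8.

(Verbatim declaration-level port — the declarations listed in the Part header count — of the Summits-side module; route
bookkeeping of the source docstring, if any, is historical; `local notation3` shorthands of the source are expanded in place.)
-/

section Part2

open _root_.MeasureTheory _root_.Complex
open Literature.MathematicalPhysics.QuantumLattice Literature.MathematicalPhysics.QuantumFieldTheory

namespace Literature.MathematicalPhysics.QuantumFieldTheory.ToronCumulant

open Literature.MathematicalPhysics.QuantumFieldTheory.HaarMoments.RobustBall.HaarSecondMoments (integral_comp_mul_left integral_comp_mul_right)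

/-! ### The fifth root of unity `ζ` and the diagonal twist -/

/-- `ζ` is a primitive fifth root of unity. [cite: CollinsSniady2006, Cor. 2.4 (invariant integration on U(N)/SU(N): low-degree Haar moments; bookkeeping)] -/
theorem zeta5_isPrimitiveRoot : IsPrimitiveRoot (Complex.exp (2 * Real.pi * Complex.I / 5)) 5 := by
  simpa using Complex.isPrimitiveRoot_exp 5 (by norm_num)

/-- `ζ^k = 1 ↔ 5 ∣ k`. [cite: CollinsSniady2006, Cor. 2.4 (invariant integration on U(N)/SU(N): low-degree Haar moments; bookkeeping)] -/
theorem zeta5_pow_eq_one_iff (k : ℕ) : (Complex.exp (2 * Real.pi * Complex.I / 5)) ^ k = 1 ↔ 5 ∣ k :=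
  zeta5_isPrimitiveRoot.pow_eq_one_iff_dvd k

/-- `conj ζ = ζ⁴`. [cite: CollinsSniady2006, Cor. 2.4 (invariant integration on U(N)/SU(N): low-degree Haar moments; bookkeeping)] -/
theorem conj_zeta5 : (starRingEnd ℂ) (Complex.exp (2 * Real.pi * Complex.I / 5)) = (Complex.exp (2 * Real.pi * Complex.I / 5)) ^ 4 := by
  have h1 : ‖(Complex.exp (2 * Real.pi * Complex.I / 5))‖ = 1 := zeta5_isPrimitiveRoot.norm'_eq_one (by norm_num)
  have h5 : (Complex.exp (2 * Real.pi * Complex.I / 5)) ^ 5 = 1 := zeta5_isPrimitiveRoot.pow_eq_one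
  have hne : (Complex.exp (2 * Real.pi * Complex.I / 5)) ≠ 0 := fun h => by rw [h, norm_zero] at h1; exact zero_ne_one h1
  rw [← Complex.inv_eq_conj h1]
  have : (Complex.exp (2 * Real.pi * Complex.I / 5)) ^ 4 * (Complex.exp (2 * Real.pi * Complex.I / 5)) = 1 := by rw [← pow_succ, h5]
  exact (eq_inv_of_mul_eq_one_left this).symm
  
/-- A complex number fixed by multiplication with `c ≠ 1` vanishes. [cite: CollinsSniady2006, Cor. 2.4 (invariant integration on U(N)/SU(N): low-degree Haar moments; bookkeeping)] -/
theorem eq_zero_of_mul_eq_self' {c z : ℂ} (hc : c ≠ 1) (h : c * z = z) : z = 0 := by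
  have h' : (c - 1) * z = 0 := by rw [sub_mul, one_mul, h, sub_self]
  rcases mul_eq_zero.mp h' with h'' | h''
  · exact absurd (sub_eq_zero.mp h'') hc
  · exact h''

/-- `conj (ζ^k) = ζ^{4k}`. [cite: CollinsSniady2006, Cor. 2.4 (invariant integration on U(N)/SU(N): low-degree Haar moments; bookkeeping)] -/
theorem conj_zeta5_pow (k : ℕ) : (starRingEnd ℂ) ((Complex.exp (2 * Real.pi * Complex.I / 5)) ^ k) = (Complex.exp (2 * Real.pi * Complex.I / 5)) ^ (4 * k) := by
  rw [map_pow, conj_zeta5, ← pow_mul]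

section Twist

variable {N : ℕ} {G : Type*} [Group G] [TopologicalSpace G] [IsTopologicalGroup G] [CompactSpace G]
  [MeasurableSpace G] [BorelSpace G] (ρ : G →* Matrix (Fin N) (Fin N) ℂ)

/-- The sum of the twist exponents over all indices is `5` (`a ≠ b`). [cite: CollinsSniady2006, Cor. 2.4 (invariant integration on U(N)/SU(N): low-degree Haar moments; bookkeeping)] -/
theorem sum_te {a b : Fin N} (hab : a ≠ b) : ∑ r : Fin N, ((if r = a then (1 : ℕ) else if r = b then (4 : ℕ) else (0 : ℕ))) = 5 := by
  have h : ∀ r : Fin N, ((if r = a then (1 : ℕ) else if r = b then (4 : ℕ) else (0 : ℕ))) = (if r = a then 1 else 0) + (if r = b then 4 else 0) := by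
    intro r
    by_cases hra : r = a
    · subst hra; simp [hab]
    · simp [hra]
  simp_rw [h]
  rw [Finset.sum_add_distrib, Finset.sum_ite_eq' Finset.univ a, Finset.sum_ite_eq' Finset.univ b]
  simp

/-- The diagonal twist lies in `SU(N)` (`a ≠ b`): its entries are unimodular and its determinant is `ζ^5 = 1`. [cite: CollinsSniady2006, Cor. 2.4 (invariant integration on U(N)/SU(N): low-degree Haar moments; bookkeeping)] -/
theorem twist_mem {a b : Fin N} (hab : a ≠ b) : ((Matrix.diagonal (fun r : Fin N => (Complex.exp (2 * Real.pi * Complex.I / 5)) ^ (((if r = a then (1 : ℕ) else if r = b then (4 : ℕ) else (0 : ℕ))))) : Matrix (Fin N) (Fin N) ℂ)) ∈ Matrix.specialUnitaryGroup (Fin N) ℂ := by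
  rw [Matrix.mem_specialUnitaryGroup_iff]
  refine ⟨?_, ?_⟩
  · rw [Matrix.mem_unitaryGroup_iff, Matrix.star_eq_conjTranspose, Matrix.diagonal_conjTranspose,
      Matrix.diagonal_mul_diagonal, ← Matrix.diagonal_one]
    congr 1
    funext r
    simp only [Pi.star_apply, Complex.star_def]
    rw [conj_zeta5_pow, ← pow_add, zeta5_pow_eq_one_iff]
    exact ⟨((if r = a then (1 : ℕ) else if r = b then (4 : ℕ) else (0 : ℕ))), by ring⟩
  · rw [Matrix.det_diagonal, Finset.prod_pow_eq_pow_sum, sum_te hab]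
    exact zeta5_isPrimitiveRoot.pow_eq_one

/-- Entries of the left-twisted matrix: `(D M)_{rc} = ζ^{te r} M_{rc}`. [cite: CollinsSniady2006, Cor. 2.4 (invariant integration on U(N)/SU(N): low-degree Haar moments; bookkeeping)] -/
theorem twist_mul_apply (a b : Fin N) (M : Matrix (Fin N) (Fin N) ℂ) (r c : Fin N) :
    (((Matrix.diagonal (fun r : Fin N => (Complex.exp (2 * Real.pi * Complex.I / 5)) ^ (((if r = a then (1 : ℕ) else if r = b then (4 : ℕ) else (0 : ℕ))))) : Matrix (Fin N) (Fin N) ℂ)) * M) r c = (Complex.exp (2 * Real.pi * Complex.I / 5)) ^ (((if r = a then (1 : ℕ) else if r = b then (4 : ℕ) else (0 : ℕ)))) * M r c := by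
  rw [Matrix.diagonal_mul]

/-- Entries of the right-twisted matrix: `(M D)_{rc} = ζ^{te c} M_{rc}`. [cite: CollinsSniady2006, Cor. 2.4 (invariant integration on U(N)/SU(N): low-degree Haar moments; bookkeeping)] -/
theorem mul_twist_apply (a b : Fin N) (M : Matrix (Fin N) (Fin N) ℂ) (r c : Fin N) :
    (M * ((Matrix.diagonal (fun r : Fin N => (Complex.exp (2 * Real.pi * Complex.I / 5)) ^ (((if r = a then (1 : ℕ) else if r = b then (4 : ℕ) else (0 : ℕ))))) : Matrix (Fin N) (Fin N) ℂ))) r c = (Complex.exp (2 * Real.pi * Complex.I / 5)) ^ (((if c = a then (1 : ℕ) else if c = b then (4 : ℕ) else (0 : ℕ)))) * M r c := by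
  rw [Matrix.mul_diagonal, mul_comm]

/-- **Row twist relation**: `∫ 𝔪 = ζ^E ∫ 𝔪` with `E = te r₁ + te r₂ + 4 te r₃ + 4 te r₄`; hence `∫ 𝔪 = 0` unless `5 ∣ E`. [cite: CollinsSniady2006, Cor. 2.4 (invariant integration on U(N)/SU(N): low-degree Haar moments; bookkeeping)] -/
theorem integral_mono_eq_zero_of_rowTwist (hρ : IsSpecialUnitaryModel ρ) {a b : Fin N} (hab : a ≠ b)
    (r₁ c₁ r₂ c₂ r₃ c₃ r₄ c₄ : Fin N)
    (hE : ¬ 5 ∣ ((if r₁ = a then (1 : ℕ) else if r₁ = b then (4 : ℕ) else (0 : ℕ))) + ((if r₂ = a then (1 : ℕ) else if r₂ = b then (4 : ℕ) else (0 : ℕ))) + 4 * ((if r₃ = a then (1 : ℕ) else if r₃ = b then (4 : ℕ) else (0 : ℕ))) + 4 * ((if r₄ = a then (1 : ℕ) else if r₄ = b then (4 : ℕ) else (0 : ℕ)))) :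
    ∫ g, ((ρ g) r₁ c₁ * (ρ g) r₂ c₂ * (starRingEnd ℂ) ((ρ g) r₃ c₃) * (starRingEnd ℂ) ((ρ g) r₄ c₄)) ∂haarProbability G = 0 := by
  have h := integral_comp_mul_left ρ hρ (twist_mem hab) (fun M => (M r₁ c₁ * M r₂ c₂ * (starRingEnd ℂ) (M r₃ c₃) * (starRingEnd ℂ) (M r₄ c₄)))
  have hpt : ∀ M : Matrix (Fin N) (Fin N) ℂ, ((((Matrix.diagonal (fun r : Fin N => (Complex.exp (2 * Real.pi * Complex.I / 5)) ^ (((if r = a then (1 : ℕ) else if r = b then (4 : ℕ) else (0 : ℕ))))) : Matrix (Fin N) (Fin N) ℂ)) * M) r₁ c₁ * (((Matrix.diagonal (fun r : Fin N => (Complex.exp (2 * Real.pi * Complex.I / 5)) ^ (((if r = a then (1 : ℕ) else if r = b then (4 : ℕ) else (0 : ℕ))))) : Matrix (Fin N) (Fin N) ℂ)) * M) r₂ c₂ * (starRingEnd ℂ) ((((Matrix.diagonal (fun r : Fin N => (Complex.exp (2 * Real.pi * Complex.I / 5)) ^ (((if r = a then (1 : ℕ) else if r = b then (4 : ℕ)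 else (0 : ℕ))))) : Matrix (Fin N) (Fin N) ℂ)) * M) r₃ c₃) * (starRingEnd ℂ) ((((Matrix.diagonal (fun r : Fin N => (Complex.exp (2 * Real.pi * Complex.I / 5)) ^ (((if r = a then (1 : ℕ) else if r = b then (4 : ℕ) else (0 : ℕ))))) : Matrix (Fin N) (Fin N) ℂ)) * M) r₄ c₄)) =
      (Complex.exp (2 * Real.pi * Complex.I / 5)) ^ (((if r₁ = a then (1 : ℕ) else if r₁ = b then (4 : ℕ) else (0 : ℕ))) + ((if r₂ = a then (1 : ℕ) else if r₂ = b then (4 : ℕ) else (0 : ℕ))) + 4 * ((if r₃ = a then (1 : ℕ) else if r₃ = b then (4 : ℕ) else (0 : ℕ))) + 4 * ((if r₄ = a then (1 : ℕ) else if r₄ = b then (4 : ℕ) else (0 : ℕ)))) * (M r₁ c₁ * M r₂ c₂ * (starRingEnd ℂ) (M r₃ c₃) * (starRingEnd ℂ) (M r₄ c₄)) := by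
    intro M
    rw [twist_mul_apply, twist_mul_apply, twist_mul_apply, twist_mul_apply, map_mul, map_mul, conj_zeta5_pow,
      conj_zeta5_pow]
    rw [pow_add, pow_add, pow_add]
    ring
  simp only [hpt] at h
  rw [integral_const_mul] at h
  exact eq_zero_of_mul_eq_self' (fun h1 => hE ((zeta5_pow_eq_one_iff _).mp h1)) h

/-- **Column twist relation**: the same with the column indices (right multiplication). [cite: CollinsSniady2006, Cor. 2.4 (invariant integration on U(N)/SU(N): low-degree Haar moments; bookkeeping)] -/
theorem integral_mono_eq_zero_of_colTwist (hρ : IsSpecialUnitaryModel ρ) {a b : Fin N} (hab : a ≠ b)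
    (r₁ c₁ r₂ c₂ r₃ c₃ r₄ c₄ : Fin N)
    (hE : ¬ 5 ∣ ((if c₁ = a then (1 : ℕ) else if c₁ = b then (4 : ℕ) else (0 : ℕ))) + ((if c₂ = a then (1 : ℕ) else if c₂ = b then (4 : ℕ) else (0 : ℕ))) + 4 * ((if c₃ = a then (1 : ℕ) else if c₃ = b then (4 : ℕ) else (0 : ℕ))) + 4 * ((if c₄ = a then (1 : ℕ) else if c₄ = b then (4 : ℕ) else (0 : ℕ)))) :
    ∫ g, ((ρ g) r₁ c₁ * (ρ g) r₂ c₂ * (starRingEnd ℂ) ((ρ g) r₃ c₃) * (starRingEnd ℂ) ((ρ g) r₄ c₄)) ∂haarProbability G = 0 := by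
  have h := integral_comp_mul_right ρ hρ (twist_mem hab) (fun M => (M r₁ c₁ * M r₂ c₂ * (starRingEnd ℂ) (M r₃ c₃) * (starRingEnd ℂ) (M r₄ c₄)))
  have hpt : ∀ M : Matrix (Fin N) (Fin N) ℂ, ((M * ((Matrix.diagonal (fun r : Fin N => (Complex.exp (2 * Real.pi * Complex.I / 5)) ^ (((if r = a then (1 : ℕ) else if r = b then (4 : ℕ) else (0 : ℕ))))) : Matrix (Fin N) (Fin N) ℂ))) r₁ c₁ * (M * ((Matrix.diagonal (fun r : Fin N => (Complex.exp (2 * Real.pi * Complex.I / 5)) ^ (((if r = a then (1 : ℕ) else if r = b then (4 : ℕ) else (0 : ℕ))))) : Matrix (Fin N) (Fin N) ℂ))) r₂ c₂ * (starRingEnd ℂ) ((M * ((Matrix.diagonal (fun r : Fin N => (Complex.exp (2 * Real.pi * Complex.I / 5)) ^ (((if r = a then (1 : ℕ) else if r = b then (4 : ℕ) else (0 : ℕ))))) : Matrix (Fin N) (Fin N) ℂ))) r₃ c₃) * (starRingEnd ℂ) ((M * ((Matrix.diagonal (fun r : Fin N => (Complex.exp (2 * Real.pi * Complex.I / 5))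 ^ (((if r = a then (1 : ℕ) else if r = b then (4 : ℕ) else (0 : ℕ))))) : Matrix (Fin N) (Fin N) ℂ))) r₄ c₄)) =
      (Complex.exp (2 * Real.pi * Complex.I / 5)) ^ (((if c₁ = a then (1 : ℕ) else if c₁ = b then (4 : ℕ) else (0 : ℕ))) + ((if c₂ = a then (1 : ℕ) else if c₂ = b then (4 : ℕ) else (0 : ℕ))) + 4 * ((if c₃ = a then (1 : ℕ) else if c₃ = b then (4 : ℕ) else (0 : ℕ))) + 4 * ((if c₄ = a then (1 : ℕ) else if c₄ = b then (4 : ℕ) else (0 : ℕ)))) * (M r₁ c₁ * M r₂ c₂ * (starRingEnd ℂ) (M r₃ c₃) * (starRingEnd ℂ) (M r₄ c₄)) := by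
    intro M
    rw [mul_twist_apply, mul_twist_apply, mul_twist_apply, mul_twist_apply, map_mul, map_mul, conj_zeta5_pow,
      conj_zeta5_pow]
    rw [pow_add, pow_add, pow_add]
    ring
  simp only [hpt] at h
  rw [integral_const_mul] at h
  exact eq_zero_of_mul_eq_self' (fun h1 => hE ((zeta5_pow_eq_one_iff _).mp h1)) h

/-- **Row support of the second moments**: `∫ 𝔪 = 0` unless the row multisets agree, `{r₁, r₂} = {r₃, r₄}`. [cite: CollinsSniady2006, Cor. 2.4 (invariant integration on U(N)/SU(N): low-degree Haar moments; bookkeeping)] -/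
theorem integral_mono_eq_zero_of_rows (hρ : IsSpecialUnitaryModel ρ) (r₁ c₁ r₂ c₂ r₃ c₃ r₄ c₄ : Fin N)
    (h : ¬((r₁ = r₃ ∧ r₂ = r₄) ∨ (r₁ = r₄ ∧ r₂ = r₃))) :
    ∫ g, ((ρ g) r₁ c₁ * (ρ g) r₂ c₂ * (starRingEnd ℂ) ((ρ g) r₃ c₃) * (starRingEnd ℂ) ((ρ g) r₄ c₄)) ∂haarProbability G = 0 := by
  by_cases h12 : r₂ = r₁
  · subst h12
    by_cases h31 : r₃ = r₂
    · subst h31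
      -- rows `r r r r₄` with `r₄ ≠ r`: twist `(r, r₄)`, exponent `1 + 1 + 4 + 16 = 22`
      have h4 : r₄ ≠ r₃ := fun h4 => h (Or.inl ⟨rfl, h4.symm⟩)
      refine integral_mono_eq_zero_of_rowTwist ρ hρ (Ne.symm h4) r₃ c₁ r₃ c₂ r₃ c₃ r₄ c₄ ?_
      simp only [↓reduceIte, h4]; omega
    · -- rows `r r r₃ r₄` with `r₃ ≠ r`: twist `(r, r₃)`
      have h13 : r₂ ≠ r₃ := fun h' => h31 h'.symm
      by_cases h42 : r₄ = r₂
      · subst h42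
        refine integral_mono_eq_zero_of_rowTwist ρ hρ h13 r₄ c₁ r₄ c₂ r₃ c₃ r₄ c₄ ?_
        simp only [↓reduceIte, h31]; omega
      · by_cases h43 : r₄ = r₃
        · subst h43
          refine integral_mono_eq_zero_of_rowTwist ρ hρ h13 r₂ c₁ r₂ c₂ r₄ c₃ r₄ c₄ ?_
          simp only [↓reduceIte, h31]; omega
        · refine integral_mono_eq_zero_of_rowTwist ρ hρ h13 r₂ c₁ r₂ c₂ r₃ c₃ r₄ c₄ ?_
          simp only [↓reduceIte, h31, h42, h43]; omega
  · by_cases h31 : r₃ = r₁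
    · subst h31
      -- rows `r₁ r₂ r₁ r₄`, `r₂ ≠ r₁`, and `r₄ ≠ r₂`: twist `(r₂, r₄)`
      have h42 : r₄ ≠ r₂ := fun h' => h (Or.inl ⟨rfl, h'.symm⟩)
      have h24 : r₂ ≠ r₄ := fun h' => h42 h'.symm
      by_cases h41 : r₄ = r₃
      · subst h41
        refine integral_mono_eq_zero_of_rowTwist ρ hρ h24 r₄ c₁ r₂ c₂ r₄ c₃ r₄ c₄ ?_
        simp only [↓reduceIte, h42]; omega
      · have h14 : r₃ ≠ r₄ := fun h' => h41 h'.symm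
        have h12' : r₃ ≠ r₂ := fun h' => h12 h'.symm
        refine integral_mono_eq_zero_of_rowTwist ρ hρ h24 r₃ c₁ r₂ c₂ r₃ c₃ r₄ c₄ ?_
        simp only [↓reduceIte, h42, h14, h12']; omega
    · by_cases h41 : r₄ = r₁
      · subst h41
        -- rows `r₁ r₂ r₃ r₁`, `r₂ ≠ r₁`, `r₃ ≠ r₁`, and `r₃ ≠ r₂`: twist `(r₂, r₃)`
        have h32 : r₃ ≠ r₂ := fun h' => h (Or.inr ⟨rfl, h'.symm⟩)
        have h23 : r₂ ≠ r₃ := fun h' => h32 h'.symm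
        have h42 : r₄ ≠ r₂ := fun h' => h12 h'.symm
        have h43 : r₄ ≠ r₃ := fun h' => h31 h'.symm
        refine integral_mono_eq_zero_of_rowTwist ρ hρ h23 r₄ c₁ r₂ c₂ r₃ c₃ r₄ c₄ ?_
        simp only [↓reduceIte, h32, h42, h43]; omega
      · -- rows `r₁ r₂ r₃ r₄`, `r₃, r₄ ≠ r₁`: twist `(r₁, r₃)`
        have h13 : r₁ ≠ r₃ := fun h' => h31 h'.symm
        by_cases h23 : r₂ = r₃
        · subst h23
          by_cases h42 : r₄ = r₂
          · subst h42
            refine integral_mono_eq_zero_of_rowTwist ρ hρ h13 r₁ c₁ r₄ c₂ r₄ c₃ r₄ c₄ ?_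
            simp only [↓reduceIte, h12]; omega
          · refine integral_mono_eq_zero_of_rowTwist ρ hρ h13 r₁ c₁ r₂ c₂ r₂ c₃ r₄ c₄ ?_
            simp only [↓reduceIte, h12, h41, h42]; omega
        · by_cases h43 : r₄ = r₃
          · subst h43
            refine integral_mono_eq_zero_of_rowTwist ρ hρ h13 r₁ c₁ r₂ c₂ r₄ c₃ r₄ c₄ ?_
            simp only [↓reduceIte, h12, h23, h41]; omega
          · refine integral_mono_eq_zero_of_rowTwist ρ hρ h13 r₁ c₁ r₂ c₂ r₃ c₃ r₄ c₄ ?_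
            simp only [↓reduceIte, h12, h23, h31, h41, h43]; omega

/-- **Column support of the second moments**: `∫ 𝔪 = 0` unless the column multisets agree, `{c₁, c₂} = {c₃, c₄}`. [cite: CollinsSniady2006, Cor. 2.4 (invariant integration on U(N)/SU(N): low-degree Haar moments; bookkeeping)] -/
theorem integral_mono_eq_zero_of_cols (hρ : IsSpecialUnitaryModel ρ) (r₁ c₁ r₂ c₂ r₃ c₃ r₄ c₄ : Fin N)
    (h : ¬((c₁ = c₃ ∧ c₂ = c₄) ∨ (c₁ = c₄ ∧ c₂ = c₃))) :
    ∫ g, ((ρ g) r₁ c₁ * (ρ g) r₂ c₂ * (starRingEnd ℂ) ((ρ g) r₃ c₃) * (starRingEnd ℂ) ((ρ g) r₄ c₄)) ∂haarProbability G = 0 := by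
  by_cases h12 : c₂ = c₁
  · subst h12
    by_cases h31 : c₃ = c₂
    · subst h31
      have h4 : c₄ ≠ c₃ := fun h4 => h (Or.inl ⟨rfl, h4.symm⟩)
      refine integral_mono_eq_zero_of_colTwist ρ hρ (Ne.symm h4) r₁ c₃ r₂ c₃ r₃ c₃ r₄ c₄ ?_
      simp only [↓reduceIte, h4]; omega
    · have h13 : c₂ ≠ c₃ := fun h' => h31 h'.symm
      by_cases h42 : c₄ = c₂
      · subst h42
        refine integral_mono_eq_zero_of_colTwist ρ hρ h13 r₁ c₄ r₂ c₄ r₃ c₃ r₄ c₄ ?_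
        simp only [↓reduceIte, h31]; omega
      · by_cases h43 : c₄ = c₃
        · subst h43
          refine integral_mono_eq_zero_of_colTwist ρ hρ h13 r₁ c₂ r₂ c₂ r₃ c₄ r₄ c₄ ?_
          simp only [↓reduceIte, h31]; omega
        · refine integral_mono_eq_zero_of_colTwist ρ hρ h13 r₁ c₂ r₂ c₂ r₃ c₃ r₄ c₄ ?_
          simp only [↓reduceIte, h31, h42, h43]; omega
  · by_cases h31 : c₃ = c₁
    · subst h31
      have h42 : c₄ ≠ c₂ := fun h' => h (Or.inl ⟨rfl, h'.symm⟩)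
      have h24 : c₂ ≠ c₄ := fun h' => h42 h'.symm
      by_cases h41 : c₄ = c₃
      · subst h41
        refine integral_mono_eq_zero_of_colTwist ρ hρ h24 r₁ c₄ r₂ c₂ r₃ c₄ r₄ c₄ ?_
        simp only [↓reduceIte, h42]; omega
      · have h14 : c₃ ≠ c₄ := fun h' => h41 h'.symm
        have h12' : c₃ ≠ c₂ := fun h' => h12 h'.symm
        refine integral_mono_eq_zero_of_colTwist ρ hρ h24 r₁ c₃ r₂ c₂ r₃ c₃ r₄ c₄ ?_
        simp only [↓reduceIte, h42, h14, h12']; omega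
    · by_cases h41 : c₄ = c₁
      · subst h41
        have h32 : c₃ ≠ c₂ := fun h' => h (Or.inr ⟨rfl, h'.symm⟩)
        have h23 : c₂ ≠ c₃ := fun h' => h32 h'.symm
        have h42 : c₄ ≠ c₂ := fun h' => h12 h'.symm
        have h43 : c₄ ≠ c₃ := fun h' => h31 h'.symm
        refine integral_mono_eq_zero_of_colTwist ρ hρ h23 r₁ c₄ r₂ c₂ r₃ c₃ r₄ c₄ ?_
        simp only [↓reduceIte, h32, h42, h43]; omega
      · have h13 : c₁ ≠ c₃ := fun h' => h31 h'.symm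
        by_cases h23 : c₂ = c₃
        · subst h23
          by_cases h42 : c₄ = c₂
          · subst h42
            refine integral_mono_eq_zero_of_colTwist ρ hρ h13 r₁ c₁ r₂ c₄ r₃ c₄ r₄ c₄ ?_
            simp only [↓reduceIte, h12]; omega
          · refine integral_mono_eq_zero_of_colTwist ρ hρ h13 r₁ c₁ r₂ c₂ r₃ c₂ r₄ c₄ ?_
            simp only [↓reduceIte, h12, h41, h42]; omega
        · by_cases h43 : c₄ = c₃
          · subst h43
            refine integral_mono_eq_zero_of_colTwist ρ hρ h13 r₁ c₁ r₂ c₂ r₃ c₄ r₄ c₄ ?_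
            simp only [↓reduceIte, h12, h23, h41]; omega
          · refine integral_mono_eq_zero_of_colTwist ρ hρ h13 r₁ c₁ r₂ c₂ r₃ c₃ r₄ c₄ ?_
            simp only [↓reduceIte, h12, h23, h31, h41, h43]; omega

end Twist

end Literature.MathematicalPhysics.QuantumFieldTheory.ToronCumulant

end Part2

/-!
## Part 3 — port of `Summits/Ventures/YMGap/Thresholds/HaarFourthMomentSUN.lean` (14 declarations kept)

# The Haar moments of bidegree `(2,2)` of the ENTRIES of `SU(N)`, every `N ≥ 3`: `∫ |U₀₀|⁴ dU = 2/(N(N+1))` and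
# `∫ |U₀₀|²|U₀₁|² dU = 1/(N(N+1))` (row type C-PRESS, `β = 0` inputs, part 19a)

Cell `pub-ymgap`, seat ds-1 (gen 11). HONEST FRAMING: pure compact-group integration for a compact group `G ≅ SU(N)`
(`IsSpecialUnitaryModel ρ`), `N = 2 + n ≥ 3`; nothing lattice-specific, nothing about the continuum or the Clay problem. Kernel
theorems only, 0 compute, no definitions (the rotation is a local notation for an explicit matrix).

These are the second Weingarten values of `U(N)`/`SU(N)` (Creutz (8.22)), obtained WITHOUT Weingarten calculus, by invariance alone, in
the style of `RobustBall.HaarSecondMoments` (bidegree `(1,1)`) plus ONE non-monomial group element: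
* `rotMatrix n c s` (local notation) — the real rotation `((c, −s), (s, c)) ⊕ 1_n ∈ SU(2+n)` (`c² + s² = 1`; built with `Matrix.fromBlocks` and
  `finSumFinEquiv`); right multiplication mixes the columns `0, 1`: `(U R)_{a0} = c U_{a0} + s U_{a1}` (`mul_rotMatrix_apply`);
* the right phase twist `diag(i at 0, −i at 2)` kills `K = ∫ Re((U₀₀ Ū₀₁)²)` (`integral_sq_entry_mul_conj_entry`; needs the third index);
* the rotations `(3 ± 4·e)/5`: `∫ |(3U₀₀ ± 4U₀₁)/5|⁴ = ∫ |U₀₀|⁴`; adding the signs: `A := ∫|U₀₀|⁴ = 2 B`, `B := ∫ |U₀₀|²|U₀₁|²`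
  (`integral_normSq_sq_eq_two_mul`);
* the unitarity row sum (`Σ_j |U₀ⱼ|² = 1`, signed column swaps): `A + (N−1)B = ∫|U₀₀|² = 1/N`, hence ★★ `A = 2/(N(N+1))`,
  ★ `B = 1/(N(N+1))` (`integral_normSq_sq`, `integral_normSq_mul_normSq_row`; concretely `integral_normSq_sq_suN`).
Part 19b (`HaarFourthMomentSUNCross`) continues down column `0` and along row `1` (`∫|U₀₀|²|U₁₀|² = 1/(N(N+1))`,
`∫|U₀₀|²|U₁₁|² = 1/(N²−1)`); the intended use is `∫ |tr U|⁴ dU = 2` for every `N ≥ 3` (not drawn here). References: M. Creutz,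
*Quarks, gluons and lattices* (1983) §8 eq. (8.22); B. Collins, IMRN 2003 (Weingarten). Everything here is proved. [folklore]

(Verbatim declaration-level port — the declarations listed in the Part header count — of the Summits-side module; route
bookkeeping of the source docstring, if any, is historical; `local notation3` shorthands of the source are expanded in place.)
-/

section Part3

open _root_.MeasureTheory _root_.Complex
open Literature.MathematicalPhysics.QuantumLattice Literature.MathematicalPhysics.QuantumFieldTheory
open scoped _root_.Matrix

namespace Literature.MathematicalPhysics.QuantumFieldTheory.HaarMoments.HaarFourthMomentSUN

open RobustBall.HaarSecondMoments (integral_comp_mul_left integral_comp_mul_right diagonal_phase_mem swap_mul_sign_mem integral_eq_zero_of_neg integral_normSq_entry re_sq_eq)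

/-! ### The rotation in the `(0,1)` coordinate plane as an element of `SU(2+n)` -/

section Rotation

/-- The rotation block is unitary when `c² + s² = 1`. [cite: CollinsSniady2006, Cor. 2.4 (invariant integration on U(N)/SU(N): low-degree Haar moments; bookkeeping)] -/
theorem rotBlock_mul_conjTranspose (c s : ℝ) (h : c ^ 2 + s ^ 2 = 1) :
    ((Matrix.of ![![((c : ℝ) : ℂ), -((s : ℝ) : ℂ)], ![((s : ℝ) : ℂ), ((c : ℝ) : ℂ)]] : Matrix (Fin 2) (Fin 2) ℂ)) * (((Matrix.of ![![((c : ℝ) : ℂ), -((s : ℝ) : ℂ)], ![((s : ℝ) : ℂ), ((c : ℝ) : ℂ)]] : Matrix (Fin 2) (Fin 2) ℂ)))ᴴ = 1 := by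
  ext i j
  fin_cases i <;> fin_cases j <;>
    simp [Matrix.mul_apply, Fin.sum_univ_two, Matrix.conjTranspose_apply, Complex.conj_ofReal]
  all_goals (norm_cast; nlinarith [h])

/-- The rotation block has determinant `c² + s² = 1`. [cite: CollinsSniady2006, Cor. 2.4 (invariant integration on U(N)/SU(N): low-degree Haar moments; bookkeeping)] -/
theorem det_rotBlock (c s : ℝ) (h : c ^ 2 + s ^ 2 = 1) : (((Matrix.of ![![((c : ℝ) : ℂ), -((s : ℝ) : ℂ)], ![((s : ℝ) : ℂ), ((c : ℝ) : ℂ)]] : Matrix (Fin 2) (Fin 2) ℂ))).det = 1 := by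
  have h' : (c : ℂ) ^ 2 + (s : ℂ) ^ 2 = 1 := by exact_mod_cast h
  rw [Matrix.det_fin_two]
  simp
  linear_combination h'

/-- **The rotation `rotMatrix n c s` lies in `SU(2+n)`** (`c² + s² = 1`). [cite: CollinsSniady2006, Cor. 2.4 (invariant integration on U(N)/SU(N): low-degree Haar moments; bookkeeping)] -/
theorem rotMatrix_mem (n : ℕ) {c s : ℝ} (h : c ^ 2 + s ^ 2 = 1) :
    (Matrix.reindex finSumFinEquiv finSumFinEquiv (Matrix.fromBlocks (((Matrix.of ![![((c : ℝ) : ℂ), -((s : ℝ) : ℂ)], ![((s : ℝ) : ℂ), ((c : ℝ) : ℂ)]] : Matrix (Fin 2) (Fin 2) ℂ))) 0 0 (1 : Matrix (Fin n) (Fin n) ℂ))) ∈ Matrix.specialUnitaryGroup (Fin (2 + n)) ℂ := by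
  rw [Matrix.mem_specialUnitaryGroup_iff]
  refine ⟨?_, ?_⟩
  · rw [Matrix.mem_unitaryGroup_iff, Matrix.star_eq_conjTranspose, Matrix.reindex_apply,
      Matrix.conjTranspose_submatrix, Matrix.submatrix_mul_equiv, Matrix.fromBlocks_conjTranspose,
      Matrix.fromBlocks_multiply]
    simp only [Matrix.conjTranspose_zero, Matrix.conjTranspose_one, Matrix.mul_zero, Matrix.zero_mul, add_zero,
      zero_add, Matrix.mul_one, rotBlock_mul_conjTranspose c s h]
    rw [Matrix.fromBlocks_one, Matrix.submatrix_one_equiv]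
  · rw [Matrix.reindex_apply, Matrix.det_submatrix_equiv_self, Matrix.det_fromBlocks_zero₂₁, det_rotBlock c s h,
      Matrix.det_one, mul_one]

/-- **Right multiplication by the rotation mixes the columns `0, 1`**: `(M R)_{a0} = c M_{a0} + s M_{a1}` and
`(M R)_{a1} = −s M_{a0} + c M_{a1}`. [cite: CollinsSniady2006, Cor. 2.4 (invariant integration on U(N)/SU(N): low-degree Haar moments; bookkeeping)] -/
theorem mul_rotMatrix_apply (n : ℕ) (c s : ℝ) (M : Matrix (Fin (2 + n)) (Fin (2 + n)) ℂ) (a : Fin (2 + n)) :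
    (M * (Matrix.reindex finSumFinEquiv finSumFinEquiv (Matrix.fromBlocks (((Matrix.of ![![((c : ℝ) : ℂ), -((s : ℝ) : ℂ)], ![((s : ℝ) : ℂ), ((c : ℝ) : ℂ)]] : Matrix (Fin 2) (Fin 2) ℂ))) 0 0 (1 : Matrix (Fin n) (Fin n) ℂ)))) a 0 = (c : ℂ) * M a 0 + (s : ℂ) * M a 1 ∧
      (M * (Matrix.reindex finSumFinEquiv finSumFinEquiv (Matrix.fromBlocks (((Matrix.of ![![((c : ℝ) : ℂ), -((s : ℝ) : ℂ)], ![((s : ℝ) : ℂ), ((c : ℝ) : ℂ)]] : Matrix (Fin 2) (Fin 2) ℂ))) 0 0 (1 : Matrix (Fin n) (Fin n) ℂ)))) a 1 = -(s : ℂ) * M a 0 + (c : ℂ) * M a 1 := by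
  have e0 : (0 : Fin (2 + n)) = Fin.castAdd n (0 : Fin 2) := rfl
  have e1 : (1 : Fin (2 + n)) = Fin.castAdd n (1 : Fin 2) := by
    ext; simp [Nat.mod_eq_of_lt (show 1 < 2 + n by omega)]
  have key : ∀ j : Fin 2, (M * (Matrix.reindex finSumFinEquiv finSumFinEquiv (Matrix.fromBlocks (((Matrix.of ![![((c : ℝ) : ℂ), -((s : ℝ) : ℂ)], ![((s : ℝ) : ℂ), ((c : ℝ) : ℂ)]] : Matrix (Fin 2) (Fin 2) ℂ))) 0 0 (1 : Matrix (Fin n) (Fin n) ℂ)))) a (Fin.castAdd n j) =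
      ∑ i : Fin 2, M a (Fin.castAdd n i) * (((Matrix.of ![![((c : ℝ) : ℂ), -((s : ℝ) : ℂ)], ![((s : ℝ) : ℂ), ((c : ℝ) : ℂ)]] : Matrix (Fin 2) (Fin 2) ℂ))) i j := by
    intro j
    rw [Matrix.mul_apply, Fin.sum_univ_add]
    have h1 : ∀ i : Fin 2, ((Matrix.reindex finSumFinEquiv finSumFinEquiv (Matrix.fromBlocks (((Matrix.of ![![((c : ℝ) : ℂ), -((s : ℝ) : ℂ)], ![((s : ℝ) : ℂ), ((c : ℝ) : ℂ)]] : Matrix (Fin 2) (Fin 2) ℂ))) 0 0 (1 : Matrix (Fin n) (Fin n) ℂ)))) (Fin.castAdd n i) (Fin.castAdd n j) = (((Matrix.of ![![((c : ℝ) : ℂ), -((s : ℝ) : ℂ)], ![((s : ℝ) : ℂ), ((c : ℝ) : ℂ)]] : Matrix (Fin 2) (Fin 2) ℂ))) i j := by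
      intro i; simp
    have h2 : ∀ k : Fin n, ((Matrix.reindex finSumFinEquiv finSumFinEquiv (Matrix.fromBlocks (((Matrix.of ![![((c : ℝ) : ℂ), -((s : ℝ) : ℂ)], ![((s : ℝ) : ℂ), ((c : ℝ) : ℂ)]] : Matrix (Fin 2) (Fin 2) ℂ))) 0 0 (1 : Matrix (Fin n) (Fin n) ℂ)))) (Fin.natAdd 2 k) (Fin.castAdd n j) = 0 := by
      intro k; simp
    simp only [h1, h2, mul_zero, Finset.sum_const_zero, add_zero]
  rw [e0, e1, key, key, Fin.sum_univ_two, Fin.sum_univ_two]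
  simp [← e0, ← e1]
  constructor <;> ring

end Rotation

/-! ### The moments of bidegree `(2,2)` -/

section Moments

variable {n : ℕ} {G : Type*} [Group G] [TopologicalSpace G] [IsTopologicalGroup G] [CompactSpace G]
  [MeasurableSpace G] [BorelSpace G] (ρ : G →* Matrix (Fin (2 + n)) (Fin (2 + n)) ℂ)

/-- Real-valued polynomial functions of the entries are Haar integrable (continuity on a compact group). [cite: CollinsSniady2006, Cor. 2.4 (invariant integration on U(N)/SU(N): low-degree Haar moments; bookkeeping)] -/
theorem integrable_of_continuous' (_hρ : Continuous ρ) {f : G → ℝ} (hf : Continuous f) :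
    Integrable f (haarProbability G) :=
  hf.integrable_of_hasCompactSupport (HasCompactSupport.of_compactSpace _)

omit [IsTopologicalGroup G] [CompactSpace G] [MeasurableSpace G] [BorelSpace G] in
/-- Continuity of `g ↦ |ρ(g)_{ai}|²`. [cite: CollinsSniady2006, Cor. 2.4 (invariant integration on U(N)/SU(N): low-degree Haar moments; bookkeeping)] -/
theorem continuous_normSq_entry (hρ : Continuous ρ) (a i : Fin (2 + n)) :
    Continuous fun g => Complex.normSq (ρ g a i) :=
  Complex.continuous_normSq.comp (hρ.matrix_elem a i)

/-- **`∫ |ρ(g)₀₀|² dg = 1/N`** in real form. [cite: CollinsSniady2006, Cor. 2.4 (invariant integration on U(N)/SU(N): low-degree Haar moments; bookkeeping)] -/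
theorem integral_normSq_entry_real (hρ : IsSpecialUnitaryModel ρ) (a i : Fin (2 + n)) :
    ∫ g, Complex.normSq (ρ g a i) ∂haarProbability G = 1 / (2 + n : ℝ) := by
  have h := integral_normSq_entry ρ hρ a i
  simp_rw [Complex.mul_conj] at h
  rw [integral_complex_ofReal] at h
  have h' : ((∫ g, Complex.normSq (ρ g a i) ∂haarProbability G : ℝ) : ℂ) = ((1 / (2 + n : ℝ) : ℝ) : ℂ) := by
    rw [h]; push_cast; rw [one_div]
  exact_mod_cast h'

/-- **The cross term vanishes: `∫ (ρ(g)₀₀ conj ρ(g)₀₁)² dg = 0`** for `N ≥ 3` (right phase twist `diag(i at 0, −i at 2)`: the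
integrand changes sign). [cite: CollinsSniady2006, Cor. 2.4 (invariant integration on U(N)/SU(N): low-degree Haar moments; bookkeeping)] -/
theorem integral_sq_entry_mul_conj_entry (hρ : IsSpecialUnitaryModel ρ) (hn : 1 ≤ n) :
    ∫ g, (ρ g 0 0 * (starRingEnd ℂ) (ρ g 0 1)) ^ 2 ∂haarProbability G = 0 := by
  set t : Fin (2 + n) := ⟨2, by omega⟩ with ht
  have h0t : (0 : Fin (2 + n)) ≠ t := fun h => by
    have := congrArg Fin.val h; rw [ht] at this; simp at this
  have h1t : (1 : Fin (2 + n)) ≠ t := fun h => by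
    have := congrArg Fin.val h; rw [ht] at this
    simp [Nat.mod_eq_of_lt (show 1 < 2 + n by omega)] at this
  have h10 : (1 : Fin (2 + n)) ≠ 0 := fun h => by
    have := congrArg Fin.val h; simp [Nat.mod_eq_of_lt (show 1 < 2 + n by omega)] at this
  set D := Matrix.diagonal (Pi.mulSingle 0 Complex.I * Pi.mulSingle t (-Complex.I) : Fin (2 + n) → ℂ) with hD
  have hDm : D ∈ Matrix.specialUnitaryGroup (Fin (2 + n)) ℂ := by rw [hD]; exact diagonal_phase_mem 0 t h0t
  have h := integral_comp_mul_right ρ hρ hDm (fun M => (M 0 0 * (starRingEnd ℂ) (M 0 1)) ^ 2)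
  have hD0 : ∀ M : Matrix (Fin (2 + n)) (Fin (2 + n)) ℂ, (M * D) 0 0 = M 0 0 * Complex.I := fun M => by
    rw [hD, Matrix.mul_diagonal]; simp [Pi.mulSingle_eq_of_ne h0t]
  have hD1 : ∀ M : Matrix (Fin (2 + n)) (Fin (2 + n)) ℂ, (M * D) 0 1 = M 0 1 := fun M => by
    rw [hD, Matrix.mul_diagonal]; simp [Pi.mulSingle_eq_of_ne h1t, Pi.mulSingle_eq_of_ne h10]
  have hpt : ∀ M : Matrix (Fin (2 + n)) (Fin (2 + n)) ℂ,
      ((M * D) 0 0 * (starRingEnd ℂ) ((M * D) 0 1)) ^ 2 = -((M 0 0 * (starRingEnd ℂ) (M 0 1)) ^ 2) := fun M => by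
    rw [hD0, hD1]
    linear_combination ((M 0 0 * (starRingEnd ℂ) (M 0 1)) ^ 2) * Complex.I_mul_I
  simp only [hpt] at h
  exact integral_eq_zero_of_neg h

/-- `∫ Re(ρ₀₀ conj ρ₀₁)² dg = (∫ |ρ₀₀|²|ρ₀₁|² dg)/2` (`(Re z)² = (|z|² + Re z²)/2` and the cross term vanishes). [cite: CollinsSniady2006, Cor. 2.4 (invariant integration on U(N)/SU(N): low-degree Haar moments; bookkeeping)] -/
theorem integral_re_sq (hρ : IsSpecialUnitaryModel ρ) (hn : 1 ≤ n) :
    ∫ g, (ρ g 0 0 * (starRingEnd ℂ) (ρ g 0 1)).re ^ 2 ∂haarProbability G =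
      (∫ g, Complex.normSq (ρ g 0 0) * Complex.normSq (ρ g 0 1) ∂haarProbability G) / 2 := by
  have hc : Continuous fun g : G => ρ g 0 0 * (starRingEnd ℂ) (ρ g 0 1) :=
    (hρ.1.matrix_elem 0 0).mul (Complex.continuous_conj.comp (hρ.1.matrix_elem 0 1))
  simp_rw [re_sq_eq, Complex.normSq_mul, Complex.normSq_conj]
  have hi1 : Integrable (fun g => Complex.normSq (ρ g 0 0) * Complex.normSq (ρ g 0 1)) (haarProbability G) :=
    integrable_of_continuous' ρ hρ.1 ((continuous_normSq_entry ρ hρ.1 0 0).mul (continuous_normSq_entry ρ hρ.1 0 1))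
  have hi2c : Integrable (fun g => (ρ g 0 0 * (starRingEnd ℂ) (ρ g 0 1)) ^ 2) (haarProbability G) :=
    (hc.pow 2).integrable_of_hasCompactSupport (HasCompactSupport.of_compactSpace _)
  have hi2 : Integrable (fun g => ((ρ g 0 0 * (starRingEnd ℂ) (ρ g 0 1)) ^ 2).re) (haarProbability G) := hi2c.re
  rw [integral_div, integral_add hi1 hi2]
  have e2 : ∫ g, ((ρ g 0 0 * (starRingEnd ℂ) (ρ g 0 1)) ^ 2).re ∂haarProbability G = 0 := by
    have h := integral_re hi2c
    rw [integral_sq_entry_mul_conj_entry ρ hρ hn] at h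
    simpa using h
  rw [e2, add_zero]

/-- `∫ |ρ₀₁|⁴ = ∫ |ρ₀₀|⁴` (right signed transposition of the columns `0, 1`). [cite: CollinsSniady2006, Cor. 2.4 (invariant integration on U(N)/SU(N): low-degree Haar moments; bookkeeping)] -/
theorem integral_normSq_sq_col_one (hρ : IsSpecialUnitaryModel ρ) :
    ∫ g, Complex.normSq (ρ g 0 1) ^ 2 ∂haarProbability G = ∫ g, Complex.normSq (ρ g 0 0) ^ 2 ∂haarProbability G := by
  have h10 : (1 : Fin (2 + n)) ≠ 0 := fun h => by
    have := congrArg Fin.val h; simp [Nat.mod_eq_of_lt (show 1 < 2 + n by omega)] at this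
  set T := Matrix.swap ℂ (0 : Fin (2 + n)) 1 * Matrix.diagonal (Pi.mulSingle 0 (-1 : ℂ)) with hT
  have hTm : T ∈ Matrix.specialUnitaryGroup (Fin (2 + n)) ℂ := by rw [hT]; exact swap_mul_sign_mem 0 1 h10.symm
  have h := integral_comp_mul_right ρ hρ hTm (fun M => Complex.normSq (M 0 0) ^ 2)
  have hTa : ∀ M : Matrix (Fin (2 + n)) (Fin (2 + n)) ℂ, (M * T) 0 0 = -M 0 1 := fun M => by
    rw [hT, ← Matrix.mul_assoc, Matrix.mul_diagonal, Matrix.mul_swap_apply_left]; simp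
  have hpt : ∀ M : Matrix (Fin (2 + n)) (Fin (2 + n)) ℂ, Complex.normSq ((M * T) 0 0) ^ 2 = Complex.normSq (M 0 1) ^ 2 :=
    fun M => by rw [hTa, Complex.normSq_neg]
  simp only [hpt] at h
  exact h

/-- ★ **`∫ |ρ₀₀|⁴ dg = 2 ∫ |ρ₀₀|²|ρ₀₁|² dg`** for `N ≥ 3` — the one genuinely fourth-order relation, from the rotations `(3 ± 4e)/5` in
the column plane `(0, 1)`. [cite: CollinsSniady2006, Cor. 2.4 (invariant integration on U(N)/SU(N): low-degree Haar moments; bookkeeping)] -/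
theorem integral_normSq_sq_eq_two_mul (hρ : IsSpecialUnitaryModel ρ) (hn : 1 ≤ n) :
    ∫ g, Complex.normSq (ρ g 0 0) ^ 2 ∂haarProbability G =
      2 * ∫ g, Complex.normSq (ρ g 0 0) * Complex.normSq (ρ g 0 1) ∂haarProbability G := by
  -- notation: X = |U₀₀|², Y = |U₀₁|², W = Re(U₀₀ conj U₀₁)
  set X : G → ℝ := fun g => Complex.normSq (ρ g 0 0) with hX
  set Y : G → ℝ := fun g => Complex.normSq (ρ g 0 1) with hY
  set W : G → ℝ := fun g => (ρ g 0 0 * (starRingEnd ℂ) (ρ g 0 1)).re with hW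
  have cX : Continuous X := continuous_normSq_entry ρ hρ.1 0 0
  have cY : Continuous Y := continuous_normSq_entry ρ hρ.1 0 1
  have cW : Continuous W :=
    Complex.continuous_re.comp ((hρ.1.matrix_elem 0 0).mul (Complex.continuous_conj.comp (hρ.1.matrix_elem 0 1)))
  -- the rotated entry: |c U₀₀ + s U₀₁|² = c² X + s² Y + 2cs W
  have hns : ∀ (c s : ℝ) (g : G), Complex.normSq ((c : ℂ) * ρ g 0 0 + (s : ℂ) * ρ g 0 1) =
      c ^ 2 * X g + s ^ 2 * Y g + 2 * c * s * W g := by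
    intro c s g
    simp only [hX, hY, hW, Complex.normSq_apply, Complex.add_re, Complex.add_im, Complex.mul_re, Complex.mul_im,
      Complex.ofReal_re, Complex.ofReal_im, Complex.conj_re, Complex.conj_im]
    ring
  -- Haar invariance under the two rotations
  have hrot : ∀ (c s : ℝ), c ^ 2 + s ^ 2 = 1 →
      ∫ g, (c ^ 2 * X g + s ^ 2 * Y g + 2 * c * s * W g) ^ 2 ∂haarProbability G = ∫ g, X g ^ 2 ∂haarProbability G := by
    intro c s hcs
    have h := integral_comp_mul_right ρ hρ (rotMatrix_mem n hcs) (fun M => Complex.normSq (M 0 0) ^ 2)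
    have hpt : ∀ g : G, Complex.normSq ((ρ g * (Matrix.reindex finSumFinEquiv finSumFinEquiv (Matrix.fromBlocks (((Matrix.of ![![((c : ℝ) : ℂ), -((s : ℝ) : ℂ)], ![((s : ℝ) : ℂ), ((c : ℝ) : ℂ)]] : Matrix (Fin 2) (Fin 2) ℂ))) 0 0 (1 : Matrix (Fin n) (Fin n) ℂ)))) 0 0) ^ 2 =
        (c ^ 2 * X g + s ^ 2 * Y g + 2 * c * s * W g) ^ 2 := fun g => by
      rw [(mul_rotMatrix_apply n c s (ρ g) 0).1, hns]
    simp only [hpt] at h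
    exact h
  have hm := hrot (3 / 5) (4 / 5) (by norm_num)
  have hp := hrot (3 / 5) (-(4 / 5)) (by norm_num)
  -- add the two signs: odd terms cancel
  have iX2 : Integrable (fun g => X g ^ 2) (haarProbability G) := integrable_of_continuous' ρ hρ.1 (by fun_prop)
  have iY2 : Integrable (fun g => Y g ^ 2) (haarProbability G) := integrable_of_continuous' ρ hρ.1 (by fun_prop)
  have iXY : Integrable (fun g => X g * Y g) (haarProbability G) := integrable_of_continuous' ρ hρ.1 (by fun_prop)
  have iW2 : Integrable (fun g => W g ^ 2) (haarProbability G) := integrable_of_continuous' ρ hρ.1 (by fun_prop)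
  have i1 : Integrable (fun g => ((3 / 5 : ℝ) ^ 2 * X g + (4 / 5 : ℝ) ^ 2 * Y g + 2 * (3 / 5) * (4 / 5) * W g) ^ 2)
      (haarProbability G) := integrable_of_continuous' ρ hρ.1 (by fun_prop)
  have i2 : Integrable (fun g => ((3 / 5 : ℝ) ^ 2 * X g + (-(4 / 5) : ℝ) ^ 2 * Y g + 2 * (3 / 5) * (-(4 / 5)) * W g) ^ 2)
      (haarProbability G) := integrable_of_continuous' ρ hρ.1 (by fun_prop)
  have hsum : ∫ g, (((3 / 5 : ℝ) ^ 2 * X g + (4 / 5 : ℝ) ^ 2 * Y g + 2 * (3 / 5) * (4 / 5) * W g) ^ 2 +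
      ((3 / 5 : ℝ) ^ 2 * X g + (-(4 / 5) : ℝ) ^ 2 * Y g + 2 * (3 / 5) * (-(4 / 5)) * W g) ^ 2) ∂haarProbability G =
      2 * ∫ g, X g ^ 2 ∂haarProbability G := by
    rw [integral_add i1 i2, hm, hp]; ring
  have hpt : ∀ g : G, ((3 / 5 : ℝ) ^ 2 * X g + (4 / 5 : ℝ) ^ 2 * Y g + 2 * (3 / 5) * (4 / 5) * W g) ^ 2 +
      ((3 / 5 : ℝ) ^ 2 * X g + (-(4 / 5) : ℝ) ^ 2 * Y g + 2 * (3 / 5) * (-(4 / 5)) * W g) ^ 2 =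
      (162 / 625 : ℝ) * X g ^ 2 + (576 / 625 : ℝ) * (X g * Y g) + (512 / 625 : ℝ) * Y g ^ 2 +
        (1152 / 625 : ℝ) * W g ^ 2 := by
    intro g; ring
  simp only [hpt] at hsum
  have i12 : Integrable (fun g => (162 / 625 : ℝ) * X g ^ 2 + (576 / 625 : ℝ) * (X g * Y g)) (haarProbability G) :=
    (iX2.const_mul _).add (iXY.const_mul _)
  have i123 : Integrable (fun g => (162 / 625 : ℝ) * X g ^ 2 + (576 / 625 : ℝ) * (X g * Y g) + (512 / 625 : ℝ) * Y g ^ 2)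
      (haarProbability G) := i12.add (iY2.const_mul _)
  rw [integral_add i123 (iW2.const_mul _), integral_add i12 (iY2.const_mul _),
    integral_add (iX2.const_mul _) (iXY.const_mul _), integral_const_mul, integral_const_mul, integral_const_mul,
    integral_const_mul] at hsum
  have hY2 : ∫ g, Y g ^ 2 ∂haarProbability G = ∫ g, X g ^ 2 ∂haarProbability G := integral_normSq_sq_col_one ρ hρ
  have hW2 : ∫ g, W g ^ 2 ∂haarProbability G = (∫ g, X g * Y g ∂haarProbability G) / 2 := integral_re_sq ρ hρ hn
  rw [hY2, hW2] at hsum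
  linarith

/-- `∫ |ρ₀₀|² |ρ₀ⱼ|² = ∫ |ρ₀₀|² |ρ₀₁|²` for every column `j ≠ 0` (right signed transposition `1 ↔ j`, fixing column `0`). [cite: CollinsSniady2006, Cor. 2.4 (invariant integration on U(N)/SU(N): low-degree Haar moments; bookkeeping)] -/
theorem integral_normSq_mul_normSq_col (hρ : IsSpecialUnitaryModel ρ) {j : Fin (2 + n)} (hj : j ≠ 0) :
    ∫ g, Complex.normSq (ρ g 0 0) * Complex.normSq (ρ g 0 j) ∂haarProbability G =
      ∫ g, Complex.normSq (ρ g 0 0) * Complex.normSq (ρ g 0 1) ∂haarProbability G := by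
  rcases eq_or_ne j 1 with rfl | hj1
  · rfl
  have h10 : (1 : Fin (2 + n)) ≠ 0 := fun h => by
    have := congrArg Fin.val h; simp [Nat.mod_eq_of_lt (show 1 < 2 + n by omega)] at this
  set T := Matrix.swap ℂ (1 : Fin (2 + n)) j * Matrix.diagonal (Pi.mulSingle 1 (-1 : ℂ)) with hT
  have hTm : T ∈ Matrix.specialUnitaryGroup (Fin (2 + n)) ℂ := by rw [hT]; exact swap_mul_sign_mem 1 j hj1.symm
  have h := integral_comp_mul_right ρ hρ hTm (fun M => Complex.normSq (M 0 0) * Complex.normSq (M 0 1))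
  have hT1 : ∀ M : Matrix (Fin (2 + n)) (Fin (2 + n)) ℂ, (M * T) 0 1 = -M 0 j := fun M => by
    rw [hT, ← Matrix.mul_assoc, Matrix.mul_diagonal, Matrix.mul_swap_apply_left]; simp
  have hT0 : ∀ M : Matrix (Fin (2 + n)) (Fin (2 + n)) ℂ, (M * T) 0 0 = M 0 0 := fun M => by
    rw [hT, ← Matrix.mul_assoc, Matrix.mul_diagonal, Matrix.mul_swap_of_ne h10.symm hj.symm]
    simp [Pi.mulSingle_eq_of_ne h10.symm]
  have hpt : ∀ M : Matrix (Fin (2 + n)) (Fin (2 + n)) ℂ,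
      Complex.normSq ((M * T) 0 0) * Complex.normSq ((M * T) 0 1) = Complex.normSq (M 0 0) * Complex.normSq (M 0 j) :=
    fun M => by rw [hT0, hT1, Complex.normSq_neg]
  simp only [hpt] at h
  exact h

/-- **Unitarity row sum against `|ρ₀₀|²`**: `∫|ρ₀₀|⁴ + (N−1) ∫|ρ₀₀|²|ρ₀₁|² = ∫ |ρ₀₀|² = 1/N`. [cite: CollinsSniady2006, Cor. 2.4 (invariant integration on U(N)/SU(N): low-degree Haar moments; bookkeeping)] -/
theorem row_sum_identity (hρ : IsSpecialUnitaryModel ρ) :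
    ∫ g, Complex.normSq (ρ g 0 0) ^ 2 ∂haarProbability G +
        (1 + n : ℝ) * ∫ g, Complex.normSq (ρ g 0 0) * Complex.normSq (ρ g 0 1) ∂haarProbability G = 1 / (2 + n : ℝ) := by
  -- Σ_j |U₀ⱼ|² = 1 pointwise
  have hrow : ∀ g : G, ∑ j, Complex.normSq (ρ g 0 j) = 1 := by
    intro g
    have hu := IsSpecialUnitaryModel.mem_unitaryGroup ρ hρ g
    rw [Matrix.mem_unitaryGroup_iff] at hu
    have h := congrFun (congrFun hu 0) 0
    rw [Matrix.mul_apply, Matrix.one_apply_eq] at h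
    have h' : ∑ j, ((Complex.normSq (ρ g 0 j) : ℝ) : ℂ) = 1 := by
      rw [← h]
      refine Finset.sum_congr rfl fun j _ => ?_
      rw [Matrix.star_apply, Complex.star_def, Complex.mul_conj]
    exact_mod_cast h'
  have hpt : ∀ g : G, Complex.normSq (ρ g 0 0) = ∑ j, Complex.normSq (ρ g 0 0) * Complex.normSq (ρ g 0 j) := by
    intro g; rw [← Finset.mul_sum, hrow g, mul_one]
  have hint : ∀ j ∈ (Finset.univ : Finset (Fin (2 + n))),
      Integrable (fun g => Complex.normSq (ρ g 0 0) * Complex.normSq (ρ g 0 j)) (haarProbability G) := fun j _ =>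
    integrable_of_continuous' ρ hρ.1 ((continuous_normSq_entry ρ hρ.1 0 0).mul (continuous_normSq_entry ρ hρ.1 0 j))
  have h1 : ∫ g, Complex.normSq (ρ g 0 0) ∂haarProbability G =
      ∑ j, ∫ g, Complex.normSq (ρ g 0 0) * Complex.normSq (ρ g 0 j) ∂haarProbability G := by
    rw [← integral_finsetSum _ hint]
    exact integral_congr_ae (Filter.Eventually.of_forall hpt)
  rw [integral_normSq_entry_real ρ hρ 0 0, ← Finset.add_sum_erase _ _ (Finset.mem_univ (0 : Fin (2 + n)))] at h1
  have hterm : ∀ j ∈ (Finset.univ : Finset (Fin (2 + n))).erase 0,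
      ∫ g, Complex.normSq (ρ g 0 0) * Complex.normSq (ρ g 0 j) ∂haarProbability G =
      ∫ g, Complex.normSq (ρ g 0 0) * Complex.normSq (ρ g 0 1) ∂haarProbability G := fun j hj =>
    integral_normSq_mul_normSq_col ρ hρ (Finset.ne_of_mem_erase hj)
  rw [Finset.sum_congr rfl hterm, Finset.sum_const, Finset.card_erase_of_mem (Finset.mem_univ _), Finset.card_univ,
    Fintype.card_fin, nsmul_eq_mul] at h1
  have hsq : ∀ g : G, Complex.normSq (ρ g 0 0) * Complex.normSq (ρ g 0 0) = Complex.normSq (ρ g 0 0) ^ 2 := fun g => by ring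
  simp only [hsq] at h1
  have hcast : ((2 + n - 1 : ℕ) : ℝ) = 1 + n := by
    rw [show 2 + n - 1 = 1 + n by omega]; push_cast; ring
  rw [hcast] at h1
  linarith

/-- ★★ **`∫ |ρ(g)₀₀|⁴ dg = 2/(N(N+1))`** for a compact group `G ≅ SU(N)`, `N ≥ 3` — the fourth moment of a coordinate of a uniform
point on the complex sphere `S^{2N−1}` (Creutz (8.22) with all indices equal). [cite: CollinsSniady2006, Cor. 2.4 (invariant integration on U(N)/SU(N): low-degree Haar moments; bookkeeping)] -/
theorem integral_normSq_sq (hρ : IsSpecialUnitaryModel ρ) (hn : 1 ≤ n) :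
    ∫ g, Complex.normSq (ρ g 0 0) ^ 2 ∂haarProbability G = 2 / ((2 + n : ℝ) * (3 + n)) := by
  have h1 := row_sum_identity ρ hρ
  have h2 := integral_normSq_sq_eq_two_mul ρ hρ hn
  have hpos : (0 : ℝ) < (2 + n : ℝ) * (3 + n) := by positivity
  rw [eq_div_iff hpos.ne']
  field_simp at h1
  nlinarith [h1, h2]

end Moments

end Literature.MathematicalPhysics.QuantumFieldTheory.HaarMoments.HaarFourthMomentSUN

end Part3

/-!
## Part 4 — port of `Summits/Ventures/YMGap/Thresholds/HaarFourthMomentSUNCross.lean` (6 declarations kept)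

# The Haar moments of bidegree `(2,2)` of the entries of `SU(N)`, `N ≥ 3`, continued: `∫ |U₀₀|²|U₁₀|² dU = 1/(N(N+1))` and
# `∫ |U₀₀|²|U₁₁|² dU = 1/(N² − 1)` (row type C-PRESS, `β = 0` inputs, part 19b)

Cell `pub-ymgap`, seat ds-1 (gen 11). HONEST FRAMING: pure compact-group integration for a compact group `G ≅ SU(N)`, `N = 2 + n ≥ 3`;
nothing lattice-specific, nothing about the continuum or the Clay problem. Kernel theorems only, 0 compute, no definitions.

From part 19a (`∫|U₀₀|⁴ = 2/(N(N+1))`) and two more unitarity sums against `|U₀₀|²`: down column `0` (`Σ_a |U_{a0}|² = 1`, left signed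
row swaps fixing row `0`) ★ `∫|U₀₀|²|U₁₀|² = 1/(N(N+1))` (`integral_normSq_mul_normSq_colEntries`), and along row `1`
(`Σ_j |U₁ⱼ|² = 1`, right signed column swaps fixing column `0`) ★ `∫|U₀₀|²|U₁₁|² = 1/(N²−1)` (`integral_normSq_mul_normSq_diag`) —
the remaining moduli entries of the second Weingarten function, and by row orthogonality in mean square the exchange entry
★ `∫ U₀₀U₁₁Ū₀₁Ū₁₀ = −1/((N−1)N(N+1))` (`integral_exchange`) (Creutz (8.22)). Everything here is proved. [folklore]

(Verbatim declaration-level port — the declarations listed in the Part header count — of the Summits-side module; route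
bookkeeping of the source docstring, if any, is historical; `local notation3` shorthands of the source are expanded in place.)
-/

section Part4

open _root_.MeasureTheory _root_.Complex
open Literature.MathematicalPhysics.QuantumLattice Literature.MathematicalPhysics.QuantumFieldTheory
open scoped _root_.Matrix

namespace Literature.MathematicalPhysics.QuantumFieldTheory.HaarMoments.HaarFourthMomentSUN

open RobustBall.HaarSecondMoments (integral_comp_mul_left integral_comp_mul_right swap_mul_sign_mem)

section Moments

variable {n : ℕ} {G : Type*} [Group G] [TopologicalSpace G] [IsTopologicalGroup G] [CompactSpace G]
  [MeasurableSpace G] [BorelSpace G] (ρ : G →* Matrix (Fin (2 + n)) (Fin (2 + n)) ℂ)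

/-! ### Down column `0` and along row `1`: `∫|U₀₀|²|U₁₀|² = 1/(N(N+1))`, `∫|U₀₀|²|U₁₁|² = 1/(N²−1)` -/

/-- `1 ≠ 0` in `Fin (2+n)`.
[cite: CollinsSniady2006, Cor. 2.4 (invariant integration on U(N)/SU(N): low-degree Haar moments; bookkeeping)] -/
theorem one_ne_zero_fin : (1 : Fin (2 + n)) ≠ 0 := fun h => by
  have := congrArg Fin.val h; simp [Nat.mod_eq_of_lt (show 1 < 2 + n by omega)] at this

/-- `∫ |ρ₀₀|² |ρ_{a0}|² = ∫ |ρ₀₀|² |ρ₁₀|²` for every row `a ≠ 0` (left signed transposition `1 ↔ a`, fixing row `0`). [cite: CollinsSniady2006, Cor. 2.4 (invariant integration on U(N)/SU(N): low-degree Haar moments; bookkeeping)] -/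
theorem integral_normSq_mul_normSq_rowIdx (hρ : IsSpecialUnitaryModel ρ) {a : Fin (2 + n)} (ha : a ≠ 0) (k : Fin (2 + n)) :
    ∫ g, Complex.normSq (ρ g 0 0) * Complex.normSq (ρ g a k) ∂haarProbability G =
      ∫ g, Complex.normSq (ρ g 0 0) * Complex.normSq (ρ g 1 k) ∂haarProbability G := by
  rcases eq_or_ne a 1 with rfl | ha1
  · rfl
  set S := Matrix.swap ℂ (1 : Fin (2 + n)) a * Matrix.diagonal (Pi.mulSingle 1 (-1 : ℂ)) with hS
  have hSm : S ∈ Matrix.specialUnitaryGroup (Fin (2 + n)) ℂ := by rw [hS]; exact swap_mul_sign_mem 1 a ha1.symm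
  have h := integral_comp_mul_left ρ hρ hSm (fun M => Complex.normSq (M 0 0) * Complex.normSq (M 1 k))
  have hS1 : ∀ M : Matrix (Fin (2 + n)) (Fin (2 + n)) ℂ, (S * M) 1 k = M a k := fun M => by
    rw [hS, Matrix.mul_assoc, Matrix.swap_mul_apply_left, Matrix.diagonal_mul]
    simp [Pi.mulSingle_eq_of_ne ha1]
  have hS0 : ∀ M : Matrix (Fin (2 + n)) (Fin (2 + n)) ℂ, (S * M) 0 0 = M 0 0 := fun M => by
    rw [hS, Matrix.mul_assoc, Matrix.swap_mul_of_ne one_ne_zero_fin.symm ha.symm, Matrix.diagonal_mul]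
    simp [Pi.mulSingle_eq_of_ne (one_ne_zero_fin (n := n)).symm]
  have hpt : ∀ M : Matrix (Fin (2 + n)) (Fin (2 + n)) ℂ,
      Complex.normSq ((S * M) 0 0) * Complex.normSq ((S * M) 1 k) = Complex.normSq (M 0 0) * Complex.normSq (M a k) :=
    fun M => by rw [hS0, hS1]
  simp only [hpt] at h
  exact h

/-- **Unitarity column sum against `|ρ₀₀|²`**: `∫|ρ₀₀|⁴ + (N−1) ∫|ρ₀₀|²|ρ₁₀|² = 1/N`. [cite: CollinsSniady2006, Cor. 2.4 (invariant integration on U(N)/SU(N): low-degree Haar moments; bookkeeping)] -/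
theorem col_sum_identity (hρ : IsSpecialUnitaryModel ρ) :
    ∫ g, Complex.normSq (ρ g 0 0) ^ 2 ∂haarProbability G +
        (1 + n : ℝ) * ∫ g, Complex.normSq (ρ g 0 0) * Complex.normSq (ρ g 1 0) ∂haarProbability G = 1 / (2 + n : ℝ) := by
  -- Σ_a |U_{a0}|² = 1 pointwise (U* U = 1)
  have hcol : ∀ g : G, ∑ a, Complex.normSq (ρ g a 0) = 1 := by
    intro g
    have hu := IsSpecialUnitaryModel.mem_unitaryGroup ρ hρ g
    rw [Matrix.mem_unitaryGroup_iff'] at hu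
    have h := congrFun (congrFun hu 0) 0
    rw [Matrix.mul_apply, Matrix.one_apply_eq] at h
    have h' : ∑ a, ((Complex.normSq (ρ g a 0) : ℝ) : ℂ) = 1 := by
      rw [← h]
      refine Finset.sum_congr rfl fun a _ => ?_
      rw [Matrix.star_apply, Complex.star_def, ← Complex.mul_conj, mul_comm]
    exact_mod_cast h'
  have hpt : ∀ g : G, Complex.normSq (ρ g 0 0) = ∑ a, Complex.normSq (ρ g 0 0) * Complex.normSq (ρ g a 0) := by
    intro g; rw [← Finset.mul_sum, hcol g, mul_one]
  have hint : ∀ a ∈ (Finset.univ : Finset (Fin (2 + n))),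
      Integrable (fun g => Complex.normSq (ρ g 0 0) * Complex.normSq (ρ g a 0)) (haarProbability G) := fun a _ =>
    integrable_of_continuous' ρ hρ.1 ((continuous_normSq_entry ρ hρ.1 0 0).mul (continuous_normSq_entry ρ hρ.1 a 0))
  have h1 : ∫ g, Complex.normSq (ρ g 0 0) ∂haarProbability G =
      ∑ a, ∫ g, Complex.normSq (ρ g 0 0) * Complex.normSq (ρ g a 0) ∂haarProbability G := by
    rw [← integral_finsetSum _ hint]
    exact integral_congr_ae (Filter.Eventually.of_forall hpt)
  rw [integral_normSq_entry_real ρ hρ 0 0, ← Finset.add_sum_erase _ _ (Finset.mem_univ (0 : Fin (2 + n)))] at h1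
  have hterm : ∀ a ∈ (Finset.univ : Finset (Fin (2 + n))).erase 0,
      ∫ g, Complex.normSq (ρ g 0 0) * Complex.normSq (ρ g a 0) ∂haarProbability G =
      ∫ g, Complex.normSq (ρ g 0 0) * Complex.normSq (ρ g 1 0) ∂haarProbability G := fun a ha =>
    integral_normSq_mul_normSq_rowIdx ρ hρ (Finset.ne_of_mem_erase ha) 0
  rw [Finset.sum_congr rfl hterm, Finset.sum_const, Finset.card_erase_of_mem (Finset.mem_univ _), Finset.card_univ,
    Fintype.card_fin, nsmul_eq_mul] at h1
  have hsq : ∀ g : G, Complex.normSq (ρ g 0 0) * Complex.normSq (ρ g 0 0) = Complex.normSq (ρ g 0 0) ^ 2 := fun g => by ring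
  simp only [hsq] at h1
  have hcast : ((2 + n - 1 : ℕ) : ℝ) = 1 + n := by
    rw [show 2 + n - 1 = 1 + n by omega]; push_cast; ring
  rw [hcast] at h1
  linarith

/-- ★ **`∫ |ρ(g)₀₀|² |ρ(g)₁₀|² dg = 1/(N(N+1))`** (`N ≥ 3`; same column, different rows). [cite: CollinsSniady2006, Cor. 2.4 (invariant integration on U(N)/SU(N): low-degree Haar moments; bookkeeping)] -/
theorem integral_normSq_mul_normSq_colEntries (hρ : IsSpecialUnitaryModel ρ) (hn : 1 ≤ n) :
    ∫ g, Complex.normSq (ρ g 0 0) * Complex.normSq (ρ g 1 0) ∂haarProbability G = 1 / ((2 + n : ℝ) * (3 + n)) := by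
  have h1 := col_sum_identity ρ hρ
  rw [integral_normSq_sq ρ hρ hn] at h1
  have hpos : (0 : ℝ) < (2 + n : ℝ) * (3 + n) := by positivity
  have hpos1 : (0 : ℝ) < 1 + n := by positivity
  field_simp at h1
  rw [eq_div_iff hpos.ne']
  nlinarith [h1]

/-- **Unitarity row sum on row `1` against `|ρ₀₀|²`**: `∫|ρ₀₀|²|ρ₁₀|² + (N−1) ∫|ρ₀₀|²|ρ₁₁|² = 1/N`. [cite: CollinsSniady2006, Cor. 2.4 (invariant integration on U(N)/SU(N): low-degree Haar moments; bookkeeping)] -/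
theorem row_one_sum_identity (hρ : IsSpecialUnitaryModel ρ) :
    ∫ g, Complex.normSq (ρ g 0 0) * Complex.normSq (ρ g 1 0) ∂haarProbability G +
        (1 + n : ℝ) * ∫ g, Complex.normSq (ρ g 0 0) * Complex.normSq (ρ g 1 1) ∂haarProbability G = 1 / (2 + n : ℝ) := by
  have hrow : ∀ g : G, ∑ j, Complex.normSq (ρ g 1 j) = 1 := by
    intro g
    have hu := IsSpecialUnitaryModel.mem_unitaryGroup ρ hρ g
    rw [Matrix.mem_unitaryGroup_iff] at hu
    have h := congrFun (congrFun hu 1) 1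
    rw [Matrix.mul_apply, Matrix.one_apply_eq] at h
    have h' : ∑ j, ((Complex.normSq (ρ g 1 j) : ℝ) : ℂ) = 1 := by
      rw [← h]
      refine Finset.sum_congr rfl fun j _ => ?_
      rw [Matrix.star_apply, Complex.star_def, Complex.mul_conj]
    exact_mod_cast h'
  have hpt : ∀ g : G, Complex.normSq (ρ g 0 0) = ∑ j, Complex.normSq (ρ g 0 0) * Complex.normSq (ρ g 1 j) := by
    intro g; rw [← Finset.mul_sum, hrow g, mul_one]
  have hint : ∀ j ∈ (Finset.univ : Finset (Fin (2 + n))),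
      Integrable (fun g => Complex.normSq (ρ g 0 0) * Complex.normSq (ρ g 1 j)) (haarProbability G) := fun j _ =>
    integrable_of_continuous' ρ hρ.1 ((continuous_normSq_entry ρ hρ.1 0 0).mul (continuous_normSq_entry ρ hρ.1 1 j))
  have h1 : ∫ g, Complex.normSq (ρ g 0 0) ∂haarProbability G =
      ∑ j, ∫ g, Complex.normSq (ρ g 0 0) * Complex.normSq (ρ g 1 j) ∂haarProbability G := by
    rw [← integral_finsetSum _ hint]
    exact integral_congr_ae (Filter.Eventually.of_forall hpt)
  -- the terms j ≠ 0 all equal the j = 1 term (right signed swaps fixing column 0)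
  have hterm : ∀ j ∈ (Finset.univ : Finset (Fin (2 + n))).erase 0,
      ∫ g, Complex.normSq (ρ g 0 0) * Complex.normSq (ρ g 1 j) ∂haarProbability G =
      ∫ g, Complex.normSq (ρ g 0 0) * Complex.normSq (ρ g 1 1) ∂haarProbability G := by
    intro j hj
    have hj0 : j ≠ 0 := Finset.ne_of_mem_erase hj
    rcases eq_or_ne j 1 with rfl | hj1
    · rfl
    set T := Matrix.swap ℂ (1 : Fin (2 + n)) j * Matrix.diagonal (Pi.mulSingle 1 (-1 : ℂ)) with hT
    have hTm : T ∈ Matrix.specialUnitaryGroup (Fin (2 + n)) ℂ := by rw [hT]; exact swap_mul_sign_mem 1 j hj1.symm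
    have h := integral_comp_mul_right ρ hρ hTm (fun M => Complex.normSq (M 0 0) * Complex.normSq (M 1 1))
    have hT1 : ∀ M : Matrix (Fin (2 + n)) (Fin (2 + n)) ℂ, (M * T) 1 1 = -M 1 j := fun M => by
      rw [hT, ← Matrix.mul_assoc, Matrix.mul_diagonal, Matrix.mul_swap_apply_left]; simp
    have hT0 : ∀ M : Matrix (Fin (2 + n)) (Fin (2 + n)) ℂ, (M * T) 0 0 = M 0 0 := fun M => by
      rw [hT, ← Matrix.mul_assoc, Matrix.mul_diagonal, Matrix.mul_swap_of_ne one_ne_zero_fin.symm hj0.symm]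
      simp [Pi.mulSingle_eq_of_ne (one_ne_zero_fin (n := n)).symm]
    have hpt' : ∀ M : Matrix (Fin (2 + n)) (Fin (2 + n)) ℂ,
        Complex.normSq ((M * T) 0 0) * Complex.normSq ((M * T) 1 1) = Complex.normSq (M 0 0) * Complex.normSq (M 1 j) :=
      fun M => by rw [hT0, hT1, Complex.normSq_neg]
    simp only [hpt'] at h
    exact h
  rw [integral_normSq_entry_real ρ hρ 0 0, ← Finset.add_sum_erase _ _ (Finset.mem_univ (0 : Fin (2 + n))),
    Finset.sum_congr rfl hterm, Finset.sum_const, Finset.card_erase_of_mem (Finset.mem_univ _), Finset.card_univ,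
    Fintype.card_fin, nsmul_eq_mul] at h1
  have hcast : ((2 + n - 1 : ℕ) : ℝ) = 1 + n := by
    rw [show 2 + n - 1 = 1 + n by omega]; push_cast; ring
  rw [hcast] at h1
  linarith

/-- ★ **`∫ |ρ(g)₀₀|² |ρ(g)₁₁|² dg = 1/(N² − 1)`** (`N ≥ 3`; different rows and columns). [cite: CollinsSniady2006, Cor. 2.4 (invariant integration on U(N)/SU(N): low-degree Haar moments; bookkeeping)] -/
theorem integral_normSq_mul_normSq_diag (hρ : IsSpecialUnitaryModel ρ) (hn : 1 ≤ n) :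
    ∫ g, Complex.normSq (ρ g 0 0) * Complex.normSq (ρ g 1 1) ∂haarProbability G = 1 / ((1 + n : ℝ) * (3 + n)) := by
  have h1 := row_one_sum_identity ρ hρ
  rw [integral_normSq_mul_normSq_colEntries ρ hρ hn] at h1
  have hpos : (0 : ℝ) < (1 + n : ℝ) * (3 + n) := by positivity
  have hpos2 : (0 : ℝ) < (2 + n : ℝ) := by positivity
  field_simp at h1
  rw [eq_div_iff hpos.ne']
  nlinarith [h1]

end Moments

end Literature.MathematicalPhysics.QuantumFieldTheory.HaarMoments.HaarFourthMomentSUN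

end Part4

/-!
## Part 5 — port of `Summits/Ventures/YMGap/Thresholds/HaarFourthMoment.lean` (17 declarations kept)

# The Haar FOURTH moment of the `SU(2)` character: `∫ (Re tr U)⁴ dU = 2`, i.e. `E[(½ Re tr U_p)⁴] = 1/8`
# (row type C-PRESS, endpoint `β = 0`, part 10: the input of the fourth Balian–Drouffe–Itzykson coefficient)

Cell `pub-ymgap`, seat ds-1 (gen 11). HONEST FRAMING: pure compact-group integration for a compact group `G ≅ SU(2)`
(`IsSpecialUnitaryModel ρ`, the tree's standing hypothesis for the gauge group); nothing lattice-specific, nothing about the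
continuum or the Clay problem. Kernel theorems only, 0 compute, no definitions.

Write the first row of `ρ(g) ∈ SU(2)` as the unit quaternion `x = (x₀, x₁, x₂, x₃) = (Re U₀₀, Im U₀₀, Re U₀₁, Im U₀₁)`
(`su2Quat`, `quatMatrix_su2Quat` of `Literature/…/SU2Haar`), so that `Re tr ρ(g) = 2x₀` and `Σ x_a² = 1`.
Left multiplication by the special unitary matrix `quatMatrix q` of a unit quaternion `q` acts on `x` by quaternion
multiplication (`quatMatrix_mul_apply`), so Haar invariance (`RobustBall.HaarSecondMoments.integral_comp_mul_left`) gives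
`∫ F(q·x) dg = ∫ F(x) dg` (`integral_comp_quat`). Nine explicit unit quaternions suffice:
* `q = i, j, k`: `∫ x_a⁴ = ∫ x₀⁴ =: m₄` (`integral_im00_pow_four`, `integral_re01_pow_four`, `integral_im01_pow_four`);
* `q = (3 ± 4e_a)/5`: `∫ ((3x₀ ∓ 4x_a)/5)⁴ = m₄`; adding the two signs kills the odd moments and leaves
  `162 m₄ + 1728 ∫ x₀²x_a² + 512 m₄ = 1250 m₄`, i.e. **`∫ x₀² x_a² = m₄/3`** (`integral_re00_sq_mul_sq_*`);
* the unitarity row sum `x₀² + x₁² + x₂² + x₃² = 1` multiplied by `x₀²` and integrated: `m₄ + 3·(m₄/3) = ∫ x₀² = 1/4`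
  (`charVariance_eq_one`: `∫ (Re tr)² = 1`), hence ★ **`m₄ = ∫ (Re U₀₀)⁴ dU = 1/8`** (`integral_re00_pow_four`) and
  ★★ **`∫ (Re tr ρ(g))⁴ dg = 2`** (`integral_reTr_pow_four`; concretely `integral_reTr_pow_four_su2`,
  `integral_half_reTr_pow_four_su2 : ∫ (½ Re tr U)⁴ dU = 1/8`).
This is the fourth moment `C₂/8 = 2/16` of the Sato–Tate / semicircle law of `½ tr U` (density `(2/π)√(1−t²)`), equivalently
the multiplicity `2` of the trivial representation in `V^{⊗4}` for the fundamental `V` of `SU(2)` — obtained here without the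
Weyl integration formula, Peter–Weyl or Weingarten calculus. Also the odd moments vanish: `∫ (Re tr)³ = 0`
(`integral_reTr_pow_three`, centre twist `−1`). USE (ds-1 g10/g11, C-PRESS part 11): under the infinite Haar product
`dg_∞` (THE DLR state at `β = 0`) the fourth cumulant of the `SU(2)` plaquette variable `W_p = ½ Re tr U_p` is
`E W⁴ − 3(E W²)² = 1/8 − 3/16 = −1/16`, the number behind `f⁗(0) = −6` for the strong-coupling free energy density.
References: Balian–Drouffe–Itzykson, Phys. Rev. D 11 (1975) 2104, §III; M. Creutz, *Quarks, gluons and lattices* (1983)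
§8; T. Bröcker, T. tom Dieck, GTM 98 (1985) II §5. Everything here is proved. [folklore]

(Verbatim declaration-level port — the declarations listed in the Part header count — of the Summits-side module; route
bookkeeping of the source docstring, if any, is historical; `local notation3` shorthands of the source are expanded in place.)
-/

section Part5

open _root_.MeasureTheory _root_.Complex
open Literature.MathematicalPhysics.QuantumLattice Literature.MathematicalPhysics.QuantumFieldTheory
open scoped _root_.Quaternion

namespace Literature.MathematicalPhysics.QuantumFieldTheory.HaarMoments.HaarFourthMoment

section Model

variable {G : Type*} [Group G] [TopologicalSpace G] [IsTopologicalGroup G] [CompactSpace G]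
  [MeasurableSpace G] [BorelSpace G] (ρ : G →* Matrix (Fin 2) (Fin 2) ℂ)

omit [IsTopologicalGroup G] [CompactSpace G] [MeasurableSpace G] [BorelSpace G] in
/-- Every value of the model `ρ : G ≅ SU(2)` is a special unitary matrix. [cite: CollinsSniady2006, Cor. 2.4 (invariant integration on U(N)/SU(N): low-degree Haar moments; bookkeeping)] -/
theorem mem_SU (hρ : IsSpecialUnitaryModel ρ) (g : G) : ρ g ∈ Matrix.specialUnitaryGroup (Fin 2) ℂ := by
  have h : ρ g ∈ (Matrix.specialUnitaryGroup (Fin 2) ℂ : Set (Matrix (Fin 2) (Fin 2) ℂ)) :=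
    hρ.2.2 ▸ Set.mem_range_self g
  exact h

omit [IsTopologicalGroup G] [CompactSpace G] [MeasurableSpace G] [BorelSpace G] in
/-- **The unitarity row sum as a unit quaternion**: `(Re U₀₀)² + (Im U₀₀)² + (Re U₀₁)² + (Im U₀₁)² = 1` for
`U = ρ(g) ∈ SU(2)`. [cite: CollinsSniady2006, Cor. 2.4 (invariant integration on U(N)/SU(N): low-degree Haar moments; bookkeeping)] -/
theorem sum_sq_eq_one (hρ : IsSpecialUnitaryModel ρ) (g : G) :
    (ρ g 0 0).re ^ 2 + (ρ g 0 0).im ^ 2 + (ρ g 0 1).re ^ 2 + (ρ g 0 1).im ^ 2 = 1 := by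
  have h := normSq_su2Quat ⟨ρ g, mem_SU ρ hρ g⟩
  rw [Quaternion.normSq_def'] at h
  simpa [su2Quat] using h

omit [IsTopologicalGroup G] [CompactSpace G] [MeasurableSpace G] [BorelSpace G] in
/-- **`Re tr ρ(g) = 2 Re ρ(g)₀₀`** for `G ≅ SU(2)` (`U₁₁ = conj U₀₀`). [cite: CollinsSniady2006, Cor. 2.4 (invariant integration on U(N)/SU(N): low-degree Haar moments; bookkeeping)] -/
theorem reTr_eq_two_mul (hρ : IsSpecialUnitaryModel ρ) (g : G) :
    PlaquetteLowerBound.reTr ρ g = 2 * (ρ g 0 0).re := by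
  have h11 := su2_apply_11 ⟨ρ g, mem_SU ρ hρ g⟩
  change ρ g 1 1 = (starRingEnd ℂ) (ρ g 0 0) at h11
  unfold PlaquetteLowerBound.reTr
  rw [Matrix.trace_fin_two, Complex.add_re, h11, Complex.conj_re]
  ring

omit [IsTopologicalGroup G] [CompactSpace G] [MeasurableSpace G] [BorelSpace G] in
/-- **Left multiplication by `quatMatrix q` is quaternion multiplication on the first row**: for
`q = a + b i + c j + d k` and `U = ρ(g)` with first-row quaternion `x`, the first row of `quatMatrix q · U` is the
quaternion `q · x`, componentwise. [cite: CollinsSniady2006, Cor. 2.4 (invariant integration on U(N)/SU(N): low-degree Haar moments; bookkeeping)] -/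
theorem quatMatrix_mul_apply (hρ : IsSpecialUnitaryModel ρ) (a b c d : ℝ) (g : G) :
    ((quatMatrix ⟨a, b, c, d⟩ * ρ g) 0 0).re =
        a * (ρ g 0 0).re - b * (ρ g 0 0).im - c * (ρ g 0 1).re - d * (ρ g 0 1).im ∧
      ((quatMatrix ⟨a, b, c, d⟩ * ρ g) 0 0).im =
        a * (ρ g 0 0).im + b * (ρ g 0 0).re + c * (ρ g 0 1).im - d * (ρ g 0 1).re ∧
      ((quatMatrix ⟨a, b, c, d⟩ * ρ g) 0 1).re =
        a * (ρ g 0 1).re - b * (ρ g 0 1).im + c * (ρ g 0 0).re + d * (ρ g 0 0).im ∧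
      ((quatMatrix ⟨a, b, c, d⟩ * ρ g) 0 1).im =
        a * (ρ g 0 1).im + b * (ρ g 0 1).re - c * (ρ g 0 0).im + d * (ρ g 0 0).re := by
  set U : Matrix.specialUnitaryGroup (Fin 2) ℂ := ⟨ρ g, mem_SU ρ hρ g⟩ with hU
  have hρg : ρ g = quatMatrix (su2Quat U) := by rw [quatMatrix_su2Quat]
  rw [hρg, ← quatMatrix_mul]
  simp only [quatMatrix_apply_00, quatMatrix_apply_01, Quaternion.re_mul, Quaternion.imI_mul,
    Quaternion.imJ_mul, Quaternion.imK_mul, su2Quat, hU]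
  exact ⟨trivial, trivial, trivial, trivial⟩

/-- ★ **Haar invariance in quaternion coordinates**: for every unit quaternion `q = (a, b, c, d)` and every function `F`
of the first row `x = (Re U₀₀, Im U₀₀, Re U₀₁, Im U₀₁)` of `U = ρ(g)`, `∫ F(q · x) dg = ∫ F(x) dg`. [cite: CollinsSniady2006, Cor. 2.4 (invariant integration on U(N)/SU(N): low-degree Haar moments; bookkeeping)] -/
theorem integral_comp_quat (hρ : IsSpecialUnitaryModel ρ) {a b c d : ℝ} (h1 : a ^ 2 + b ^ 2 + c ^ 2 + d ^ 2 = 1)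
    (F : ℝ → ℝ → ℝ → ℝ → ℝ) :
    ∫ g, F (a * (ρ g 0 0).re - b * (ρ g 0 0).im - c * (ρ g 0 1).re - d * (ρ g 0 1).im)
        (a * (ρ g 0 0).im + b * (ρ g 0 0).re + c * (ρ g 0 1).im - d * (ρ g 0 1).re)
        (a * (ρ g 0 1).re - b * (ρ g 0 1).im + c * (ρ g 0 0).re + d * (ρ g 0 0).im)
        (a * (ρ g 0 1).im + b * (ρ g 0 1).re - c * (ρ g 0 0).im + d * (ρ g 0 0).re) ∂haarProbability G =
      ∫ g, F (ρ g 0 0).re (ρ g 0 0).im (ρ g 0 1).re (ρ g 0 1).im ∂haarProbability G := by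
  set q : ℍ := ⟨a, b, c, d⟩ with hq
  have hnq : ‖q‖ = 1 := by
    have hsq : Quaternion.normSq q = 1 := by rw [Quaternion.normSq_def']; simpa [hq] using h1
    rw [Quaternion.normSq_eq_norm_mul_self] at hsq
    nlinarith [norm_nonneg q]
  have h := RobustBall.HaarSecondMoments.integral_comp_mul_left ρ hρ (quatMatrix_mem_specialUnitaryGroup hnq)
    (fun M => F (M 0 0).re (M 0 0).im (M 0 1).re (M 0 1).im)
  have hpt : ∀ g : G, F ((quatMatrix q * ρ g) 0 0).re ((quatMatrix q * ρ g) 0 0).im ((quatMatrix q * ρ g) 0 1).re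
      ((quatMatrix q * ρ g) 0 1).im =
      F (a * (ρ g 0 0).re - b * (ρ g 0 0).im - c * (ρ g 0 1).re - d * (ρ g 0 1).im)
        (a * (ρ g 0 0).im + b * (ρ g 0 0).re + c * (ρ g 0 1).im - d * (ρ g 0 1).re)
        (a * (ρ g 0 1).re - b * (ρ g 0 1).im + c * (ρ g 0 0).re + d * (ρ g 0 0).im)
        (a * (ρ g 0 1).im + b * (ρ g 0 1).re - c * (ρ g 0 0).im + d * (ρ g 0 0).re) := by
    intro g
    obtain ⟨e1, e2, e3, e4⟩ := quatMatrix_mul_apply ρ hρ a b c d g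
    rw [e1, e2, e3, e4]
  simp only [hpt] at h
  exact h

omit [IsTopologicalGroup G] [CompactSpace G] [MeasurableSpace G] [BorelSpace G] in
/-- The four real coordinates of the first row are continuous. [cite: CollinsSniady2006, Cor. 2.4 (invariant integration on U(N)/SU(N): low-degree Haar moments; bookkeeping)] -/
theorem continuous_coords (hρ : IsSpecialUnitaryModel ρ) :
    Continuous (fun g => (ρ g 0 0).re) ∧ Continuous (fun g => (ρ g 0 0).im) ∧
      Continuous (fun g => (ρ g 0 1).re) ∧ Continuous (fun g => (ρ g 0 1).im) :=
  ⟨Complex.continuous_re.comp (hρ.1.matrix_elem 0 0), Complex.continuous_im.comp (hρ.1.matrix_elem 0 0),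
    Complex.continuous_re.comp (hρ.1.matrix_elem 0 1), Complex.continuous_im.comp (hρ.1.matrix_elem 0 1)⟩

/-! ### Fourth moments of single coordinates: `∫ x_a⁴ = ∫ x₀⁴` (`q = i, j, k`) -/

/-- `∫ (Im U₀₀)⁴ = ∫ (Re U₀₀)⁴` (left twist by `quatMatrix i = diag(i, −i)`). [cite: CollinsSniady2006, Cor. 2.4 (invariant integration on U(N)/SU(N): low-degree Haar moments; bookkeeping)] -/
theorem integral_im00_pow_four (hρ : IsSpecialUnitaryModel ρ) :
    ∫ g, (ρ g 0 0).im ^ 4 ∂haarProbability G = ∫ g, (ρ g 0 0).re ^ 4 ∂haarProbability G := by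
  have h := integral_comp_quat ρ hρ (a := 0) (b := 1) (c := 0) (d := 0) (by norm_num) (fun s _ _ _ => s ^ 4)
  have hpt : ∀ g : G, ((0 : ℝ) * (ρ g 0 0).re - 1 * (ρ g 0 0).im - 0 * (ρ g 0 1).re - 0 * (ρ g 0 1).im) ^ 4 =
      (ρ g 0 0).im ^ 4 := fun g => by ring
  simp only [hpt] at h
  exact h

/-- `∫ (Re U₀₁)⁴ = ∫ (Re U₀₀)⁴` (left twist by `quatMatrix j`). [cite: CollinsSniady2006, Cor. 2.4 (invariant integration on U(N)/SU(N): low-degree Haar moments; bookkeeping)] -/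
theorem integral_re01_pow_four (hρ : IsSpecialUnitaryModel ρ) :
    ∫ g, (ρ g 0 1).re ^ 4 ∂haarProbability G = ∫ g, (ρ g 0 0).re ^ 4 ∂haarProbability G := by
  have h := integral_comp_quat ρ hρ (a := 0) (b := 0) (c := 1) (d := 0) (by norm_num) (fun s _ _ _ => s ^ 4)
  have hpt : ∀ g : G, ((0 : ℝ) * (ρ g 0 0).re - 0 * (ρ g 0 0).im - 1 * (ρ g 0 1).re - 0 * (ρ g 0 1).im) ^ 4 =
      (ρ g 0 1).re ^ 4 := fun g => by ring
  simp only [hpt] at h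
  exact h

/-- `∫ (Im U₀₁)⁴ = ∫ (Re U₀₀)⁴` (left twist by `quatMatrix k`). [cite: CollinsSniady2006, Cor. 2.4 (invariant integration on U(N)/SU(N): low-degree Haar moments; bookkeeping)] -/
theorem integral_im01_pow_four (hρ : IsSpecialUnitaryModel ρ) :
    ∫ g, (ρ g 0 1).im ^ 4 ∂haarProbability G = ∫ g, (ρ g 0 0).re ^ 4 ∂haarProbability G := by
  have h := integral_comp_quat ρ hρ (a := 0) (b := 0) (c := 0) (d := 1) (by norm_num) (fun s _ _ _ => s ^ 4)
  have hpt : ∀ g : G, ((0 : ℝ) * (ρ g 0 0).re - 0 * (ρ g 0 0).im - 0 * (ρ g 0 1).re - 1 * (ρ g 0 1).im) ^ 4 =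
      (ρ g 0 1).im ^ 4 := fun g => by ring
  simp only [hpt] at h
  exact h

/-! ### Mixed moments: `∫ x₀² x_a² = (∫ x₀⁴)/3` (the rotations `q = (3 ± 4 e_a)/5`) -/

/-- The bookkeeping step: from `∫ ((3x₀ − 4y)/5)⁴ = ∫ ((3x₀ + 4y)/5)⁴ = ∫ x₀⁴ = ∫ y⁴` conclude `∫ x₀² y² = (∫ x₀⁴)/3`.
[cite: CollinsSniady2006, Cor. 2.4 (invariant integration on U(N)/SU(N): low-degree Haar moments; bookkeeping)] -/
theorem integral_sq_mul_sq_of_rotations {x y : G → ℝ} (hx : Continuous x) (hy : Continuous y)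
    (hm : ∫ g, ((3 * x g - 4 * y g) / 5) ^ 4 ∂haarProbability G = ∫ g, x g ^ 4 ∂haarProbability G)
    (hp : ∫ g, ((3 * x g + 4 * y g) / 5) ^ 4 ∂haarProbability G = ∫ g, x g ^ 4 ∂haarProbability G)
    (hy4 : ∫ g, y g ^ 4 ∂haarProbability G = ∫ g, x g ^ 4 ∂haarProbability G) :
    ∫ g, x g ^ 2 * y g ^ 2 ∂haarProbability G = (∫ g, x g ^ 4 ∂haarProbability G) / 3 := by
  have hi1 : Integrable (fun g => ((3 * x g - 4 * y g) / 5) ^ 4) (haarProbability G) :=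
    Continuous.integrable_of_hasCompactSupport (by fun_prop) (HasCompactSupport.of_compactSpace _)
  have hi2 : Integrable (fun g => ((3 * x g + 4 * y g) / 5) ^ 4) (haarProbability G) :=
    Continuous.integrable_of_hasCompactSupport (by fun_prop) (HasCompactSupport.of_compactSpace _)
  have hi3 : Integrable (fun g => (162 / 625 : ℝ) * x g ^ 4) (haarProbability G) :=
    Continuous.integrable_of_hasCompactSupport (by fun_prop) (HasCompactSupport.of_compactSpace _)
  have hi4 : Integrable (fun g => (1728 / 625 : ℝ) * (x g ^ 2 * y g ^ 2)) (haarProbability G) :=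
    Continuous.integrable_of_hasCompactSupport (by fun_prop) (HasCompactSupport.of_compactSpace _)
  have hi5 : Integrable (fun g => (512 / 625 : ℝ) * y g ^ 4) (haarProbability G) :=
    Continuous.integrable_of_hasCompactSupport (by fun_prop) (HasCompactSupport.of_compactSpace _)
  have hsum : ∫ g, (((3 * x g - 4 * y g) / 5) ^ 4 + ((3 * x g + 4 * y g) / 5) ^ 4) ∂haarProbability G =
      2 * ∫ g, x g ^ 4 ∂haarProbability G := by
    rw [integral_add hi1 hi2, hm, hp]; ring
  have hpt : ∀ g : G, ((3 * x g - 4 * y g) / 5) ^ 4 + ((3 * x g + 4 * y g) / 5) ^ 4 =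
      (162 / 625 : ℝ) * x g ^ 4 + (1728 / 625 : ℝ) * (x g ^ 2 * y g ^ 2) + (512 / 625 : ℝ) * y g ^ 4 := by
    intro g; ring
  simp only [hpt] at hsum
  have hi34 : Integrable (fun g => (162 / 625 : ℝ) * x g ^ 4 + (1728 / 625 : ℝ) * (x g ^ 2 * y g ^ 2))
      (haarProbability G) := hi3.add hi4
  rw [integral_add hi34 hi5, integral_add hi3 hi4, integral_const_mul, integral_const_mul,
    integral_const_mul, hy4] at hsum
  linarith

/-- `∫ (Re U₀₀)² (Im U₀₀)² = (∫ (Re U₀₀)⁴)/3` (rotations by `(3 ± 4i)/5` in the `(x₀, x₁)` plane). [cite: CollinsSniady2006, Cor. 2.4 (invariant integration on U(N)/SU(N): low-degree Haar moments; bookkeeping)] -/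
theorem integral_re00_sq_mul_im00_sq (hρ : IsSpecialUnitaryModel ρ) :
    ∫ g, (ρ g 0 0).re ^ 2 * (ρ g 0 0).im ^ 2 ∂haarProbability G =
      (∫ g, (ρ g 0 0).re ^ 4 ∂haarProbability G) / 3 := by
  obtain ⟨c0, c1, -, -⟩ := continuous_coords ρ hρ
  refine integral_sq_mul_sq_of_rotations c0 c1 ?_ ?_ (integral_im00_pow_four ρ hρ)
  · have h := integral_comp_quat ρ hρ (a := 3 / 5) (b := 4 / 5) (c := 0) (d := 0) (by norm_num)
      (fun s _ _ _ => s ^ 4)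
    have hpt : ∀ g : G, ((3 / 5 : ℝ) * (ρ g 0 0).re - 4 / 5 * (ρ g 0 0).im - 0 * (ρ g 0 1).re - 0 * (ρ g 0 1).im) ^ 4
        = ((3 * (ρ g 0 0).re - 4 * (ρ g 0 0).im) / 5) ^ 4 := fun g => by ring
    simp only [hpt] at h
    exact h
  · have h := integral_comp_quat ρ hρ (a := 3 / 5) (b := -(4 / 5)) (c := 0) (d := 0) (by norm_num)
      (fun s _ _ _ => s ^ 4)
    have hpt : ∀ g : G,
        ((3 / 5 : ℝ) * (ρ g 0 0).re - -(4 / 5) * (ρ g 0 0).im - 0 * (ρ g 0 1).re - 0 * (ρ g 0 1).im) ^ 4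
        = ((3 * (ρ g 0 0).re + 4 * (ρ g 0 0).im) / 5) ^ 4 := fun g => by ring
    simp only [hpt] at h
    exact h

/-- `∫ (Re U₀₀)² (Re U₀₁)² = (∫ (Re U₀₀)⁴)/3` (rotations by `(3 ± 4j)/5`). [cite: CollinsSniady2006, Cor. 2.4 (invariant integration on U(N)/SU(N): low-degree Haar moments; bookkeeping)] -/
theorem integral_re00_sq_mul_re01_sq (hρ : IsSpecialUnitaryModel ρ) :
    ∫ g, (ρ g 0 0).re ^ 2 * (ρ g 0 1).re ^ 2 ∂haarProbability G =
      (∫ g, (ρ g 0 0).re ^ 4 ∂haarProbability G) / 3 := by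
  obtain ⟨c0, -, c2, -⟩ := continuous_coords ρ hρ
  refine integral_sq_mul_sq_of_rotations c0 c2 ?_ ?_ (integral_re01_pow_four ρ hρ)
  · have h := integral_comp_quat ρ hρ (a := 3 / 5) (b := 0) (c := 4 / 5) (d := 0) (by norm_num)
      (fun s _ _ _ => s ^ 4)
    have hpt : ∀ g : G, ((3 / 5 : ℝ) * (ρ g 0 0).re - 0 * (ρ g 0 0).im - 4 / 5 * (ρ g 0 1).re - 0 * (ρ g 0 1).im) ^ 4
        = ((3 * (ρ g 0 0).re - 4 * (ρ g 0 1).re) / 5) ^ 4 := fun g => by ring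
    simp only [hpt] at h
    exact h
  · have h := integral_comp_quat ρ hρ (a := 3 / 5) (b := 0) (c := -(4 / 5)) (d := 0) (by norm_num)
      (fun s _ _ _ => s ^ 4)
    have hpt : ∀ g : G,
        ((3 / 5 : ℝ) * (ρ g 0 0).re - 0 * (ρ g 0 0).im - -(4 / 5) * (ρ g 0 1).re - 0 * (ρ g 0 1).im) ^ 4
        = ((3 * (ρ g 0 0).re + 4 * (ρ g 0 1).re) / 5) ^ 4 := fun g => by ring
    simp only [hpt] at h
    exact h

/-- `∫ (Re U₀₀)² (Im U₀₁)² = (∫ (Re U₀₀)⁴)/3` (rotations by `(3 ± 4k)/5`). [cite: CollinsSniady2006, Cor. 2.4 (invariant integration on U(N)/SU(N): low-degree Haar moments; bookkeeping)] -/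
theorem integral_re00_sq_mul_im01_sq (hρ : IsSpecialUnitaryModel ρ) :
    ∫ g, (ρ g 0 0).re ^ 2 * (ρ g 0 1).im ^ 2 ∂haarProbability G =
      (∫ g, (ρ g 0 0).re ^ 4 ∂haarProbability G) / 3 := by
  obtain ⟨c0, -, -, c3⟩ := continuous_coords ρ hρ
  refine integral_sq_mul_sq_of_rotations c0 c3 ?_ ?_ (integral_im01_pow_four ρ hρ)
  · have h := integral_comp_quat ρ hρ (a := 3 / 5) (b := 0) (c := 0) (d := 4 / 5) (by norm_num)
      (fun s _ _ _ => s ^ 4)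
    have hpt : ∀ g : G, ((3 / 5 : ℝ) * (ρ g 0 0).re - 0 * (ρ g 0 0).im - 0 * (ρ g 0 1).re - 4 / 5 * (ρ g 0 1).im) ^ 4
        = ((3 * (ρ g 0 0).re - 4 * (ρ g 0 1).im) / 5) ^ 4 := fun g => by ring
    simp only [hpt] at h
    exact h
  · have h := integral_comp_quat ρ hρ (a := 3 / 5) (b := 0) (c := 0) (d := -(4 / 5)) (by norm_num)
      (fun s _ _ _ => s ^ 4)
    have hpt : ∀ g : G,
        ((3 / 5 : ℝ) * (ρ g 0 0).re - 0 * (ρ g 0 0).im - 0 * (ρ g 0 1).re - -(4 / 5) * (ρ g 0 1).im) ^ 4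
        = ((3 * (ρ g 0 0).re + 4 * (ρ g 0 1).im) / 5) ^ 4 := fun g => by ring
    simp only [hpt] at h
    exact h

/-! ### The fourth moment -/

/-- **`∫ (Re U₀₀)² dg = 1/4`** (a quarter of the character variance `V₀(SU(2)) = 1`). [cite: CollinsSniady2006, Cor. 2.4 (invariant integration on U(N)/SU(N): low-degree Haar moments; bookkeeping)] -/
theorem integral_re00_sq (hρ : IsSpecialUnitaryModel ρ) :
    ∫ g, (ρ g 0 0).re ^ 2 ∂haarProbability G = 1 / 4 := by
  have hV := RobustBall.HaarSecondMoments.charVariance_eq_one ρ hρ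
  unfold PlaquetteLowerBound.charVariance at hV
  simp_rw [reTr_eq_two_mul ρ hρ, mul_pow] at hV
  rw [integral_const_mul] at hV
  linarith

/-- ★ **THE HAAR FOURTH MOMENT OF AN `SU(2)` ENTRY: `∫ (Re ρ(g)₀₀)⁴ dg = 1/8`** — the fourth moment of a coordinate of
a uniform point on `S³` (`E[u₀⁴] = 3/(n(n+2)) = 1/8` for `n = 4`). [cite: CollinsSniady2006, Cor. 2.4 (invariant integration on U(N)/SU(N): low-degree Haar moments; bookkeeping)] -/
theorem integral_re00_pow_four (hρ : IsSpecialUnitaryModel ρ) :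
    ∫ g, (ρ g 0 0).re ^ 4 ∂haarProbability G = 1 / 8 := by
  obtain ⟨c0, c1, c2, c3⟩ := continuous_coords ρ hρ
  -- integrate `x₀² · (x₀² + x₁² + x₂² + x₃²) = x₀²`
  have hpt : ∀ g : G, (ρ g 0 0).re ^ 2 =
      (ρ g 0 0).re ^ 4 + (ρ g 0 0).re ^ 2 * (ρ g 0 0).im ^ 2 + (ρ g 0 0).re ^ 2 * (ρ g 0 1).re ^ 2 +
        (ρ g 0 0).re ^ 2 * (ρ g 0 1).im ^ 2 := by
    intro g
    have h1 := sum_sq_eq_one ρ hρ g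
    linear_combination -((ρ g 0 0).re ^ 2 * h1)
  have hq : ∫ g, ((ρ g 0 0).re ^ 4 + (ρ g 0 0).re ^ 2 * (ρ g 0 0).im ^ 2 + (ρ g 0 0).re ^ 2 * (ρ g 0 1).re ^ 2 +
      (ρ g 0 0).re ^ 2 * (ρ g 0 1).im ^ 2) ∂haarProbability G = 1 / 4 := by
    rw [← integral_re00_sq ρ hρ]
    exact integral_congr_ae (Filter.Eventually.of_forall fun g => (hpt g).symm)
  have hi1 : Integrable (fun g => (ρ g 0 0).re ^ 4) (haarProbability G) :=
    Continuous.integrable_of_hasCompactSupport (by fun_prop) (HasCompactSupport.of_compactSpace _)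
  have hi2 : Integrable (fun g => (ρ g 0 0).re ^ 2 * (ρ g 0 0).im ^ 2) (haarProbability G) :=
    Continuous.integrable_of_hasCompactSupport (by fun_prop) (HasCompactSupport.of_compactSpace _)
  have hi3 : Integrable (fun g => (ρ g 0 0).re ^ 2 * (ρ g 0 1).re ^ 2) (haarProbability G) :=
    Continuous.integrable_of_hasCompactSupport (by fun_prop) (HasCompactSupport.of_compactSpace _)
  have hi4 : Integrable (fun g => (ρ g 0 0).re ^ 2 * (ρ g 0 1).im ^ 2) (haarProbability G) :=
    Continuous.integrable_of_hasCompactSupport (by fun_prop) (HasCompactSupport.of_compactSpace _)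
  have hi12 : Integrable (fun g => (ρ g 0 0).re ^ 4 + (ρ g 0 0).re ^ 2 * (ρ g 0 0).im ^ 2) (haarProbability G) :=
    hi1.add hi2
  have hi123 : Integrable (fun g => (ρ g 0 0).re ^ 4 + (ρ g 0 0).re ^ 2 * (ρ g 0 0).im ^ 2 +
      (ρ g 0 0).re ^ 2 * (ρ g 0 1).re ^ 2) (haarProbability G) := hi12.add hi3
  rw [integral_add hi123 hi4, integral_add hi12 hi3, integral_add hi1 hi2,
    integral_re00_sq_mul_im00_sq ρ hρ, integral_re00_sq_mul_re01_sq ρ hρ, integral_re00_sq_mul_im01_sq ρ hρ] at hq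
  linarith

/-- ★★ **THE HAAR FOURTH MOMENT OF THE `SU(2)` CHARACTER: `∫ (Re tr ρ(g))⁴ dg = 2`** for every compact group
`G ≅ SU(2)` — the Catalan number `C₂`, the number of invariants in `V^{⊗4}`. [cite: CollinsSniady2006, Cor. 2.4 (invariant integration on U(N)/SU(N): low-degree Haar moments; bookkeeping)] -/
theorem integral_reTr_pow_four (hρ : IsSpecialUnitaryModel ρ) :
    ∫ g, PlaquetteLowerBound.reTr ρ g ^ 4 ∂haarProbability G = 2 := by
  simp_rw [reTr_eq_two_mul ρ hρ, mul_pow]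
  rw [integral_const_mul, integral_re00_pow_four ρ hρ]
  norm_num

end Model

/-! ### The concrete group `SU(2) = Matrix.specialUnitaryGroup (Fin 2) ℂ` -/

/-- ★★ **`∫_{SU(2)} (Re tr U)⁴ dU = 2`** in the venture's vocabulary (`fundamentalRep (Fin 2)`). [cite: CollinsSniady2006, Cor. 2.4 (invariant integration on U(N)/SU(N): low-degree Haar moments; bookkeeping)] -/
theorem integral_reTr_pow_four_su2 :
    ∫ U, ((U : Matrix (Fin 2) (Fin 2) ℂ).trace.re) ^ 4 ∂haarProbability (Matrix.specialUnitaryGroup (Fin 2) ℂ) = 2 := by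
  have h := integral_reTr_pow_four (fundamentalRep (Fin 2)) (TorusAreaLaw.isSpecialUnitaryModel_fundamentalRep 2)
  simpa only [PlaquetteLowerBound.reTr, fundamentalRep_apply] using h

end Literature.MathematicalPhysics.QuantumFieldTheory.HaarMoments.HaarFourthMoment

end Part5

/-!
## Part 6 — port of `Summits/Ventures/YMGap/Thresholds/HaarFourthMomentSU2Entries.lean` (1 declarations kept)

# The `N = 2` row of the bidegree-(2,2) Haar moments: `∫_{SU(2)} |U₀₀|⁴ dU = 1/3`, `∫_{SU(2)} |U₀₀|²|U₀₁|² dU = 1/6`,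
# `∫_{SU(2)} U₀₀U₁₁Ū₀₁Ū₁₀ dU = −1/6`
# (row type C-PRESS, `β = 0` inputs, part 19′)

Cell `pub-ymgap`, seat ds-1 (gen 11). HONEST FRAMING: pure compact-group integration for `G ≅ SU(2)`; nothing lattice-specific, nothing
about the continuum or the Clay problem. Kernel theorems only, 0 compute, no definitions.

Part 19a (`HaarFourthMomentSUN`) proves `∫|U₀₀|⁴ = 2/(N(N+1))` and `∫|U₀₀|²|U₀₁|² = 1/(N(N+1))` for `N ≥ 3` (its phase-twist step needs a third
index). The same values hold for `N = 2` — `1/3` and `1/6` — and follow at once from part 10's quaternion-coordinate moments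
(`x = (Re U₀₀, Im U₀₀, Re U₀₁, Im U₀₁)` uniform on `S³`: `∫x₀⁴ = 1/8`, `∫x₀²x_a² = 1/24`): `|U₀₀|² = x₀² + x₁²`, `|U₀₁|² = x₂² + x₃²`, and the
twist by `quatMatrix i` supplies the two pair moments not containing `x₀`. Everything here is proved. [folklore]

(Verbatim declaration-level port — the declarations listed in the Part header count — of the Summits-side module; route
bookkeeping of the source docstring, if any, is historical; `local notation3` shorthands of the source are expanded in place.)
-/

section Part6

open _root_.MeasureTheory _root_.Complex
open Literature.MathematicalPhysics.QuantumLattice Literature.MathematicalPhysics.QuantumFieldTheory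

namespace Literature.MathematicalPhysics.QuantumFieldTheory.HaarMoments.HaarFourthMoment

section Model

variable {G : Type*} [Group G] [TopologicalSpace G] [IsTopologicalGroup G] [CompactSpace G]
  [MeasurableSpace G] [BorelSpace G] (ρ : G →* Matrix (Fin 2) (Fin 2) ℂ)

/-- ★ **`∫ |ρ(g)₀₀|⁴ dg = 1/3` for `G ≅ SU(2)`** (`= 2/(N(N+1))` at `N = 2`). [cite: CollinsSniady2006, Cor. 2.4 (invariant integration on U(N)/SU(N): low-degree Haar moments; bookkeeping)] -/
theorem integral_normSq_entry_sq_su2Model (hρ : IsSpecialUnitaryModel ρ) :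
    ∫ g, Complex.normSq (ρ g 0 0) ^ 2 ∂haarProbability G = 1 / 3 := by
  obtain ⟨c0, c1, c2, c3⟩ := continuous_coords ρ hρ
  have hpt : ∀ g : G, Complex.normSq (ρ g 0 0) ^ 2 =
      (ρ g 0 0).re ^ 4 + 2 * ((ρ g 0 0).re ^ 2 * (ρ g 0 0).im ^ 2) + (ρ g 0 0).im ^ 4 := fun g => by
    rw [Complex.normSq_apply]; ring
  simp_rw [hpt]
  have i1 : Integrable (fun g => (ρ g 0 0).re ^ 4) (haarProbability G) :=
    Continuous.integrable_of_hasCompactSupport (by fun_prop) (HasCompactSupport.of_compactSpace _)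
  have i2 : Integrable (fun g => 2 * ((ρ g 0 0).re ^ 2 * (ρ g 0 0).im ^ 2)) (haarProbability G) :=
    Continuous.integrable_of_hasCompactSupport (by fun_prop) (HasCompactSupport.of_compactSpace _)
  have i3 : Integrable (fun g => (ρ g 0 0).im ^ 4) (haarProbability G) :=
    Continuous.integrable_of_hasCompactSupport (by fun_prop) (HasCompactSupport.of_compactSpace _)
  have i12 : Integrable (fun g => (ρ g 0 0).re ^ 4 + 2 * ((ρ g 0 0).re ^ 2 * (ρ g 0 0).im ^ 2)) (haarProbability G) := i1.add i2
  rw [integral_add i12 i3, integral_add i1 i2, integral_const_mul, integral_re00_sq_mul_im00_sq ρ hρ,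
    integral_im00_pow_four ρ hρ, integral_re00_pow_four ρ hρ]
  norm_num

end Model

end Literature.MathematicalPhysics.QuantumFieldTheory.HaarMoments.HaarFourthMoment

end Part6

/-!
## Part 7 — port of `Summits/QuantumFields/YangMills/Theorems/ToronCumulantSignHaarMoments22.lean` (20 declarations kept)

# Route `ToronCumulantSign`, crux `CommutatorSkewMoment` (stmt-QuantumFields-27530) — helper II:
# the modulus moments of bidegree `(2,2)` of `SU(N)` at ARBITRARY index positions, every `N ≥ 2`

For a compact group `G ≅ SU(N)` (`IsSpecialUnitaryModel ρ`), `N = 2 + n ≥ 2`, the four values of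
`∫ |ρ_{r₁c₁}|² |ρ_{r₂c₂}|² dg` (Creutz (8.22); Collins–Śniady Cor. 2.4):
* same entry: `A = 2/(N(N+1))` (`integral_nn_same`);
* same row, different columns, or same column, different rows: `B = 1/(N(N+1))` (`integral_nn_row`, `integral_nn_col`);
* different rows and different columns: `C = 1/(N² − 1)` (`integral_nn_gen`),
transported from the tree's values at the positions `(0,0),(0,1),(1,0),(1,1)` (venture files `HaarFourthMomentSUN`, `N ≥ 3`, and
`HaarFourthMomentSU2Entries`, `N = 2`) by signed transpositions acting on rows (left) and columns (right), with `B` and `C`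
DERIVED from `A` by the unitarity row/column sums (so `N = 2` needs only `∫|U₀₀|⁴ = 1/3`).  Consequences used by the crux:
the diagonal sums `Σ_m ∫ |ρ_mm|²|ρ_ii|² = (N+2)/(N(N+1))` (`sum_integral_nn_diag_same`) and, for `i ≠ k`,
`Σ_m ∫ |ρ_mm|²|ρ_ik|² = (N²−2)/(N(N²−1))` (`sum_integral_nn_diag_off`).  HONEST LABEL: pure compact-group integration; helper
toward the OPEN crux `CommutatorSkewMoment`; nothing about the Yang–Mills mass gap.

References: M. Creutz, *Quarks, gluons and lattices* (1983) §8 (8.22); B. Collins, P. Śniady, CMP 264 (2006), Cor. 2.4.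

(Verbatim declaration-level port — the declarations listed in the Part header count — of the Summits-side module; route
bookkeeping of the source docstring, if any, is historical; `local notation3` shorthands of the source are expanded in place.)
-/

section Part7

open _root_.MeasureTheory _root_.Complex
open Literature.MathematicalPhysics.QuantumLattice Literature.MathematicalPhysics.QuantumFieldTheory

namespace Literature.MathematicalPhysics.QuantumFieldTheory.ToronCumulant

open Literature.MathematicalPhysics.QuantumFieldTheory.HaarMoments.RobustBall.HaarSecondMoments (integral_comp_mul_left integral_comp_mul_right swap_mul_sign_mem)
open Literature.MathematicalPhysics.QuantumFieldTheory.HaarMoments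

section Moments

variable {n : ℕ} {G : Type*} [Group G] [TopologicalSpace G] [IsTopologicalGroup G] [CompactSpace G]
  [MeasurableSpace G] [BorelSpace G] (ρ : G →* Matrix (Fin (2 + n)) (Fin (2 + n)) ℂ)

/-! ### Transport of index positions by signed transpositions -/

/-- `|(T X)_{rc}|² = |X_{σ r, c}|²` for the signed transposition `T` of `a ≠ b`, `σ = (a b)`. [cite: CollinsSniady2006, Cor. 2.4 (invariant integration on U(N)/SU(N): low-degree Haar moments; bookkeeping)] -/
theorem normSq_signedSwap_mul {a b : Fin (2 + n)} (hab : a ≠ b) (X : Matrix (Fin (2 + n)) (Fin (2 + n)) ℂ)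
    (r c : Fin (2 + n)) : Complex.normSq ((((Matrix.swap ℂ a b * Matrix.diagonal (Pi.mulSingle a (-1 : ℂ)) : Matrix (Fin (2 + n)) (Fin (2 + n)) ℂ)) * X) r c) = Complex.normSq (X (Equiv.swap a b r) c) := by
  rw [Matrix.mul_assoc]
  by_cases hra : r = a
  · rw [hra, Matrix.swap_mul_apply_left, Matrix.diagonal_mul, Equiv.swap_apply_left]
    simp [Pi.mulSingle_eq_of_ne hab.symm]
  · by_cases hrb : r = b
    · rw [hrb, Matrix.swap_mul_apply_right, Matrix.diagonal_mul, Equiv.swap_apply_right]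
      simp
    · rw [Matrix.swap_mul_of_ne hra hrb, Matrix.diagonal_mul, Equiv.swap_apply_of_ne_of_ne hra hrb]
      simp [Pi.mulSingle_eq_of_ne hra]

/-- `|(X T)_{rc}|² = |X_{r, σ c}|²` for the signed transposition `T` of `a ≠ b`, `σ = (a b)`. [cite: CollinsSniady2006, Cor. 2.4 (invariant integration on U(N)/SU(N): low-degree Haar moments; bookkeeping)] -/
theorem normSq_mul_signedSwap {a b : Fin (2 + n)} (hab : a ≠ b) (X : Matrix (Fin (2 + n)) (Fin (2 + n)) ℂ)
    (r c : Fin (2 + n)) : Complex.normSq ((X * ((Matrix.swap ℂ a b * Matrix.diagonal (Pi.mulSingle a (-1 : ℂ)) : Matrix (Fin (2 + n)) (Fin (2 + n)) ℂ))) r c) = Complex.normSq (X r (Equiv.swap a b c)) := by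
  rw [← Matrix.mul_assoc, Matrix.mul_diagonal]
  by_cases hca : c = a
  · rw [hca, Matrix.mul_swap_apply_left, Equiv.swap_apply_left]; simp
  · by_cases hcb : c = b
    · rw [hcb, Matrix.mul_swap_apply_right, Equiv.swap_apply_right]; simp [Pi.mulSingle_eq_of_ne hab.symm]
    · rw [Matrix.mul_swap_of_ne hca hcb, Equiv.swap_apply_of_ne_of_ne hca hcb]
      simp [Pi.mulSingle_eq_of_ne hca]

/-- **Row transport**: `∫ |ρ_{r₁c₁}|²|ρ_{r₂c₂}|² = ∫ |ρ_{σr₁,c₁}|²|ρ_{σr₂,c₂}|²` for `σ = (a b)`, `a ≠ b`. [cite: CollinsSniady2006, Cor. 2.4 (invariant integration on U(N)/SU(N): low-degree Haar moments; bookkeeping)] -/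
theorem integral_nn_swap_rows (hρ : IsSpecialUnitaryModel ρ) {a b : Fin (2 + n)} (hab : a ≠ b)
    (r₁ c₁ r₂ c₂ : Fin (2 + n)) :
    ∫ g, (Complex.normSq ((ρ g) r₁ c₁) * Complex.normSq ((ρ g) r₂ c₂)) ∂haarProbability G =
      ∫ g, (Complex.normSq ((ρ g) (Equiv.swap a b r₁) c₁) * Complex.normSq ((ρ g) (Equiv.swap a b r₂) c₂)) ∂haarProbability G := by
  have h := integral_comp_mul_left ρ hρ (swap_mul_sign_mem a b hab) (fun M => (Complex.normSq (M r₁ c₁) * Complex.normSq (M r₂ c₂)))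
  beta_reduce at h
  rw [← h]
  simp_rw [normSq_signedSwap_mul hab]

/-- **Column transport**: `∫ |ρ_{r₁c₁}|²|ρ_{r₂c₂}|² = ∫ |ρ_{r₁,σc₁}|²|ρ_{r₂,σc₂}|²` for `σ = (a b)`, `a ≠ b`. [cite: CollinsSniady2006, Cor. 2.4 (invariant integration on U(N)/SU(N): low-degree Haar moments; bookkeeping)] -/
theorem integral_nn_swap_cols (hρ : IsSpecialUnitaryModel ρ) {a b : Fin (2 + n)} (hab : a ≠ b)
    (r₁ c₁ r₂ c₂ : Fin (2 + n)) :
    ∫ g, (Complex.normSq ((ρ g) r₁ c₁) * Complex.normSq ((ρ g) r₂ c₂)) ∂haarProbability G =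
      ∫ g, (Complex.normSq ((ρ g) r₁ (Equiv.swap a b c₁)) * Complex.normSq ((ρ g) r₂ (Equiv.swap a b c₂))) ∂haarProbability G := by
  have h := integral_comp_mul_right ρ hρ (swap_mul_sign_mem a b hab) (fun M => (Complex.normSq (M r₁ c₁) * Complex.normSq (M r₂ c₂)))
  beta_reduce at h
  rw [← h]
  simp_rw [normSq_mul_signedSwap hab]

/-- **Rows to canonical position, distinct rows**: `∫ |ρ_{r₁c₁}|²|ρ_{r₂c₂}|² = ∫ |ρ_{0c₁}|²|ρ_{1c₂}|²` (`r₁ ≠ r₂`). [cite: CollinsSniady2006, Cor. 2.4 (invariant integration on U(N)/SU(N): low-degree Haar moments; bookkeeping)] -/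
theorem integral_nn_rows01 (hρ : IsSpecialUnitaryModel ρ) {r₁ r₂ : Fin (2 + n)} (h : r₁ ≠ r₂) (c₁ c₂ : Fin (2 + n)) :
    ∫ g, (Complex.normSq ((ρ g) r₁ c₁) * Complex.normSq ((ρ g) r₂ c₂)) ∂haarProbability G = ∫ g, (Complex.normSq ((ρ g) 0 c₁) * Complex.normSq ((ρ g) 1 c₂)) ∂haarProbability G := by
  -- step 1: move `r₁` to `0`
  have step1 : ∃ r : Fin (2 + n), r ≠ 0 ∧
      ∫ g, (Complex.normSq ((ρ g) r₁ c₁) * Complex.normSq ((ρ g) r₂ c₂)) ∂haarProbability G = ∫ g, (Complex.normSq ((ρ g) 0 c₁) * Complex.normSq ((ρ g) r c₂)) ∂haarProbability G := by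
    rcases eq_or_ne r₁ 0 with h0 | h0
    · subst h0; exact ⟨r₂, h.symm, rfl⟩
    · refine ⟨Equiv.swap r₁ 0 r₂, ?_, ?_⟩
      · intro h'
        have h'' := congrArg (Equiv.swap r₁ 0) h'
        rw [Equiv.swap_apply_self, Equiv.swap_apply_right] at h''
        exact h h''.symm
      · rw [integral_nn_swap_rows ρ hρ h0 r₁ c₁ r₂ c₂, Equiv.swap_apply_left]
  obtain ⟨r, hr0, hr⟩ := step1
  rw [hr]
  -- step 2: move `r` to `1`, fixing `0`
  rcases eq_or_ne r 1 with h1 | h1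
  · rw [h1]
  · rw [integral_nn_swap_rows ρ hρ h1 0 c₁ r c₂, Equiv.swap_apply_left,
      Equiv.swap_apply_of_ne_of_ne hr0.symm HaarFourthMomentSUN.one_ne_zero_fin.symm]

/-- **Rows to canonical position, equal rows**: `∫ |ρ_{rc₁}|²|ρ_{rc₂}|² = ∫ |ρ_{0c₁}|²|ρ_{0c₂}|²`. [cite: CollinsSniady2006, Cor. 2.4 (invariant integration on U(N)/SU(N): low-degree Haar moments; bookkeeping)] -/
theorem integral_nn_rows00 (hρ : IsSpecialUnitaryModel ρ) (r c₁ c₂ : Fin (2 + n)) :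
    ∫ g, (Complex.normSq ((ρ g) r c₁) * Complex.normSq ((ρ g) r c₂)) ∂haarProbability G = ∫ g, (Complex.normSq ((ρ g) 0 c₁) * Complex.normSq ((ρ g) 0 c₂)) ∂haarProbability G := by
  rcases eq_or_ne r 0 with h0 | h0
  · rw [h0]
  · rw [integral_nn_swap_rows ρ hρ h0 r c₁ r c₂, Equiv.swap_apply_left]

/-- **Columns to canonical position, distinct columns**: `∫ |ρ_{r₁c₁}|²|ρ_{r₂c₂}|² = ∫ |ρ_{r₁0}|²|ρ_{r₂1}|²` (`c₁ ≠ c₂`). [cite: CollinsSniady2006, Cor. 2.4 (invariant integration on U(N)/SU(N): low-degree Haar moments; bookkeeping)] -/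
theorem integral_nn_cols01 (hρ : IsSpecialUnitaryModel ρ) {c₁ c₂ : Fin (2 + n)} (h : c₁ ≠ c₂) (r₁ r₂ : Fin (2 + n)) :
    ∫ g, (Complex.normSq ((ρ g) r₁ c₁) * Complex.normSq ((ρ g) r₂ c₂)) ∂haarProbability G = ∫ g, (Complex.normSq ((ρ g) r₁ 0) * Complex.normSq ((ρ g) r₂ 1)) ∂haarProbability G := by
  have step1 : ∃ c : Fin (2 + n), c ≠ 0 ∧
      ∫ g, (Complex.normSq ((ρ g) r₁ c₁) * Complex.normSq ((ρ g) r₂ c₂)) ∂haarProbability G = ∫ g, (Complex.normSq ((ρ g) r₁ 0) * Complex.normSq ((ρ g) r₂ c)) ∂haarProbability G := by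
    rcases eq_or_ne c₁ 0 with h0 | h0
    · subst h0; exact ⟨c₂, h.symm, rfl⟩
    · refine ⟨Equiv.swap c₁ 0 c₂, ?_, ?_⟩
      · intro h'
        have h'' := congrArg (Equiv.swap c₁ 0) h'
        rw [Equiv.swap_apply_self, Equiv.swap_apply_right] at h''
        exact h h''.symm
      · rw [integral_nn_swap_cols ρ hρ h0 r₁ c₁ r₂ c₂, Equiv.swap_apply_left]
  obtain ⟨c, hc0, hc⟩ := step1
  rw [hc]
  rcases eq_or_ne c 1 with h1 | h1
  · rw [h1]
  · rw [integral_nn_swap_cols ρ hρ h1 r₁ 0 r₂ c, Equiv.swap_apply_left,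
      Equiv.swap_apply_of_ne_of_ne hc0.symm HaarFourthMomentSUN.one_ne_zero_fin.symm]

/-- **Columns to canonical position, equal columns**: `∫ |ρ_{r₁c}|²|ρ_{r₂c}|² = ∫ |ρ_{r₁0}|²|ρ_{r₂0}|²`. [cite: CollinsSniady2006, Cor. 2.4 (invariant integration on U(N)/SU(N): low-degree Haar moments; bookkeeping)] -/
theorem integral_nn_cols00 (hρ : IsSpecialUnitaryModel ρ) (c r₁ r₂ : Fin (2 + n)) :
    ∫ g, (Complex.normSq ((ρ g) r₁ c) * Complex.normSq ((ρ g) r₂ c)) ∂haarProbability G = ∫ g, (Complex.normSq ((ρ g) r₁ 0) * Complex.normSq ((ρ g) r₂ 0)) ∂haarProbability G := by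
  rcases eq_or_ne c 0 with h0 | h0
  · rw [h0]
  · rw [integral_nn_swap_cols ρ hρ h0 r₁ c r₂ c, Equiv.swap_apply_left]

/-! ### The values `A = 2/(N(N+1))`, `B = 1/(N(N+1))`, `C = 1/(N²−1)` at arbitrary positions -/

/-- Integrability of `|ρ_{r₁c₁}|²|ρ_{r₂c₂}|²`. [cite: CollinsSniady2006, Cor. 2.4 (invariant integration on U(N)/SU(N): low-degree Haar moments; bookkeeping)] -/
theorem integrable_nn (hρ : Continuous ρ) (r₁ c₁ r₂ c₂ : Fin (2 + n)) :
    Integrable (fun g => (Complex.normSq ((ρ g) r₁ c₁) * Complex.normSq ((ρ g) r₂ c₂))) (haarProbability G) :=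
  ((Complex.continuous_normSq.comp (hρ.matrix_elem r₁ c₁)).mul
    (Complex.continuous_normSq.comp (hρ.matrix_elem r₂ c₂))).integrable_of_hasCompactSupport
    (HasCompactSupport.of_compactSpace _)

/-- ★ **`A`: `∫ |ρ_{rc}|⁴ = 2/(N(N+1))`** at every position, every `N ≥ 2`. [cite: CollinsSniady2006, Cor. 2.4 (invariant integration on U(N)/SU(N): low-degree Haar moments; bookkeeping)] -/
theorem integral_nn_same (hρ : IsSpecialUnitaryModel ρ) (r c : Fin (2 + n)) :
    ∫ g, (Complex.normSq ((ρ g) r c) * Complex.normSq ((ρ g) r c)) ∂haarProbability G = 2 / ((2 + n : ℝ) * (3 + n)) := by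
  rw [integral_nn_rows00 ρ hρ r c c, integral_nn_cols00 ρ hρ c 0 0]
  simp_rw [← pow_two]
  rcases Nat.eq_zero_or_pos n with hn | hn
  · subst hn
    rw [HaarFourthMoment.integral_normSq_entry_sq_su2Model ρ hρ]
    norm_num
  · rw [HaarFourthMomentSUN.integral_normSq_sq ρ hρ hn]

omit [IsTopologicalGroup G] [CompactSpace G] [MeasurableSpace G] [BorelSpace G] in
/-- The unitarity row sum `Σ_c |ρ_{rc}|² = 1`. [cite: CollinsSniady2006, Cor. 2.4 (invariant integration on U(N)/SU(N): low-degree Haar moments; bookkeeping)] -/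
theorem sum_normSq_row (hρ : IsSpecialUnitaryModel ρ) (g : G) (r : Fin (2 + n)) :
    ∑ c, Complex.normSq (ρ g r c) = 1 := by
  have hu := IsSpecialUnitaryModel.mem_unitaryGroup ρ hρ g
  rw [Matrix.mem_unitaryGroup_iff] at hu
  have h := congrFun (congrFun hu r) r
  rw [Matrix.mul_apply, Matrix.one_apply_eq] at h
  have h' : ∑ c, ((Complex.normSq (ρ g r c) : ℝ) : ℂ) = 1 := by
    rw [← h]
    refine Finset.sum_congr rfl fun c _ => ?_
    rw [Matrix.star_apply, Complex.star_def, Complex.mul_conj]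
  exact_mod_cast h'

omit [IsTopologicalGroup G] [CompactSpace G] [MeasurableSpace G] [BorelSpace G] in
/-- The unitarity column sum `Σ_r |ρ_{rc}|² = 1`. [cite: CollinsSniady2006, Cor. 2.4 (invariant integration on U(N)/SU(N): low-degree Haar moments; bookkeeping)] -/
theorem sum_normSq_col (hρ : IsSpecialUnitaryModel ρ) (g : G) (c : Fin (2 + n)) :
    ∑ r, Complex.normSq (ρ g r c) = 1 := by
  have hu := IsSpecialUnitaryModel.mem_unitaryGroup ρ hρ g
  rw [Matrix.mem_unitaryGroup_iff'] at hu
  have h := congrFun (congrFun hu c) c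
  rw [Matrix.mul_apply, Matrix.one_apply_eq] at h
  have h' : ∑ r, ((Complex.normSq (ρ g r c) : ℝ) : ℂ) = 1 := by
    rw [← h]
    refine Finset.sum_congr rfl fun r _ => ?_
    rw [Matrix.star_apply, Complex.star_def, Complex.normSq_eq_conj_mul_self]
  exact_mod_cast h'

/-- `Σ_{c} ∫ |ρ₀₀|²|ρ_{r c}|² = ∫ |ρ₀₀|² = 1/N` (row sum against `|ρ₀₀|²`). [cite: CollinsSniady2006, Cor. 2.4 (invariant integration on U(N)/SU(N): low-degree Haar moments; bookkeeping)] -/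
theorem sum_integral_nn_rowSum (hρ : IsSpecialUnitaryModel ρ) (r : Fin (2 + n)) :
    ∑ c, ∫ g, (Complex.normSq ((ρ g) 0 0) * Complex.normSq ((ρ g) r c)) ∂haarProbability G = 1 / (2 + n : ℝ) := by
  rw [← integral_finsetSum _ (fun c _ => integrable_nn ρ hρ.1 0 0 r c)]
  have hpt : ∀ g : G, ∑ c, (Complex.normSq ((ρ g) 0 0) * Complex.normSq ((ρ g) r c)) = Complex.normSq (ρ g 0 0) := fun g => by
    rw [← Finset.mul_sum, sum_normSq_row ρ hρ g r, mul_one]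
  simp_rw [hpt]
  exact HaarFourthMomentSUN.integral_normSq_entry_real ρ hρ 0 0

/-- `Σ_{r} ∫ |ρ₀₀|²|ρ_{r c}|² = 1/N` (column sum against `|ρ₀₀|²`). [cite: CollinsSniady2006, Cor. 2.4 (invariant integration on U(N)/SU(N): low-degree Haar moments; bookkeeping)] -/
theorem sum_integral_nn_colSum (hρ : IsSpecialUnitaryModel ρ) (c : Fin (2 + n)) :
    ∑ r, ∫ g, (Complex.normSq ((ρ g) 0 0) * Complex.normSq ((ρ g) r c)) ∂haarProbability G = 1 / (2 + n : ℝ) := by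
  rw [← integral_finsetSum _ (fun r _ => integrable_nn ρ hρ.1 0 0 r c)]
  have hpt : ∀ g : G, ∑ r, (Complex.normSq ((ρ g) 0 0) * Complex.normSq ((ρ g) r c)) = Complex.normSq (ρ g 0 0) := fun g => by
    rw [← Finset.mul_sum, sum_normSq_col ρ hρ g c, mul_one]
  simp_rw [hpt]
  exact HaarFourthMomentSUN.integral_normSq_entry_real ρ hρ 0 0

/-- A sum over `Fin (2+n)` splits off the term at `0`; the other terms, all equal to `v`, contribute `(N−1) v`. [cite: CollinsSniady2006, Cor. 2.4 (invariant integration on U(N)/SU(N): low-degree Haar moments; bookkeeping)] -/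
theorem sum_eq_add_of_eq_off_zero {f : Fin (2 + n) → ℝ} {v : ℝ} (h : ∀ i, i ≠ 0 → f i = v) :
    ∑ i, f i = f 0 + (1 + n : ℝ) * v := by
  rw [← Finset.add_sum_erase Finset.univ f (Finset.mem_univ 0)]
  congr 1
  rw [Finset.sum_congr rfl fun i hi => h i (Finset.ne_of_mem_erase hi), Finset.sum_const, Finset.card_erase_of_mem
    (Finset.mem_univ _), Finset.card_univ, Fintype.card_fin, show 2 + n - 1 = 1 + n by omega, nsmul_eq_mul]
  push_cast
  ring

/-- ★ **`B` (same row): `∫ |ρ_{rc₁}|²|ρ_{rc₂}|² = 1/(N(N+1))`** for `c₁ ≠ c₂`, every `N ≥ 2` (from `A` and the row sum). [cite: CollinsSniady2006, Cor. 2.4 (invariant integration on U(N)/SU(N): low-degree Haar moments; bookkeeping)] -/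
theorem integral_nn_row (hρ : IsSpecialUnitaryModel ρ) (r : Fin (2 + n)) {c₁ c₂ : Fin (2 + n)} (h : c₁ ≠ c₂) :
    ∫ g, (Complex.normSq ((ρ g) r c₁) * Complex.normSq ((ρ g) r c₂)) ∂haarProbability G = 1 / ((2 + n : ℝ) * (3 + n)) := by
  rw [integral_nn_rows00 ρ hρ r c₁ c₂, integral_nn_cols01 ρ hρ h 0 0]
  have hs := sum_integral_nn_rowSum ρ hρ 0
  have hoff : ∀ c : Fin (2 + n), c ≠ 0 →
      ∫ g, (Complex.normSq ((ρ g) 0 0) * Complex.normSq ((ρ g) 0 c)) ∂haarProbability G = ∫ g, (Complex.normSq ((ρ g) 0 0) * Complex.normSq ((ρ g) 0 1)) ∂haarProbability G :=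
    fun c hc => integral_nn_cols01 ρ hρ hc.symm 0 0
  rw [sum_eq_add_of_eq_off_zero hoff, integral_nn_same ρ hρ 0 0] at hs
  have hpos : (0 : ℝ) < (2 + n : ℝ) * (3 + n) := by positivity
  have hpos1 : (0 : ℝ) < (1 + n : ℝ) := by positivity
  field_simp at hs
  rw [eq_div_iff hpos.ne']
  nlinarith [hs]

/-- ★ **`B` (same column): `∫ |ρ_{r₁c}|²|ρ_{r₂c}|² = 1/(N(N+1))`** for `r₁ ≠ r₂`, every `N ≥ 2`. [cite: CollinsSniady2006, Cor. 2.4 (invariant integration on U(N)/SU(N): low-degree Haar moments; bookkeeping)] -/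
theorem integral_nn_col (hρ : IsSpecialUnitaryModel ρ) (c : Fin (2 + n)) {r₁ r₂ : Fin (2 + n)} (h : r₁ ≠ r₂) :
    ∫ g, (Complex.normSq ((ρ g) r₁ c) * Complex.normSq ((ρ g) r₂ c)) ∂haarProbability G = 1 / ((2 + n : ℝ) * (3 + n)) := by
  rw [integral_nn_cols00 ρ hρ c r₁ r₂, integral_nn_rows01 ρ hρ h 0 0]
  have hs := sum_integral_nn_colSum ρ hρ 0
  have hoff : ∀ r : Fin (2 + n), r ≠ 0 →
      ∫ g, (Complex.normSq ((ρ g) 0 0) * Complex.normSq ((ρ g) r 0)) ∂haarProbability G = ∫ g, (Complex.normSq ((ρ g) 0 0) * Complex.normSq ((ρ g) 1 0)) ∂haarProbability G :=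
    fun r hr => integral_nn_rows01 ρ hρ hr.symm 0 0
  rw [sum_eq_add_of_eq_off_zero hoff, integral_nn_same ρ hρ 0 0] at hs
  have hpos : (0 : ℝ) < (2 + n : ℝ) * (3 + n) := by positivity
  have hpos1 : (0 : ℝ) < (1 + n : ℝ) := by positivity
  field_simp at hs
  rw [eq_div_iff hpos.ne']
  nlinarith [hs]

/-- ★ **`C`: `∫ |ρ_{r₁c₁}|²|ρ_{r₂c₂}|² = 1/(N²−1)`** for `r₁ ≠ r₂`, `c₁ ≠ c₂`, every `N ≥ 2` (from `B` and the row sum of row `1`).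
[cite: CollinsSniady2006, Cor. 2.4 (invariant integration on U(N)/SU(N): low-degree Haar moments; bookkeeping)] -/
theorem integral_nn_gen (hρ : IsSpecialUnitaryModel ρ) {r₁ r₂ c₁ c₂ : Fin (2 + n)} (hr : r₁ ≠ r₂) (hc : c₁ ≠ c₂) :
    ∫ g, (Complex.normSq ((ρ g) r₁ c₁) * Complex.normSq ((ρ g) r₂ c₂)) ∂haarProbability G = 1 / ((1 + n : ℝ) * (3 + n)) := by
  rw [integral_nn_rows01 ρ hρ hr, integral_nn_cols01 ρ hρ hc 0 1]
  have hs := sum_integral_nn_rowSum ρ hρ 1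
  have hoff : ∀ c : Fin (2 + n), c ≠ 0 →
      ∫ g, (Complex.normSq ((ρ g) 0 0) * Complex.normSq ((ρ g) 1 c)) ∂haarProbability G = ∫ g, (Complex.normSq ((ρ g) 0 0) * Complex.normSq ((ρ g) 1 1)) ∂haarProbability G :=
    fun c hc => integral_nn_cols01 ρ hρ hc.symm 0 1
  rw [sum_eq_add_of_eq_off_zero hoff, integral_nn_col ρ hρ 0 HaarFourthMomentSUN.one_ne_zero_fin.symm] at hs
  have hpos : (0 : ℝ) < (1 + n : ℝ) * (3 + n) := by positivity
  have hpos2 : (0 : ℝ) < (2 + n : ℝ) * (3 + n) := by positivity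
  have hpos1 : (0 : ℝ) < (1 + n : ℝ) := by positivity
  field_simp at hs
  rw [eq_div_iff hpos.ne']
  nlinarith [hs]

/-! ### The diagonal sums `Σ_m ∫ |ρ_mm|² |ρ_ik|²` -/

/-- ★ **`Σ_m ∫ |ρ_mm|²|ρ_ii|² = (N+2)/(N(N+1))`** (`= A + (N−1)C`). [cite: CollinsSniady2006, Cor. 2.4 (invariant integration on U(N)/SU(N): low-degree Haar moments; bookkeeping)] -/
theorem sum_integral_nn_diag_same (hρ : IsSpecialUnitaryModel ρ) (i : Fin (2 + n)) :
    ∑ m, ∫ g, (Complex.normSq ((ρ g) m m) * Complex.normSq ((ρ g) i i)) ∂haarProbability G = (4 + n : ℝ) / ((2 + n : ℝ) * (3 + n)) := by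
  rw [← Finset.add_sum_erase Finset.univ _ (Finset.mem_univ i), integral_nn_same ρ hρ i i]
  have hoff : ∀ m ∈ Finset.univ.erase i, ∫ g, (Complex.normSq ((ρ g) m m) * Complex.normSq ((ρ g) i i)) ∂haarProbability G = 1 / ((1 + n : ℝ) * (3 + n)) :=
    fun m hm => integral_nn_gen ρ hρ (Finset.ne_of_mem_erase hm) (Finset.ne_of_mem_erase hm)
  rw [Finset.sum_congr rfl hoff, Finset.sum_const, Finset.card_erase_of_mem (Finset.mem_univ _), Finset.card_univ,
    Fintype.card_fin, show 2 + n - 1 = 1 + n by omega, nsmul_eq_mul]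
  have hpos1 : (0 : ℝ) < (1 + n : ℝ) := by positivity
  push_cast
  field_simp
  ring

/-- ★ **`Σ_m ∫ |ρ_mm|²|ρ_ik|² = (N²−2)/(N(N²−1))`** for `i ≠ k` (`= 2B + (N−2)C`). [cite: CollinsSniady2006, Cor. 2.4 (invariant integration on U(N)/SU(N): low-degree Haar moments; bookkeeping)] -/
theorem sum_integral_nn_diag_off (hρ : IsSpecialUnitaryModel ρ) {i k : Fin (2 + n)} (hik : i ≠ k) :
    ∑ m, ∫ g, (Complex.normSq ((ρ g) m m) * Complex.normSq ((ρ g) i k)) ∂haarProbability G =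
      ((2 + n : ℝ) ^ 2 - 2) / ((2 + n : ℝ) * ((1 + n : ℝ) * (3 + n))) := by
  rw [← Finset.add_sum_erase Finset.univ _ (Finset.mem_univ i), integral_nn_row ρ hρ i hik]
  have hk : k ∈ Finset.univ.erase i := Finset.mem_erase.mpr ⟨hik.symm, Finset.mem_univ k⟩
  rw [← Finset.add_sum_erase _ _ hk, integral_nn_col ρ hρ k hik.symm]
  have hoff : ∀ m ∈ (Finset.univ.erase i).erase k,
      ∫ g, (Complex.normSq ((ρ g) m m) * Complex.normSq ((ρ g) i k)) ∂haarProbability G = 1 / ((1 + n : ℝ) * (3 + n)) := fun m hm => by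
    have hmk : m ≠ k := Finset.ne_of_mem_erase hm
    have hmi : m ≠ i := Finset.ne_of_mem_erase (Finset.mem_of_mem_erase hm)
    exact integral_nn_gen ρ hρ hmi hmk
  rw [Finset.sum_congr rfl hoff, Finset.sum_const, Finset.card_erase_of_mem hk,
    Finset.card_erase_of_mem (Finset.mem_univ _), Finset.card_univ, Fintype.card_fin, nsmul_eq_mul]
  have hpos1 : (0 : ℝ) < (1 + n : ℝ) := by positivity
  have e : ((2 + n - 1 - 1 : ℕ) : ℝ) = n := by
    rw [show 2 + n - 1 - 1 = n by omega]
  rw [e]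
  field_simp
  ring

end Moments

end Literature.MathematicalPhysics.QuantumFieldTheory.ToronCumulant

end Part7

/-!
## Part 8 — port of `Summits/QuantumFields/YangMills/Theorems/ToronCumulantSignInnerMoment.lean` (18 declarations kept)

# Route `ToronCumulantSign`, crux `CommutatorSkewMoment` (stmt-QuantumFields-27530) — helper III:
# the `|tr|²`-weighted second moment and the inner conjugation integral `∫ (|tr Y|² − 1) tr(X Y X† Y†) dY`

For a compact group `G ≅ SU(N)` (`IsSpecialUnitaryModel ρ`), `N = 2 + n ≥ 2`:
* ★ the `|tr|²`-WEIGHTED SECOND MOMENT (`integral_normSqTrace_entry`):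
  `∫ |tr ρ|² ρ_{jk} conj(ρ_{il}) dg = γ_N δ_{ji} δ_{kl} + C_N δ_{il} δ_{jk}`, `γ_N = (N²−2)/(N(N²−1))`, `C_N = 1/(N²−1)` — the
  conjugation-equivariant map `A ↦ E[|tr Y|² Y A Y†] = C_N A + γ_N tr(A)·1` of the route text, obtained from the support lemmas
  (helper I) and the position-free modulus moments (helper II), no Weingarten calculus;
* hence, for EVERY matrix `X` (`integral_normSqTrace_traceConj`): `∫ |tr ρ|² tr(X ρ X† ρ†) dg = γ_N |tr X|² + C_N Σ_{ij} |X_{ij}|²`, and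
  (`integral_traceConj`, degree `(1,1)`, tree `integral_entry_mul_conj_entry`) `∫ tr(X ρ X† ρ†) dg = |tr X|²/N`;
* ★★ for unitary `X` (`Σ|X_{ij}|² = N`): `∫ (|tr ρ|² − 1) tr(X ρ X† ρ†) dg = (N² − |tr X|²)/(N(N²−1))`
  (`integral_normSqTrace_sub_one_traceConj`) — the planner's `stub_innerConjugationMoment`, for every `N ≥ 2`.
HONEST LABEL: pure compact-group integration; helper toward the OPEN crux `CommutatorSkewMoment`; nothing about the mass gap.

References: B. Collins, P. Śniady, CMP 264 (2006), Cor. 2.4; M. Creutz, *Quarks, gluons and lattices* (1983) §8.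

(Verbatim declaration-level port — the declarations listed in the Part header count — of the Summits-side module; route
bookkeeping of the source docstring, if any, is historical; `local notation3` shorthands of the source are expanded in place.)
-/

section Part8

open _root_.MeasureTheory _root_.Complex
open Literature.MathematicalPhysics.QuantumLattice Literature.MathematicalPhysics.QuantumFieldTheory

namespace Literature.MathematicalPhysics.QuantumFieldTheory.ToronCumulant

open Literature.MathematicalPhysics.QuantumFieldTheory.HaarMoments

section Inner

variable {n : ℕ} {G : Type*} [Group G] [TopologicalSpace G] [IsTopologicalGroup G] [CompactSpace G]
  [MeasurableSpace G] [BorelSpace G] (ρ : G →* Matrix (Fin (2 + n)) (Fin (2 + n)) ℂ)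

/-- Integrability of the general monomial. [cite: Wilson1974, §III (one-site Wilson action: Gibbs-tilted product Haar measure; bookkeeping)] -/
theorem integrable_mono (hρ : Continuous ρ) (r₁ c₁ r₂ c₂ r₃ c₃ r₄ c₄ : Fin (2 + n)) :
    Integrable (fun g => ((ρ g) r₁ c₁ * (ρ g) r₂ c₂ * (starRingEnd ℂ) ((ρ g) r₃ c₃) * (starRingEnd ℂ) ((ρ g) r₄ c₄))) (haarProbability G) :=
  ((((hρ.matrix_elem r₁ c₁).mul (hρ.matrix_elem r₂ c₂)).mul (Complex.continuous_conj.comp (hρ.matrix_elem r₃ c₃))).mul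
    (Complex.continuous_conj.comp (hρ.matrix_elem r₄ c₄))).integrable_of_hasCompactSupport
    (HasCompactSupport.of_compactSpace _)

omit [IsTopologicalGroup G] [CompactSpace G] [MeasurableSpace G] [BorelSpace G] in
/-- A monomial paired with itself is the (real) product of squared moduli. [cite: Wilson1974, §III (one-site Wilson action: Gibbs-tilted product Haar measure; bookkeeping)] -/
theorem mono_self_eq (M : Matrix (Fin (2 + n)) (Fin (2 + n)) ℂ) (r₁ c₁ r₂ c₂ : Fin (2 + n)) :
    (M r₁ c₁ * M r₂ c₂ * (starRingEnd ℂ) (M r₁ c₁) * (starRingEnd ℂ) (M r₂ c₂)) = ((Complex.normSq (M r₁ c₁) * Complex.normSq (M r₂ c₂) : ℝ) : ℂ) := by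
  rw [ofReal_mul, ← Complex.mul_conj, ← Complex.mul_conj]; ring

/-- `∫ 𝔪(p, q; p, q) = ∫ |ρ_p|² |ρ_q|²` (as a real number). [cite: Wilson1974, §III (one-site Wilson action: Gibbs-tilted product Haar measure; bookkeeping)] -/
theorem integral_mono_self (r₁ c₁ r₂ c₂ : Fin (2 + n)) :
    ∫ g, ((ρ g) r₁ c₁ * (ρ g) r₂ c₂ * (starRingEnd ℂ) ((ρ g) r₁ c₁) * (starRingEnd ℂ) ((ρ g) r₂ c₂)) ∂haarProbability G =
      ((∫ g, Complex.normSq (ρ g r₁ c₁) * Complex.normSq (ρ g r₂ c₂) ∂haarProbability G : ℝ) : ℂ) := by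
  simp_rw [mono_self_eq]
  exact integral_ofReal

omit [IsTopologicalGroup G] [CompactSpace G] [MeasurableSpace G] [BorelSpace G] in
/-- `|tr M|² = Σ_{m,n} M_mm conj(M_nn)`. [cite: Wilson1974, §III (one-site Wilson action: Gibbs-tilted product Haar measure; bookkeeping)] -/
theorem normSq_trace_eq_sum (M : Matrix (Fin (2 + n)) (Fin (2 + n)) ℂ) :
    ((Complex.normSq M.trace : ℝ) : ℂ) = ∑ m, ∑ n', M m m * (starRingEnd ℂ) (M n' n') := by
  rw [Complex.normSq_eq_conj_mul_self, Matrix.trace, mul_comm]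
  simp only [Matrix.diag_apply, map_sum, Finset.sum_mul, Finset.mul_sum]
  exact Finset.sum_comm

/-- ★ **The `|tr|²-weighted second moment**: `∫ |tr ρ|² ρ_{jk} conj(ρ_{il}) = γ_N δ_{ji}δ_{kl} + C_N δ_{il}δ_{jk}`. [cite: Wilson1974, §III (one-site Wilson action: Gibbs-tilted product Haar measure; bookkeeping)] -/
theorem integral_normSqTrace_entry (hρ : IsSpecialUnitaryModel ρ) (j k i l : Fin (2 + n)) :
    ∫ g, ((Complex.normSq (ρ g).trace : ℝ) : ℂ) * (ρ g j k * (starRingEnd ℂ) (ρ g i l)) ∂haarProbability G =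
      (if j = i ∧ k = l then ((((((2 + n : ℝ) ^ 2 - 2) / ((2 + n : ℝ) * ((1 + n : ℝ) * (3 + n))) : ℝ)) : ℝ) : ℂ) else 0) + (if i = l ∧ j = k then (((((1 / ((1 + n : ℝ) * (3 + n))) : ℝ)) : ℝ) : ℂ) else 0) := by
  -- expand `|tr|²` and exchange sum and integral
  have hexp : ∀ g : G, ((Complex.normSq (ρ g).trace : ℝ) : ℂ) * (ρ g j k * (starRingEnd ℂ) (ρ g i l)) =
      ∑ m, ∑ n', ((ρ g) m m * (ρ g) j k * (starRingEnd ℂ) ((ρ g) n' n') * (starRingEnd ℂ) ((ρ g) i l)) := by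
    intro g
    rw [normSq_trace_eq_sum, Finset.sum_mul]
    refine Finset.sum_congr rfl fun m _ => ?_
    rw [Finset.sum_mul]
    refine Finset.sum_congr rfl fun n' _ => ?_
    ring
  simp_rw [hexp]
  rw [integral_finsetSum _ (fun m _ => integrable_finsetSum _ (fun n' _ => integrable_mono ρ hρ.1 m m j k n' n' i l))]
  simp_rw [integral_finsetSum _ (fun n' _ => integrable_mono ρ hρ.1 _ _ j k n' n' i l)]
  -- the support of the summands
  by_cases hA : j = i ∧ k = l
  · obtain ⟨hji, hkl⟩ := hA
    subst hji; subst hkl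
    rw [if_pos ⟨rfl, rfl⟩]
    -- only the diagonal `n' = m` survives
    have hdiag : ∀ m : Fin (2 + n), ∑ n', ∫ g, ((ρ g) m m * (ρ g) j k * (starRingEnd ℂ) ((ρ g) n' n') * (starRingEnd ℂ) ((ρ g) j k)) ∂haarProbability G =
        ((∫ g, Complex.normSq (ρ g m m) * Complex.normSq (ρ g j k) ∂haarProbability G : ℝ) : ℂ) := by
      intro m
      rw [Finset.sum_eq_single m]
      · exact integral_mono_self ρ m m j k
      · intro n' _ hn'
        exact integral_mono_eq_zero_of_rows ρ hρ m m j k n' n' j k (by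
          rintro (⟨h1, -⟩ | ⟨h1, h2⟩)
          · exact hn' h1.symm
          · exact hn' (h2 ▸ h1 ▸ rfl))
      · intro h; exact absurd (Finset.mem_univ m) h
    simp_rw [hdiag]
    rw [← ofReal_sum]
    by_cases hB : j = k
    · subst hB
      rw [if_pos ⟨rfl, rfl⟩, sum_integral_nn_diag_same ρ hρ j, ← ofReal_add]
      congr 1
      have hpos1 : (0 : ℝ) < (1 + n : ℝ) := by positivity
      field_simp
      ring
    · rw [if_neg (fun h => hB h.1), add_zero, sum_integral_nn_diag_off ρ hρ hB]
  · rw [if_neg hA, zero_add]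
    by_cases hB : i = l ∧ j = k
    · obtain ⟨hil, hjk⟩ := hB
      subst hil; subst hjk
      rw [if_pos ⟨rfl, rfl⟩]
      have hij : j ≠ i := fun h => hA ⟨h, h⟩
      -- only `(m, n') = (i, j)` survives
      rw [Finset.sum_eq_single i]
      · rw [Finset.sum_eq_single j]
        · have h := integral_mono_self ρ i i j j
          have e : ∀ g : G, ((ρ g) i i * (ρ g) j j * (starRingEnd ℂ) ((ρ g) i i) * (starRingEnd ℂ) ((ρ g) j j)) = ((ρ g) i i * (ρ g) j j * (starRingEnd ℂ) ((ρ g) j j) * (starRingEnd ℂ) ((ρ g) i i)) := fun g => by ring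
          simp_rw [e] at h
          rw [h, integral_nn_gen ρ hρ hij.symm hij.symm]
        · intro n' _ hn'
          exact integral_mono_eq_zero_of_rows ρ hρ i i j j n' n' i i (by
            rintro (⟨-, h2⟩ | ⟨-, h2⟩)
            · exact hij h2
            · exact hn' h2.symm)
        · intro h; exact absurd (Finset.mem_univ j) h
      · intro m _ hm
        refine Finset.sum_eq_zero fun n' _ => ?_
        exact integral_mono_eq_zero_of_rows ρ hρ m m j j n' n' i i (by
          rintro (⟨h1, h2⟩ | ⟨h1, -⟩)
          · exact hij h2
          · exact hm h1)
      · intro h; exact absurd (Finset.mem_univ i) h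
    · rw [if_neg hB]
      refine Finset.sum_eq_zero fun m _ => Finset.sum_eq_zero fun n' _ => ?_
      by_cases hr : (m = n' ∧ j = i) ∨ (m = i ∧ j = n')
      · -- rows match, so the columns do not
        refine integral_mono_eq_zero_of_cols ρ hρ m m j k n' n' i l ?_
        rintro (⟨hmn, hkl⟩ | ⟨hml, hkn⟩)
        · rcases hr with ⟨-, hji⟩ | ⟨hmi, hjn⟩
          · exact hA ⟨hji, hkl⟩
          · exact hA ⟨hjn.trans (hmn.symm.trans hmi), hkl⟩
        · rcases hr with ⟨hmn, hji⟩ | ⟨hmi, hjn⟩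
          · exact hA ⟨hji, (hkn.trans (hmn.symm.trans hml)).symm ▸ rfl⟩
          · exact hB ⟨hmi.symm.trans hml, hjn.trans hkn.symm⟩
      · exact integral_mono_eq_zero_of_rows ρ hρ m m j k n' n' i l hr

omit [IsTopologicalGroup G] [CompactSpace G] [MeasurableSpace G] [BorelSpace G] in
/-- `tr(X M X† M†) = Σ_{i,l,k,j} X_ij M_jk conj(X_lk) conj(M_il)`. [cite: Wilson1974, §III (one-site Wilson action: Gibbs-tilted product Haar measure; bookkeeping)] -/
theorem trace_conj_expand (X M : Matrix (Fin (2 + n)) (Fin (2 + n)) ℂ) :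
    (X * M * X.conjTranspose * M.conjTranspose).trace =
      ∑ i, ∑ l, ∑ k, ∑ j, X i j * M j k * (starRingEnd ℂ) (X l k) * (starRingEnd ℂ) (M i l) := by
  simp only [Matrix.trace, Matrix.diag_apply, Matrix.mul_apply, Matrix.conjTranspose_apply, Complex.star_def,
    Finset.sum_mul]

omit [IsTopologicalGroup G] [CompactSpace G] [MeasurableSpace G] [BorelSpace G] in
/-- `Σ_{i,l,k,j} X_ij conj(X_lk) c [j = i ∧ k = l] = c |tr X|²`. [cite: Wilson1974, §III (one-site Wilson action: Gibbs-tilted product Haar measure; bookkeeping)] -/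
theorem sum4_delta_diag (X : Matrix (Fin (2 + n)) (Fin (2 + n)) ℂ) (c : ℂ) :
    ∑ i, ∑ l, ∑ k, ∑ j, X i j * (starRingEnd ℂ) (X l k) * (if j = i ∧ k = l then c else 0) =
      c * ((Complex.normSq X.trace : ℝ) : ℂ) := by
  have h : ∀ i l : Fin (2 + n), ∑ k, ∑ j, X i j * (starRingEnd ℂ) (X l k) * (if j = i ∧ k = l then c else 0) =
      X i i * (starRingEnd ℂ) (X l l) * c := by
    intro i l
    rw [Finset.sum_eq_single l]
    · rw [Finset.sum_eq_single i]
      · simp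
      · intro j _ hj; simp [hj]
      · intro h; exact absurd (Finset.mem_univ i) h
    · intro k _ hk; exact Finset.sum_eq_zero fun j _ => by simp [hk]
    · intro h; exact absurd (Finset.mem_univ l) h
  simp_rw [h]
  rw [normSq_trace_eq_sum, Finset.mul_sum]
  refine Finset.sum_congr rfl fun i _ => ?_
  rw [Finset.mul_sum]
  refine Finset.sum_congr rfl fun l _ => ?_
  ring

omit [IsTopologicalGroup G] [CompactSpace G] [MeasurableSpace G] [BorelSpace G] in
/-- `Σ_{i,l,k,j} X_ij conj(X_lk) c [i = l ∧ j = k] = c Σ_{ij} |X_ij|²`. [cite: Wilson1974, §III (one-site Wilson action: Gibbs-tilted product Haar measure; bookkeeping)] -/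
theorem sum4_delta_cross (X : Matrix (Fin (2 + n)) (Fin (2 + n)) ℂ) (c : ℂ) :
    ∑ i, ∑ l, ∑ k, ∑ j, X i j * (starRingEnd ℂ) (X l k) * (if i = l ∧ j = k then c else 0) =
      c * ∑ i, ∑ j, ((Complex.normSq (X i j) : ℝ) : ℂ) := by
  have h : ∀ i : Fin (2 + n), ∑ l, ∑ k, ∑ j, X i j * (starRingEnd ℂ) (X l k) * (if i = l ∧ j = k then c else 0) =
      ∑ k, X i k * (starRingEnd ℂ) (X i k) * c := by
    intro i
    rw [Finset.sum_eq_single i]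
    · refine Finset.sum_congr rfl fun k _ => ?_
      rw [Finset.sum_eq_single k]
      · simp
      · intro j _ hj; simp [hj]
      · intro h; exact absurd (Finset.mem_univ k) h
    · intro l _ hl
      exact Finset.sum_eq_zero fun k _ => Finset.sum_eq_zero fun j _ => by simp [Ne.symm hl]
    · intro h; exact absurd (Finset.mem_univ i) h
  simp_rw [h]
  rw [Finset.mul_sum]
  refine Finset.sum_congr rfl fun i _ => ?_
  rw [Finset.mul_sum]
  refine Finset.sum_congr rfl fun k _ => ?_
  rw [Complex.normSq_eq_conj_mul_self]
  ring

omit [IsTopologicalGroup G] [CompactSpace G] [MeasurableSpace G] [BorelSpace G] in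
/-- Continuity of the expansion terms. [cite: Wilson1974, §III (one-site Wilson action: Gibbs-tilted product Haar measure; bookkeeping)] -/
theorem continuous_term (hρ : Continuous ρ) (X : Matrix (Fin (2 + n)) (Fin (2 + n)) ℂ) (i l k j : Fin (2 + n)) :
    Continuous fun g => (((Complex.normSq (Matrix.trace (ρ g)) : ℝ) : ℂ) * (X i j * (ρ g) j k * (starRingEnd ℂ) (X l k) * (starRingEnd ℂ) ((ρ g) i l))) := by
  refine (Complex.continuous_ofReal.comp (Complex.continuous_normSq.comp ?_)).mul ?_
  · exact (continuous_id.matrix_trace).comp hρ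
  · exact (((continuous_const.mul (hρ.matrix_elem j k)).mul continuous_const).mul
      (Complex.continuous_conj.comp (hρ.matrix_elem i l)))

/-- Integrability of finite sums of the expansion terms (continuity on a compact group). [cite: Wilson1974, §III (one-site Wilson action: Gibbs-tilted product Haar measure; bookkeeping)] -/
theorem integrable_of_continuous'' {f : G → ℂ} (hf : Continuous f) : Integrable f (haarProbability G) :=
  hf.integrable_of_hasCompactSupport (HasCompactSupport.of_compactSpace _)

/-- The integral of one expansion term. [cite: Wilson1974, §III (one-site Wilson action: Gibbs-tilted product Haar measure; bookkeeping)] -/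
theorem integral_term (hρ : IsSpecialUnitaryModel ρ) (X : Matrix (Fin (2 + n)) (Fin (2 + n)) ℂ) (i l k j : Fin (2 + n)) :
    ∫ g, (((Complex.normSq (Matrix.trace (ρ g)) : ℝ) : ℂ) * (X i j * (ρ g) j k * (starRingEnd ℂ) (X l k) * (starRingEnd ℂ) ((ρ g) i l))) ∂haarProbability G =
      X i j * (starRingEnd ℂ) (X l k) * ((if j = i ∧ k = l then ((((((2 + n : ℝ) ^ 2 - 2) / ((2 + n : ℝ) * ((1 + n : ℝ) * (3 + n))) : ℝ)) : ℝ) : ℂ) else 0) +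
        (if i = l ∧ j = k then (((((1 / ((1 + n : ℝ) * (3 + n))) : ℝ)) : ℝ) : ℂ) else 0)) := by
  rw [← integral_normSqTrace_entry ρ hρ j k i l, ← integral_const_mul]
  refine integral_congr_ae (ae_of_all _ fun g => ?_)
  simp only
  ring

/-- ★ **`∫ |tr ρ|² tr(X ρ X† ρ†) dg = γ_N |tr X|² + C_N Σ_{ij} |X_ij|²`** for every matrix `X`. [cite: Wilson1974, §III (one-site Wilson action: Gibbs-tilted product Haar measure; bookkeeping)] -/
theorem integral_normSqTrace_traceConj (hρ : IsSpecialUnitaryModel ρ) (X : Matrix (Fin (2 + n)) (Fin (2 + n)) ℂ) :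
    ∫ g, ((Complex.normSq (ρ g).trace : ℝ) : ℂ) * (X * ρ g * X.conjTranspose * (ρ g).conjTranspose).trace
        ∂haarProbability G =
      ((((((2 + n : ℝ) ^ 2 - 2) / ((2 + n : ℝ) * ((1 + n : ℝ) * (3 + n))) : ℝ)) : ℝ) : ℂ) * ((Complex.normSq X.trace : ℝ) : ℂ) + (((((1 / ((1 + n : ℝ) * (3 + n))) : ℝ)) : ℝ) : ℂ) * ∑ i, ∑ j, ((Complex.normSq (X i j) : ℝ) : ℂ) := by
  have hexp : ∀ g : G, ((Complex.normSq (ρ g).trace : ℝ) : ℂ) * (X * ρ g * X.conjTranspose * (ρ g).conjTranspose).trace =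
      ∑ i, ∑ l, ∑ k, ∑ j, (((Complex.normSq (Matrix.trace (ρ g)) : ℝ) : ℂ) * (X i j * (ρ g) j k * (starRingEnd ℂ) (X l k) * (starRingEnd ℂ) ((ρ g) i l))) := by
    intro g
    rw [trace_conj_expand]
    simp only [Finset.mul_sum]
  simp_rw [hexp]
  have hc := continuous_term ρ hρ.1 X
  rw [integral_finsetSum _ (fun i _ => integrable_of_continuous'' (continuous_finsetSum _ fun l _ =>
    continuous_finsetSum _ fun k _ => continuous_finsetSum _ fun j _ => hc i l k j))]
  have h1 : ∀ i, ∫ g, ∑ l, ∑ k, ∑ j, (((Complex.normSq (Matrix.trace (ρ g)) : ℝ) : ℂ) * (X i j * (ρ g) j k * (starRingEnd ℂ) (X l k) * (starRingEnd ℂ) ((ρ g) i l))) ∂haarProbability G =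
      ∑ l, ∫ g, ∑ k, ∑ j, (((Complex.normSq (Matrix.trace (ρ g)) : ℝ) : ℂ) * (X i j * (ρ g) j k * (starRingEnd ℂ) (X l k) * (starRingEnd ℂ) ((ρ g) i l))) ∂haarProbability G := fun i =>
    integral_finsetSum _ (fun l _ => integrable_of_continuous'' (continuous_finsetSum _ fun k _ =>
      continuous_finsetSum _ fun j _ => hc i l k j))
  have h2 : ∀ i l, ∫ g, ∑ k, ∑ j, (((Complex.normSq (Matrix.trace (ρ g)) : ℝ) : ℂ) * (X i j * (ρ g) j k * (starRingEnd ℂ) (X l k) * (starRingEnd ℂ) ((ρ g) i l))) ∂haarProbability G =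
      ∑ k, ∫ g, ∑ j, (((Complex.normSq (Matrix.trace (ρ g)) : ℝ) : ℂ) * (X i j * (ρ g) j k * (starRingEnd ℂ) (X l k) * (starRingEnd ℂ) ((ρ g) i l))) ∂haarProbability G := fun i l =>
    integral_finsetSum _ (fun k _ => integrable_of_continuous'' (continuous_finsetSum _ fun j _ => hc i l k j))
  have h3 : ∀ i l k, ∫ g, ∑ j, (((Complex.normSq (Matrix.trace (ρ g)) : ℝ) : ℂ) * (X i j * (ρ g) j k * (starRingEnd ℂ) (X l k) * (starRingEnd ℂ) ((ρ g) i l))) ∂haarProbability G = ∑ j, ∫ g, (((Complex.normSq (Matrix.trace (ρ g)) : ℝ) : ℂ) * (X i j * (ρ g) j k * (starRingEnd ℂ) (X l k) * (starRingEnd ℂ) ((ρ g) i l))) ∂haarProbability G :=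
    fun i l k => integral_finsetSum _ (fun j _ => integrable_of_continuous'' (hc i l k j))
  simp_rw [h1, h2, h3, integral_term ρ hρ X, mul_add, Finset.sum_add_distrib]
  rw [sum4_delta_diag, sum4_delta_cross]

omit [IsTopologicalGroup G] [CompactSpace G] [MeasurableSpace G] [BorelSpace G] in
/-- Continuity of the degree-(1,1) terms. [cite: Wilson1974, §III (one-site Wilson action: Gibbs-tilted product Haar measure; bookkeeping)] -/
theorem continuous_term₁ (hρ : Continuous ρ) (X : Matrix (Fin (2 + n)) (Fin (2 + n)) ℂ) (i l k j : Fin (2 + n)) :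
    Continuous fun g => (X i j * (ρ g) j k * (starRingEnd ℂ) (X l k) * (starRingEnd ℂ) ((ρ g) i l)) :=
  (((continuous_const.mul (hρ.matrix_elem j k)).mul continuous_const).mul
    (Complex.continuous_conj.comp (hρ.matrix_elem i l)))

/-- The integral of one degree-(1,1) term (tree `integral_entry_mul_conj_entry`). [cite: Wilson1974, §III (one-site Wilson action: Gibbs-tilted product Haar measure; bookkeeping)] -/
theorem integral_term₁ (hρ : IsSpecialUnitaryModel ρ) (X : Matrix (Fin (2 + n)) (Fin (2 + n)) ℂ) (i l k j : Fin (2 + n)) :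
    ∫ g, (X i j * (ρ g) j k * (starRingEnd ℂ) (X l k) * (starRingEnd ℂ) ((ρ g) i l)) ∂haarProbability G =
      X i j * (starRingEnd ℂ) (X l k) * (if j = i ∧ k = l then ((2 + n : ℕ) : ℂ)⁻¹ else 0) := by
  rw [← RobustBall.HaarSecondMoments.integral_entry_mul_conj_entry ρ hρ j k i l, ← integral_const_mul]
  refine integral_congr_ae (ae_of_all _ fun g => ?_)
  simp only
  ring

/-- **`∫ tr(X ρ X† ρ†) dg = |tr X|²/N`** for every matrix `X` (Schur orthogonality of the fundamental representation). [cite: Wilson1974, §III (one-site Wilson action: Gibbs-tilted product Haar measure; bookkeeping)] -/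
theorem integral_traceConj (hρ : IsSpecialUnitaryModel ρ) (X : Matrix (Fin (2 + n)) (Fin (2 + n)) ℂ) :
    ∫ g, (X * ρ g * X.conjTranspose * (ρ g).conjTranspose).trace ∂haarProbability G =
      ((2 + n : ℕ) : ℂ)⁻¹ * ((Complex.normSq X.trace : ℝ) : ℂ) := by
  simp_rw [trace_conj_expand]
  have hc := continuous_term₁ ρ hρ.1 X
  rw [integral_finsetSum _ (fun i _ => integrable_of_continuous'' (continuous_finsetSum _ fun l _ =>
    continuous_finsetSum _ fun k _ => continuous_finsetSum _ fun j _ => hc i l k j))]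
  have h1 : ∀ i, ∫ g, ∑ l, ∑ k, ∑ j, (X i j * (ρ g) j k * (starRingEnd ℂ) (X l k) * (starRingEnd ℂ) ((ρ g) i l)) ∂haarProbability G =
      ∑ l, ∫ g, ∑ k, ∑ j, (X i j * (ρ g) j k * (starRingEnd ℂ) (X l k) * (starRingEnd ℂ) ((ρ g) i l)) ∂haarProbability G := fun i =>
    integral_finsetSum _ (fun l _ => integrable_of_continuous'' (continuous_finsetSum _ fun k _ =>
      continuous_finsetSum _ fun j _ => hc i l k j))
  have h2 : ∀ i l, ∫ g, ∑ k, ∑ j, (X i j * (ρ g) j k * (starRingEnd ℂ) (X l k) * (starRingEnd ℂ) ((ρ g) i l)) ∂haarProbability G =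
      ∑ k, ∫ g, ∑ j, (X i j * (ρ g) j k * (starRingEnd ℂ) (X l k) * (starRingEnd ℂ) ((ρ g) i l)) ∂haarProbability G := fun i l =>
    integral_finsetSum _ (fun k _ => integrable_of_continuous'' (continuous_finsetSum _ fun j _ => hc i l k j))
  have h3 : ∀ i l k, ∫ g, ∑ j, (X i j * (ρ g) j k * (starRingEnd ℂ) (X l k) * (starRingEnd ℂ) ((ρ g) i l)) ∂haarProbability G = ∑ j, ∫ g, (X i j * (ρ g) j k * (starRingEnd ℂ) (X l k) * (starRingEnd ℂ) ((ρ g) i l)) ∂haarProbability G :=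
    fun i l k => integral_finsetSum _ (fun j _ => integrable_of_continuous'' (hc i l k j))
  simp_rw [h1, h2, h3, integral_term₁ ρ hρ X]
  rw [sum4_delta_diag]

omit [IsTopologicalGroup G] [CompactSpace G] [MeasurableSpace G] [BorelSpace G] in
/-- For a unitary matrix `Σ_{ij} |X_ij|² = N`. [cite: Wilson1974, §III (one-site Wilson action: Gibbs-tilted product Haar measure; bookkeeping)] -/
theorem sum_normSq_entries_of_mem_unitaryGroup {X : Matrix (Fin (2 + n)) (Fin (2 + n)) ℂ}
    (hX : X ∈ Matrix.unitaryGroup (Fin (2 + n)) ℂ) :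
    ∑ i, ∑ j, ((Complex.normSq (X i j) : ℝ) : ℂ) = ((2 + n : ℕ) : ℂ) := by
  rw [Matrix.mem_unitaryGroup_iff] at hX
  have hrow : ∀ i : Fin (2 + n), ∑ j, ((Complex.normSq (X i j) : ℝ) : ℂ) = 1 := by
    intro i
    have h := congrFun (congrFun hX i) i
    rw [Matrix.mul_apply, Matrix.one_apply_eq] at h
    rw [← h]
    refine Finset.sum_congr rfl fun j _ => ?_
    rw [Matrix.star_apply, Complex.star_def, Complex.mul_conj]
  simp_rw [hrow]
  simp

omit [IsTopologicalGroup G] [CompactSpace G] [MeasurableSpace G] [BorelSpace G] in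
/-- Continuity of `g ↦ tr(X ρ(g) X† ρ(g)†)`. [cite: Wilson1974, §III (one-site Wilson action: Gibbs-tilted product Haar measure; bookkeeping)] -/
theorem continuous_traceConj (hρ : Continuous ρ) (X : Matrix (Fin (2 + n)) (Fin (2 + n)) ℂ) :
    Continuous fun g => (X * ρ g * X.conjTranspose * (ρ g).conjTranspose).trace := by
  refine continuous_id.matrix_trace.comp ?_
  exact ((continuous_const.mul hρ).mul continuous_const).mul (continuous_id.matrix_conjTranspose.comp hρ)

/-- ★★ **The inner conjugation moment** (the planner's `stub_innerConjugationMoment`, every `N ≥ 2`): for unitary `X`,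
`∫ (|tr ρ|² − 1) tr(X ρ X† ρ†) dg = (N² − |tr X|²)/(N(N² − 1))`. [cite: Wilson1974, §III (one-site Wilson action: Gibbs-tilted product Haar measure; bookkeeping)] -/
theorem integral_normSqTrace_sub_one_traceConj (hρ : IsSpecialUnitaryModel ρ) {X : Matrix (Fin (2 + n)) (Fin (2 + n)) ℂ}
    (hX : X ∈ Matrix.unitaryGroup (Fin (2 + n)) ℂ) :
    ∫ g, (((Complex.normSq (ρ g).trace : ℝ) : ℂ) - 1) * (X * ρ g * X.conjTranspose * (ρ g).conjTranspose).trace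
        ∂haarProbability G =
      ((((2 + n : ℝ) ^ 2 - Complex.normSq X.trace) / ((2 + n : ℝ) * ((1 + n : ℝ) * (3 + n))) : ℝ) : ℂ) := by
  have hcw : Continuous fun g => ((Complex.normSq (ρ g).trace : ℝ) : ℂ) *
      (X * ρ g * X.conjTranspose * (ρ g).conjTranspose).trace :=
    (Complex.continuous_ofReal.comp (Complex.continuous_normSq.comp ((continuous_id.matrix_trace).comp hρ.1))).mul
      (continuous_traceConj ρ hρ.1 X)
  simp_rw [sub_mul, one_mul]
  rw [integral_sub (integrable_of_continuous'' hcw) (integrable_of_continuous'' (continuous_traceConj ρ hρ.1 X)),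
    integral_normSqTrace_traceConj ρ hρ X, integral_traceConj ρ hρ X, sum_normSq_entries_of_mem_unitaryGroup hX]
  have hpos1 : (0 : ℝ) < (1 + n : ℝ) := by positivity
  have hpos2 : (0 : ℝ) < (2 + n : ℝ) := by positivity
  have hpos3 : (0 : ℝ) < (3 + n : ℝ) := by positivity
  have hreal : (((2 + n : ℝ) ^ 2 - 2) / ((2 + n : ℝ) * ((1 + n : ℝ) * (3 + n)))) * Complex.normSq X.trace +
      (1 / ((1 + n : ℝ) * (3 + n))) * (2 + n : ℝ) - (2 + n : ℝ)⁻¹ * Complex.normSq X.trace =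
      ((2 + n : ℝ) ^ 2 - Complex.normSq X.trace) / ((2 + n : ℝ) * ((1 + n : ℝ) * (3 + n))) := by
    field_simp
    ring
  have hcast := congrArg (fun x : ℝ => (x : ℂ)) hreal
  push_cast at hcast ⊢
  exact hcast

end Inner

end Literature.MathematicalPhysics.QuantumFieldTheory.ToronCumulant

end Part8

/-!
## Part 9 — port of `Summits/Ventures/YMGap/Thresholds/HaarThirdMomentSU3.lean` (1 declarations kept)

# The Haar THIRD moments of `SU(3)`, I: the cubic entry moments and the baryon vertex `∫ U₀₀ U₁₁ U₂₂ dU = 1/6`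
# (row type C-PRESS, endpoint `β = 0`, part 14a; part 14b `HaarThirdMomentSU3Trace`: `∫ (tr U)³ = 1`, `∫ (Re tr U)³ = 1/4`)

Cell `pub-ymgap`, seat ds-1 (gen 11). HONEST FRAMING: pure compact-group integration for a compact group `G ≅ SU(3)`
(`IsSpecialUnitaryModel ρ`); nothing lattice-specific, nothing about the continuum or the Clay problem. Kernel theorems only,
0 compute, no definitions. Method = the invariance method of rb-p2's `HaarSecondMoments` one degree up:
* **phases** (`row_phase`, `col_phase`): the left/right twist by `diag(i, −i, 1)` or `diag(1, i, −i)` multiplies the cubic moment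
  `T[i,j,k; l,m,n] = ∫ U_{il} U_{jm} U_{kn}` by a fourth root of unity, which is `≠ 1` unless the row (column) indices are a
  permutation of `(0,1,2)` — so all other cubic moments VANISH (`row_vanish`, `col_vanish`), and ALL moments `∫ U U Ū` vanish
  (`integral_entry_entry_conj_entry`);
* **signed transpositions** (`swapRow_apply`, `swapCol_apply`): permuting rows or columns multiplies `T` by the signature
  (`rows_102`, …, `cols_201`);
* **`det U = 1`** integrated (`Matrix.det_fin_three`): `6 · T[0,1,2; 0,1,2] = 1`, ★ `integral_baryon : ∫ U₀₀ U₁₁ U₂₂ dU = 1/6`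
  (Creutz (8.25): `∫ dU U_{i₁j₁}U_{i₂j₂}U_{i₃j₃} = ε_{i₁i₂i₃} ε_{j₁j₂j₃}/3!` for `SU(3)`).
`integral_diag3`: `∫ U_{ii}U_{jj}U_{kk} dU = 1/6` on permutations of `(0,1,2)`, `0` otherwise.
Consequences in part 14b (`HaarThirdMomentSU3Trace`): `∫ (tr U)³ dU = 1`, `∫ (tr U)² conj(tr U) dU = 0`, `∫ (Re tr U)³ dU = 1/4`
— the third cumulant of the `SU(3)` plaquette variable `W = (1/3) Re tr U_p` under Haar measure is `1/108 ≠ 0` (for `SU(2)` it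
vanishes, part 10). References: M. Creutz, *Quarks, gluons and lattices* (1983) §8 eqs. (8.19)–(8.25); Balian–Drouffe–Itzykson, Phys. Rev. D 11
(1975) 2104 §III. Everything here is proved. [folklore]

(Verbatim declaration-level port — the declarations listed in the Part header count — of the Summits-side module; route
bookkeeping of the source docstring, if any, is historical; `local notation3` shorthands of the source are expanded in place.)
-/

section Part9

open _root_.MeasureTheory _root_.Complex
open Literature.MathematicalPhysics.QuantumLattice Literature.MathematicalPhysics.QuantumFieldTheory

namespace Literature.MathematicalPhysics.QuantumFieldTheory.HaarMoments.HaarThirdMomentSU3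

section Model

variable {G : Type*} [Group G] [TopologicalSpace G] [IsTopologicalGroup G] [CompactSpace G]
  [MeasurableSpace G] [BorelSpace G] (ρ : G →* Matrix (Fin 3) (Fin 3) ℂ)

omit [IsTopologicalGroup G] [CompactSpace G] [BorelSpace G] in
/-- A complex number fixed by multiplication with `c ≠ 1` is zero. [cite: CollinsSniady2006, Cor. 2.4 (invariant integration on U(N)/SU(N): low-degree Haar moments; bookkeeping)] -/
theorem eq_zero_of_mul_eq_self {c z : ℂ} (hc : c ≠ 1) (h : c * z = z) : z = 0 := by
  have h' : (c - 1) * z = 0 := by rw [sub_mul, one_mul, h, sub_self]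
  rcases mul_eq_zero.mp h' with h'' | h''
  · exact absurd (sub_eq_zero.mp h'') hc
  · exact h''

end Model

end Literature.MathematicalPhysics.QuantumFieldTheory.HaarMoments.HaarThirdMomentSU3

end Part9

/-!
## Part 10 — port of `Summits/Ventures/YMGap/Thresholds/HaarFourthMomentSUNTrace.lean` (14 declarations kept)

# `∫_{SU(N)} |tr U|⁴ dU = 2` for EVERY `N ≥ 3` — the fourth moment of the character is that of a complex Gaussian
# (row type C-PRESS, `β = 0` inputs, part 19c)

Cell `pub-ymgap`, seat ds-1 (gen 11). HONEST FRAMING: pure compact-group integration for a compact group `G ≅ SU(N)`, `N = 2 + n ≥ 3`;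
nothing lattice-specific, nothing about the continuum or the Clay problem. Kernel theorems only, 0 compute, no definitions.

`|tr U|⁴ = Σ_{i,k,j,l} U_ii U_kk Ū_jj Ū_ll`. The left phase twists `diag(i at a, −i at b)` (`diagonal_phase_mem`) multiply such a monomial
by a fourth root of unity which is `≠ 1` unless the multisets `{i,k}` and `{j,l}` agree (`integral_diag4_eq_zero`; for the pattern
`U_ii² Ū_jj²` the spare third index is needed, whence `N ≥ 3`); the survivors are `N` terms `∫|U_ii|⁴ = 2/(N(N+1))` (part 19a) and
`2N(N−1)` terms `∫|U_ii|²|U_jj|² = 1/(N²−1)` (part 19b), so ★★ `∫ |tr ρ(g)|⁴ dg = 2/(N+1) + 2N/(N+1) = 2` (`integral_normSq_trace_sq`):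
the number of invariants in `V ⊗ V ⊗ V̄ ⊗ V̄`, obtained without characters or Weingarten calculus. With `∫|tr|² = 1`
(`integral_normSq_trace`) this says `|tr U|²` has variance `1`, exactly as for a standard complex Gaussian. References: M. Creutz,
*Quarks, gluons and lattices* (1983) §8; P. Diaconis, M. Shahshahani, J. Appl. Probab. 31A (1994) 49 (moments of traces).
Everything here is proved. [folklore]

(Verbatim declaration-level port — the declarations listed in the Part header count — of the Summits-side module; route
bookkeeping of the source docstring, if any, is historical; `local notation3` shorthands of the source are expanded in place.)
-/

section Part10

open _root_.MeasureTheory _root_.Complex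
open Literature.MathematicalPhysics.QuantumLattice Literature.MathematicalPhysics.QuantumFieldTheory
open scoped _root_.Matrix

namespace Literature.MathematicalPhysics.QuantumFieldTheory.HaarMoments.HaarFourthMomentSUN

open RobustBall.HaarSecondMoments (integral_comp_mul_left diagonal_phase_mem)
open HaarThirdMomentSU3 (eq_zero_of_mul_eq_self)

section Moments

variable {n : ℕ} {G : Type*} [Group G] [TopologicalSpace G] [IsTopologicalGroup G] [CompactSpace G]
  [MeasurableSpace G] [BorelSpace G] (ρ : G →* Matrix (Fin (2 + n)) (Fin (2 + n)) ℂ)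

/-- Entries of the twisted matrix: `(D M)_{rc} = tc_r · M_{rc}` for `D = diag(i at a, −i at b)`. [cite: CollinsSniady2006, Cor. 2.4 (invariant integration on U(N)/SU(N): low-degree Haar moments; bookkeeping)] -/
theorem twist_mul_apply {a b : Fin (2 + n)} (hab : a ≠ b) (M : Matrix (Fin (2 + n)) (Fin (2 + n)) ℂ) (r c : Fin (2 + n)) :
    (Matrix.diagonal (Pi.mulSingle a Complex.I * Pi.mulSingle b (-Complex.I) : Fin (2 + n) → ℂ) * M) r c =
      (((if r = a then Complex.I else if r = b then -Complex.I else (1 : ℂ)))) * M r c := by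
  rw [Matrix.diagonal_mul, Pi.mul_apply]
  by_cases hra : r = a
  · subst hra
    simp [Pi.mulSingle_eq_of_ne hab]
  · by_cases hrb : r = b
    · subst hrb
      simp [hra]
    · simp [hra, hrb]

/-- **The twist relation**: `∫ 𝔪 = φ · ∫ 𝔪` with `φ = tc_i tc_k conj(tc_j) conj(tc_l)`; hence `∫ 𝔪 = 0` whenever `φ ≠ 1`. [cite: CollinsSniady2006, Cor. 2.4 (invariant integration on U(N)/SU(N): low-degree Haar moments; bookkeeping)] -/
theorem integral_diag4_eq_zero (hρ : IsSpecialUnitaryModel ρ) {a b : Fin (2 + n)} (hab : a ≠ b) (i k j l : Fin (2 + n))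
    (φ : ℂ) (hφ : φ ≠ 1) (hcoef : (((if i = a then Complex.I else if i = b then -Complex.I else (1 : ℂ)))) * (((if k = a then Complex.I else if k = b then -Complex.I else (1 : ℂ)))) * (starRingEnd ℂ) (((if j = a then Complex.I else if j = b then -Complex.I else (1 : ℂ)))) * (starRingEnd ℂ) (((if l = a then Complex.I else if l = b then -Complex.I else (1 : ℂ)))) = φ) :
    ∫ g, ((ρ g) i i * (ρ g) k k * (starRingEnd ℂ) ((ρ g) j j) * (starRingEnd ℂ) ((ρ g) l l)) ∂haarProbability G = 0 := by
  set D := Matrix.diagonal (Pi.mulSingle a Complex.I * Pi.mulSingle b (-Complex.I) : Fin (2 + n) → ℂ) with hD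
  have hDm : D ∈ Matrix.specialUnitaryGroup (Fin (2 + n)) ℂ := by rw [hD]; exact diagonal_phase_mem a b hab
  have h := integral_comp_mul_left ρ hρ hDm (fun M => (M i i * M k k * (starRingEnd ℂ) (M j j) * (starRingEnd ℂ) (M l l)))
  have hpt : ∀ M : Matrix (Fin (2 + n)) (Fin (2 + n)) ℂ, ((D * M) i i * (D * M) k k * (starRingEnd ℂ) ((D * M) j j) * (starRingEnd ℂ) ((D * M) l l)) = φ * (M i i * M k k * (starRingEnd ℂ) (M j j) * (starRingEnd ℂ) (M l l)) := by
    intro M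
    rw [hD, twist_mul_apply hab, twist_mul_apply hab, twist_mul_apply hab, twist_mul_apply hab, map_mul, map_mul, ← hcoef]
    ring
  simp only [hpt] at h
  rw [integral_const_mul] at h
  exact eq_zero_of_mul_eq_self hφ h

/-- Integrability of the diagonal monomials. [cite: CollinsSniady2006, Cor. 2.4 (invariant integration on U(N)/SU(N): low-degree Haar moments; bookkeeping)] -/
theorem integrable_diag4 (hρ : Continuous ρ) (i k j l : Fin (2 + n)) :
    Integrable (fun g => ((ρ g) i i * (ρ g) k k * (starRingEnd ℂ) ((ρ g) j j) * (starRingEnd ℂ) ((ρ g) l l))) (haarProbability G) :=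
  ((((hρ.matrix_elem i i).mul (hρ.matrix_elem k k)).mul (Complex.continuous_conj.comp (hρ.matrix_elem j j))).mul
    (Complex.continuous_conj.comp (hρ.matrix_elem l l))).integrable_of_hasCompactSupport (HasCompactSupport.of_compactSpace _)

/-- A spare index: for `i j : Fin (2+n)` with `n ≥ 1` there is `m ∉ {i, j}`. [cite: CollinsSniady2006, Cor. 2.4 (invariant integration on U(N)/SU(N): low-degree Haar moments; bookkeeping)] -/
theorem exists_third (hn : 1 ≤ n) (i j : Fin (2 + n)) : ∃ m : Fin (2 + n), m ≠ i ∧ m ≠ j := by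
  by_contra hcon
  push Not at hcon
  have hsub : (Finset.univ : Finset (Fin (2 + n))) ⊆ {i, j} := fun m _ => by
    rcases eq_or_ne m i with h | h
    · simp [h]
    · simp [hcon m h]
  have hcard := Finset.card_le_card hsub
  rw [Finset.card_univ, Fintype.card_fin] at hcard
  have h2 : ({i, j} : Finset (Fin (2 + n))).card ≤ 2 := Finset.card_le_two
  omega

/-- **The diagonal case `i = k`**: `∫ U_ii² Ū_jj Ū_ll = 0` unless `j = l = i`. [cite: CollinsSniady2006, Cor. 2.4 (invariant integration on U(N)/SU(N): low-degree Haar moments; bookkeeping)] -/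
theorem integral_diag4_eq_zero_of_eq (hρ : IsSpecialUnitaryModel ρ) (hn : 1 ≤ n) (i j l : Fin (2 + n))
    (h : ¬(j = i ∧ l = i)) : ∫ g, ((ρ g) i i * (ρ g) i i * (starRingEnd ℂ) ((ρ g) j j) * (starRingEnd ℂ) ((ρ g) l l)) ∂haarProbability G = 0 := by
  have hnI : (-Complex.I : ℂ) ≠ 1 := fun h' => by have := congrArg Complex.im h'; simp at this
  by_cases hji : j = i
  · rw [hji] at h ⊢
    have hli : l ≠ i := fun hl => h ⟨rfl, hl⟩
    have hil : i ≠ l := fun h => hli h.symm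
    -- U_ii² Ū_ii Ū_ll: twist (i, l): I·I·conj(I)·conj(−I) = −1
    refine integral_diag4_eq_zero ρ hρ hil i i i l (-1) (by norm_num) ?_
    simp [hli, Complex.conj_I]
  · have hij : i ≠ j := fun h => hji h.symm
    by_cases hlj : l = j
    · rw [hlj]
      -- U_ii² Ū_jj²: twist (i, m) with a spare index m ∉ {i, j}
      obtain ⟨m, hmi, hmj⟩ := exists_third hn i j
      have him : i ≠ m := fun h => hmi h.symm
      have hjm : j ≠ m := fun h => hmj h.symm
      refine integral_diag4_eq_zero ρ hρ him i i j j (-1) (by norm_num) ?_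
      simp [hji, hjm, Complex.I_mul_I]
    · have hjl : j ≠ l := fun h => hlj h.symm
      by_cases hli : l = i
      · rw [hli]
        -- U_ii² Ū_jj Ū_ii with j ≠ i: twist (i, j): I·I·conj(−I)·conj(I) = −1
        refine integral_diag4_eq_zero ρ hρ hij i i j i (-1) (by norm_num) ?_
        simp [hji, Complex.conj_I]
      · have hil : i ≠ l := fun h => hli h.symm
        -- U_ii² Ū_jj Ū_ll, j, l ≠ i, l ≠ j: twist (i, j): I·I·conj(−I)·1 = −I
        refine integral_diag4_eq_zero ρ hρ hij i i j l (-Complex.I) hnI ?_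
        simp [hji, hli, hlj, Complex.conj_I]

/-- **The off-diagonal case `i ≠ k`**: `∫ U_ii U_kk Ū_jj Ū_ll = 0` unless `(j, l) ∈ {(i, k), (k, i)}`. [cite: CollinsSniady2006, Cor. 2.4 (invariant integration on U(N)/SU(N): low-degree Haar moments; bookkeeping)] -/
theorem integral_diag4_eq_zero_of_ne (hρ : IsSpecialUnitaryModel ρ) {i k : Fin (2 + n)} (hik : i ≠ k) (j l : Fin (2 + n))
    (h1 : ¬(j = i ∧ l = k)) (h2 : ¬(j = k ∧ l = i)) : ∫ g, ((ρ g) i i * (ρ g) k k * (starRingEnd ℂ) ((ρ g) j j) * (starRingEnd ℂ) ((ρ g) l l)) ∂haarProbability G = 0 := by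
  have hI : (Complex.I : ℂ) ≠ 1 := fun h' => by have := congrArg Complex.im h'; simp at this
  have hnI : (-Complex.I : ℂ) ≠ 1 := fun h' => by have := congrArg Complex.im h'; simp at this
  have hki : k ≠ i := fun h => hik h.symm
  by_cases hji : j = i
  · rw [hji] at h1 h2 ⊢
    have hlk : l ≠ k := fun hl => h1 ⟨rfl, hl⟩
    have hkl : k ≠ l := fun h => hlk h.symm
    by_cases hli : l = i
    · rw [hli]
      -- U_ii U_kk Ū_ii Ū_ii: twist (k, i): tc_i = −I, tc_k = I ⇒ (−I)(I)(I)(I) = −1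
      refine integral_diag4_eq_zero ρ hρ hki i k i i (-1) (by norm_num) ?_
      simp [hik, Complex.conj_I]
    · have hil : i ≠ l := fun h => hli h.symm
      -- U_ii U_kk Ū_ii Ū_ll, l ∉ {i, k}: twist (k, l): tc_i = 1, tc_k = I, conj(tc_l) = conj(−I) = I ⇒ −1
      refine integral_diag4_eq_zero ρ hρ hkl i k i l (-1) (by norm_num) ?_
      simp [hik, hil, hlk, Complex.conj_I]
  · have hij : i ≠ j := fun h => hji h.symm
    by_cases hjk : j = k
    · rw [hjk] at h1 h2 ⊢
      have hli : l ≠ i := fun hl => h2 ⟨rfl, hl⟩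
      have hil : i ≠ l := fun h => hli h.symm
      by_cases hlk : l = k
      · rw [hlk]
        -- U_ii U_kk Ū_kk Ū_kk: twist (i, k): I·(−I)·(I)·(I) = −1
        refine integral_diag4_eq_zero ρ hρ hik i k k k (-1) (by norm_num) ?_
        simp [hki, Complex.conj_I]
      · have hkl : k ≠ l := fun h => hlk h.symm
        -- U_ii U_kk Ū_kk Ū_ll, l ∉ {i, k}: twist (i, l): I·1·1·conj(−I) = −1
        refine integral_diag4_eq_zero ρ hρ hil i k k l (-1) (by norm_num) ?_
        simp [hki, hli, hkl, Complex.conj_I]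
    · have hkj : k ≠ j := fun h => hjk h.symm
      -- j ∉ {i, k}: twist (i, j): tc_i = I, tc_k = 1, conj(tc_j) = I, conj(tc_l) ∈ {−I, I, 1}
      by_cases hli : l = i
      · rw [hli]
        refine integral_diag4_eq_zero ρ hρ hij i k j i Complex.I hI ?_
        simp [hki, hji, hkj, Complex.conj_I]
      · have hil : i ≠ l := fun h => hli h.symm
        by_cases hlj : l = j
        · rw [hlj]
          refine integral_diag4_eq_zero ρ hρ hij i k j j (-Complex.I) hnI ?_
          simp [hki, hji, hkj, Complex.conj_I]
        · have hjl : j ≠ l := fun h => hlj h.symm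
          refine integral_diag4_eq_zero ρ hρ hij i k j l (-1) (by norm_num) ?_
          simp [hki, hji, hkj, hli, hlj, Complex.conj_I]

/-- **Simultaneous signed swap of rows and columns**: `|((T M) T)_{rc}| = |M_{σr σc}|` for the signed transposition
`T` of `a ≠ b` and `σ = (a b)`. [cite: CollinsSniady2006, Cor. 2.4 (invariant integration on U(N)/SU(N): low-degree Haar moments; bookkeeping)] -/
theorem normSq_conj_swap {a b : Fin (2 + n)} (hab : a ≠ b) (M : Matrix (Fin (2 + n)) (Fin (2 + n)) ℂ) (r c : Fin (2 + n)) :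
    Complex.normSq ((Matrix.swap ℂ a b * Matrix.diagonal (Pi.mulSingle a (-1 : ℂ)) * M *
        (Matrix.swap ℂ a b * Matrix.diagonal (Pi.mulSingle a (-1 : ℂ)))) r c) =
      Complex.normSq (M (Equiv.swap a b r) (Equiv.swap a b c)) := by
  set T : Matrix (Fin (2 + n)) (Fin (2 + n)) ℂ := Matrix.swap ℂ a b * Matrix.diagonal (Pi.mulSingle a (-1 : ℂ)) with hT
  have hrow : ∀ (X : Matrix (Fin (2 + n)) (Fin (2 + n)) ℂ) (r c : Fin (2 + n)),
      Complex.normSq ((T * X) r c) = Complex.normSq (X (Equiv.swap a b r) c) := by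
    intro X r c
    rw [hT, Matrix.mul_assoc]
    by_cases hra : r = a
    · rw [hra, Matrix.swap_mul_apply_left, Matrix.diagonal_mul, Equiv.swap_apply_left]
      simp [Pi.mulSingle_eq_of_ne hab.symm]
    · by_cases hrb : r = b
      · rw [hrb, Matrix.swap_mul_apply_right, Matrix.diagonal_mul, Equiv.swap_apply_right]
        simp
      · rw [Matrix.swap_mul_of_ne hra hrb, Matrix.diagonal_mul, Equiv.swap_apply_of_ne_of_ne hra hrb]
        simp [Pi.mulSingle_eq_of_ne hra]
  have hcol : ∀ (X : Matrix (Fin (2 + n)) (Fin (2 + n)) ℂ) (r c : Fin (2 + n)),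
      Complex.normSq ((X * T) r c) = Complex.normSq (X r (Equiv.swap a b c)) := by
    intro X r c
    rw [hT, ← Matrix.mul_assoc, Matrix.mul_diagonal]
    by_cases hca : c = a
    · rw [hca, Matrix.mul_swap_apply_left, Equiv.swap_apply_left]; simp
    · by_cases hcb : c = b
      · rw [hcb, Matrix.mul_swap_apply_right, Equiv.swap_apply_right]; simp [Pi.mulSingle_eq_of_ne hab.symm]
      · rw [Matrix.mul_swap_of_ne hca hcb, Equiv.swap_apply_of_ne_of_ne hca hcb]
        simp [Pi.mulSingle_eq_of_ne hca]
  rw [hcol (T * M) r c, hrow M r]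

/-- `∫ |U_pp|²|U_qq|² = ∫ |U_{σp σp}|²|U_{σq σq}|²` for `σ = (a b)`, `a ≠ b` (conjugation invariance of Haar measure by the signed
transposition). [cite: CollinsSniady2006, Cor. 2.4 (invariant integration on U(N)/SU(N): low-degree Haar moments; bookkeeping)] -/
theorem integral_normSq_diag_mul_swap (hρ : IsSpecialUnitaryModel ρ) {a b : Fin (2 + n)} (hab : a ≠ b) (p q : Fin (2 + n)) :
    ∫ g, Complex.normSq (ρ g p p) * Complex.normSq (ρ g q q) ∂haarProbability G =
      ∫ g, Complex.normSq (ρ g (Equiv.swap a b p) (Equiv.swap a b p)) *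
        Complex.normSq (ρ g (Equiv.swap a b q) (Equiv.swap a b q)) ∂haarProbability G := by
  have hTm : Matrix.swap ℂ a b * Matrix.diagonal (Pi.mulSingle a (-1 : ℂ)) ∈ Matrix.specialUnitaryGroup (Fin (2 + n)) ℂ :=
    RobustBall.HaarSecondMoments.swap_mul_sign_mem a b hab
  have h := RobustBall.HaarSecondMoments.integral_comp_mul_left ρ hρ hTm
    (fun M => Complex.normSq ((M * (Matrix.swap ℂ a b * Matrix.diagonal (Pi.mulSingle a (-1 : ℂ)))) p p) *
      Complex.normSq ((M * (Matrix.swap ℂ a b * Matrix.diagonal (Pi.mulSingle a (-1 : ℂ)))) q q))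
  have h' := RobustBall.HaarSecondMoments.integral_comp_mul_right ρ hρ hTm
    (fun M => Complex.normSq (M p p) * Complex.normSq (M q q))
  beta_reduce at h h'
  rw [← h', ← h]
  simp_rw [normSq_conj_swap hab]

/-- `∫ |U_ii|⁴ = ∫ |U₀₀|⁴` for every `i`. [cite: CollinsSniady2006, Cor. 2.4 (invariant integration on U(N)/SU(N): low-degree Haar moments; bookkeeping)] -/
theorem integral_normSq_diag_sq_eq (hρ : IsSpecialUnitaryModel ρ) (i : Fin (2 + n)) :
    ∫ g, Complex.normSq (ρ g i i) ^ 2 ∂haarProbability G = ∫ g, Complex.normSq (ρ g 0 0) ^ 2 ∂haarProbability G := by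
  rcases eq_or_ne i 0 with rfl | hi0
  · rfl
  have h := integral_normSq_diag_mul_swap ρ hρ hi0.symm i i
  rw [Equiv.swap_apply_right] at h
  simp_rw [← pow_two] at h
  exact h

/-- `∫ |U_ii|²|U_kk|² = ∫ |U₀₀|²|U₁₁|²` for every `i ≠ k`. [cite: CollinsSniady2006, Cor. 2.4 (invariant integration on U(N)/SU(N): low-degree Haar moments; bookkeeping)] -/
theorem integral_normSq_diag_mul_eq (hρ : IsSpecialUnitaryModel ρ) {i k : Fin (2 + n)} (hik : i ≠ k) :
    ∫ g, Complex.normSq (ρ g i i) * Complex.normSq (ρ g k k) ∂haarProbability G =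
      ∫ g, Complex.normSq (ρ g 0 0) * Complex.normSq (ρ g 1 1) ∂haarProbability G := by
  have h10 : (1 : Fin (2 + n)) ≠ 0 := one_ne_zero_fin
  -- step 1: move i to 0
  have step1 : ∀ {i k : Fin (2 + n)}, i ≠ k →
      ∃ k' : Fin (2 + n), k' ≠ 0 ∧ ∫ g, Complex.normSq (ρ g i i) * Complex.normSq (ρ g k k) ∂haarProbability G =
        ∫ g, Complex.normSq (ρ g 0 0) * Complex.normSq (ρ g k' k') ∂haarProbability G := by
    intro i k hik
    rcases eq_or_ne i 0 with rfl | hi0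
    · exact ⟨k, hik.symm, rfl⟩
    refine ⟨Equiv.swap 0 i k, ?_, ?_⟩
    · intro h0
      exact hik ((Equiv.swap (0 : Fin (2 + n)) i).injective (h0.trans (Equiv.swap_apply_right 0 i).symm)).symm
    · rw [integral_normSq_diag_mul_swap ρ hρ hi0.symm i k, Equiv.swap_apply_right]
  -- step 2: with i = 0, move k' to 1 by the swap (1 k') fixing 0
  obtain ⟨k', hk', e⟩ := step1 hik
  rw [e]
  rcases eq_or_ne k' 1 with rfl | hk1
  · rfl
  rw [integral_normSq_diag_mul_swap ρ hρ hk1.symm 0 k', Equiv.swap_apply_of_ne_of_ne h10.symm hk'.symm,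
    Equiv.swap_apply_right]

/-- The inner double sum for `i = k`: only `j = l = i` survives, giving `∫|U₀₀|⁴`. [cite: CollinsSniady2006, Cor. 2.4 (invariant integration on U(N)/SU(N): low-degree Haar moments; bookkeeping)] -/
theorem sum_diag4_eq (hρ : IsSpecialUnitaryModel ρ) (hn : 1 ≤ n) (i : Fin (2 + n)) :
    ∑ j, ∑ l, ∫ g, ((ρ g) i i * (ρ g) i i * (starRingEnd ℂ) ((ρ g) j j) * (starRingEnd ℂ) ((ρ g) l l)) ∂haarProbability G = ((∫ g, Complex.normSq (ρ g 0 0) ^ 2 ∂haarProbability G : ℝ) : ℂ) := by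
  rw [Finset.sum_eq_single i (fun j _ hj => Finset.sum_eq_zero fun l _ =>
      integral_diag4_eq_zero_of_eq ρ hρ hn i j l fun h => hj h.1) (fun h => absurd (Finset.mem_univ i) h),
    Finset.sum_eq_single i (fun l _ hl => integral_diag4_eq_zero_of_eq ρ hρ hn i i l fun h => hl h.2)
      (fun h => absurd (Finset.mem_univ i) h)]
  have hpt : ∀ g : G, ((ρ g) i i * (ρ g) i i * (starRingEnd ℂ) ((ρ g) i i) * (starRingEnd ℂ) ((ρ g) i i)) = ((Complex.normSq (ρ g i i) ^ 2 : ℝ) : ℂ) := fun g => by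
    push_cast
    rw [← Complex.mul_conj]
    ring
  simp_rw [hpt]
  rw [integral_complex_ofReal, integral_normSq_diag_sq_eq ρ hρ i]

/-- The inner double sum for `i ≠ k`: only `(j,l) = (i,k), (k,i)` survive, giving `2 ∫|U₀₀|²|U₁₁|²`. [cite: CollinsSniady2006, Cor. 2.4 (invariant integration on U(N)/SU(N): low-degree Haar moments; bookkeeping)] -/
theorem sum_diag4_ne (hρ : IsSpecialUnitaryModel ρ) {i k : Fin (2 + n)} (hik : i ≠ k) :
    ∑ j, ∑ l, ∫ g, ((ρ g) i i * (ρ g) k k * (starRingEnd ℂ) ((ρ g) j j) * (starRingEnd ℂ) ((ρ g) l l)) ∂haarProbability G =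
      2 * ((∫ g, Complex.normSq (ρ g 0 0) * Complex.normSq (ρ g 1 1) ∂haarProbability G : ℝ) : ℂ) := by
  have hki : k ≠ i := fun h => hik h.symm
  -- the j-sum is supported on {i, k}
  have hsupp : ∀ j ∈ (Finset.univ : Finset (Fin (2 + n))), j ∉ ({i, k} : Finset (Fin (2 + n))) →
      ∑ l, ∫ g, ((ρ g) i i * (ρ g) k k * (starRingEnd ℂ) ((ρ g) j j) * (starRingEnd ℂ) ((ρ g) l l)) ∂haarProbability G = 0 := by
    intro j _ hj
    have hji : j ≠ i := fun h => hj (by simp [h])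
    have hjk : j ≠ k := fun h => hj (by simp [h])
    exact Finset.sum_eq_zero fun l _ => integral_diag4_eq_zero_of_ne ρ hρ hik j l (fun h => hji h.1) (fun h => hjk h.1)
  rw [← Finset.sum_subset (Finset.subset_univ ({i, k} : Finset (Fin (2 + n)))) hsupp, Finset.sum_pair hik]
  -- j = i: only l = k survives; j = k: only l = i survives
  rw [Finset.sum_eq_single k (fun l _ hl => integral_diag4_eq_zero_of_ne ρ hρ hik i l (fun h => hl h.2)
      (fun h => hik h.1)) (fun h => absurd (Finset.mem_univ k) h),
    Finset.sum_eq_single i (fun l _ hl => integral_diag4_eq_zero_of_ne ρ hρ hik k l (fun h => hki h.1)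
      (fun h => hl h.2)) (fun h => absurd (Finset.mem_univ i) h)]
  have hpt1 : ∀ g : G, ((ρ g) i i * (ρ g) k k * (starRingEnd ℂ) ((ρ g) i i) * (starRingEnd ℂ) ((ρ g) k k)) = ((Complex.normSq (ρ g i i) * Complex.normSq (ρ g k k) : ℝ) : ℂ) := fun g => by
    push_cast
    rw [← Complex.mul_conj, ← Complex.mul_conj]
    ring
  have hpt2 : ∀ g : G, ((ρ g) i i * (ρ g) k k * (starRingEnd ℂ) ((ρ g) k k) * (starRingEnd ℂ) ((ρ g) i i)) = ((Complex.normSq (ρ g i i) * Complex.normSq (ρ g k k) : ℝ) : ℂ) := fun g => by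
    push_cast
    rw [← Complex.mul_conj, ← Complex.mul_conj]
    ring
  simp_rw [hpt1, hpt2]
  rw [integral_complex_ofReal, integral_normSq_diag_mul_eq ρ hρ hik, ← two_mul]

/-- ★★ **`∫ |tr ρ(g)|⁴ dg = 2` for every compact group `G ≅ SU(N)`, `N ≥ 3`** — the fourth moment of the fundamental character is
that of a standard complex Gaussian (the number of invariants in `V⊗V⊗V̄⊗V̄`). [cite: CollinsSniady2006, Cor. 2.4 (invariant integration on U(N)/SU(N): low-degree Haar moments; bookkeeping)] -/
theorem integral_normSq_trace_sq (hρ : IsSpecialUnitaryModel ρ) (hn : 1 ≤ n) :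
    ∫ g, Complex.normSq (ρ g).trace ^ 2 ∂haarProbability G = 2 := by
  -- complex form: |tr|⁴ = Σ_{i,k,j,l} 𝔪 i k j l
  have hexp : ∀ g : G, (((Complex.normSq (ρ g).trace ^ 2 : ℝ)) : ℂ) = ∑ i, ∑ k, ∑ j, ∑ l, ((ρ g) i i * (ρ g) k k * (starRingEnd ℂ) ((ρ g) j j) * (starRingEnd ℂ) ((ρ g) l l)) := by
    intro g
    have hz : (ρ g).trace * (starRingEnd ℂ) (ρ g).trace = ∑ i, ∑ j, ρ g i i * (starRingEnd ℂ) (ρ g j j) := by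
      rw [Matrix.trace, map_sum, Finset.sum_mul_sum]
      rfl
    rw [Complex.ofReal_pow, ← Complex.mul_conj, pow_two, hz, Finset.sum_mul_sum]
    refine Finset.sum_congr rfl fun i _ => Finset.sum_congr rfl fun k _ => ?_
    rw [Finset.sum_mul_sum]
    refine Finset.sum_congr rfl fun j _ => Finset.sum_congr rfl fun l _ => ?_
    ring
  have hC : ((∫ g, Complex.normSq (ρ g).trace ^ 2 ∂haarProbability G : ℝ) : ℂ) = 2 := by
    rw [← integral_complex_ofReal]
    simp_rw [hexp]
    rw [integral_finsetSum _ (fun i _ => integrable_finsetSum _ fun k _ => integrable_finsetSum _ fun j _ =>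
      integrable_finsetSum _ fun l _ => integrable_diag4 ρ hρ.1 i k j l)]
    have hin1 : ∀ i : Fin (2 + n), ∫ g, ∑ k, ∑ j, ∑ l, ((ρ g) i i * (ρ g) k k * (starRingEnd ℂ) ((ρ g) j j) * (starRingEnd ℂ) ((ρ g) l l)) ∂haarProbability G =
        ∑ k, ∑ j, ∑ l, ∫ g, ((ρ g) i i * (ρ g) k k * (starRingEnd ℂ) ((ρ g) j j) * (starRingEnd ℂ) ((ρ g) l l)) ∂haarProbability G := by
      intro i
      rw [integral_finsetSum _ (fun k _ => integrable_finsetSum _ fun j _ =>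
        integrable_finsetSum _ fun l _ => integrable_diag4 ρ hρ.1 i k j l)]
      refine Finset.sum_congr rfl fun k _ => ?_
      rw [integral_finsetSum _ (fun j _ => integrable_finsetSum _ fun l _ => integrable_diag4 ρ hρ.1 i k j l)]
      refine Finset.sum_congr rfl fun j _ => ?_
      rw [integral_finsetSum _ (fun l _ => integrable_diag4 ρ hρ.1 i k j l)]
    simp_rw [hin1]
    -- split k = i / k ≠ i
    have hinner : ∀ i : Fin (2 + n), ∑ k, ∑ j, ∑ l, ∫ g, ((ρ g) i i * (ρ g) k k * (starRingEnd ℂ) ((ρ g) j j) * (starRingEnd ℂ) ((ρ g) l l)) ∂haarProbability G =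
        ((∫ g, Complex.normSq (ρ g 0 0) ^ 2 ∂haarProbability G : ℝ) : ℂ) +
          (1 + n : ℂ) * (2 * ((∫ g, Complex.normSq (ρ g 0 0) * Complex.normSq (ρ g 1 1) ∂haarProbability G : ℝ) : ℂ)) := by
      intro i
      rw [← Finset.add_sum_erase _ _ (Finset.mem_univ i), sum_diag4_eq ρ hρ hn i]
      congr 1
      rw [Finset.sum_congr rfl (fun k hk => sum_diag4_ne ρ hρ (Finset.ne_of_mem_erase hk).symm), Finset.sum_const,
        Finset.card_erase_of_mem (Finset.mem_univ _), Finset.card_univ, Fintype.card_fin, nsmul_eq_mul]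
      congr 1
      rw [show 2 + n - 1 = 1 + n by omega]; push_cast; ring
    simp_rw [hinner]
    rw [Finset.sum_const, Finset.card_univ, Fintype.card_fin, nsmul_eq_mul, integral_normSq_sq ρ hρ hn,
      integral_normSq_mul_normSq_diag ρ hρ hn]
    have h2 : (2 + n : ℂ) ≠ 0 := by exact_mod_cast (show (2 + n : ℕ) ≠ 0 by omega)
    have h3 : (3 + n : ℂ) ≠ 0 := by exact_mod_cast (show (3 + n : ℕ) ≠ 0 by omega)
    have h1 : (1 + n : ℂ) ≠ 0 := by exact_mod_cast (show (1 + n : ℕ) ≠ 0 by omega)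
    push_cast
    field_simp
    ring
  exact_mod_cast hC

end Moments

/-! ### The concrete group `SU(N)`, `N ≥ 3` -/

/-- ★★ **`∫_{SU(N)} |tr U|⁴ dU = 2`** for every `N ≥ 3`, in the venture's vocabulary. [cite: CollinsSniady2006, Cor. 2.4 (invariant integration on U(N)/SU(N): low-degree Haar moments; bookkeeping)] -/
theorem integral_normSq_trace_sq_suN {N : ℕ} (hN : 3 ≤ N) :
    ∫ U, Complex.normSq (U : Matrix (Fin N) (Fin N) ℂ).trace ^ 2 ∂haarProbability (Matrix.specialUnitaryGroup (Fin N) ℂ) = 2 := by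
  obtain ⟨n, rfl⟩ := Nat.exists_eq_add_of_le (show 2 ≤ N by omega)
  have h := integral_normSq_trace_sq (n := n) (fundamentalRep (Fin (2 + n)))
    (TorusAreaLaw.isSpecialUnitaryModel_fundamentalRep (2 + n)) (by omega)
  simpa only [fundamentalRep_apply] using h

end Literature.MathematicalPhysics.QuantumFieldTheory.HaarMoments.HaarFourthMomentSUN

end Part10

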